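import Literature.NumberTheory.LFunctions.FreitasLiHalfPlanes
import Literature.NumberTheory.LFunctions.KeiperLiZeroSum
import Literature.NumberTheory.LFunctions.KeiperLiAsymptoticCriteriaProofs
import Literature.NumberTheory.LFunctions.RiemannXiLogDeriv
import Mathlib.Analysis.Analytic.Binomial
import HarnessLib

/-!
# Freitas' Li-type criterion — proofs (discharges of `FreitasLiHalfPlanes.lean`)

LABEL (line 1): **RH-FREE** theorems (sibling proofs file of
`Literature/NumberTheory/LFunctions/FreitasLiHalfPlanes.lean`; P. Freitas, J. London Math. Soc. (2)
73 (2006) 399–414 = arXiv:math/0507368).  bears_on: LADDER-RH L-C/L-P (COLUMN 4, LI).  WHAT THIS IS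
NOT: none of the theorems below is worded as, or is, progress toward RH; the `τ = 1` instance of
Theorem 1 is Li's criterion (RH re-indexed) and is NOT proved here in the RH direction; nothing here
bears on the truth of RH.

## Contents

* `Freitas2006_thm_2_2_holds` — Theorem 2.2 (signs of the derivatives of `ξ` on the real axis), by
  the Taylor expansion of the entire function `ξ⁽ʲ⁾` about `1/2` (the road of the tree's
  `iteratedDeriv_riemannXi_one_nonneg`): the odd derivatives vanish at `1/2`
  (`iteratedDeriv_riemannXi_half_odd`) and the even ones are positive there
  (`iteratedDeriv_two_mul_riemannXi_half_pos`).
* `Freitas2006_thm_2_i_holds` — Theorem 2 (i), `α_n(0) = n ξ'(0)/ξ(0) < 0` (Leibniz' rule at `s = 0`;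
  the sign from Theorem 2.2).
* `riemannZeta_ne_zero_of_freitasAlpha_nonneg` — the "if" half of Theorem 1 for every `τ ≥ 1/2`:
  `α_n(τ) ≥ 0 ∀ n ≥ 1 ⟹ ζ ≠ 0` on `Re s > τ/2`.  Freitas (§3, p. 7) follows Li's proof; so do we,
  through the tree's abstract form of it, `li_lemma_ne_zero`, applied to `f(w) = ξ(τ/(1−w))` on the
  unit disc: its Taylor coefficients at `0` are `≥ 0` (Faà di Bruno, `ξ⁽ⁱ⁾(τ) ≥ 0` for `τ ≥ 1/2` by
  Theorem 2.2, `dⁱ[τ/(1−w)](0) = τ·i!`), and `dᵏ[log f](0) = τ (k−1)! α_k(τ)` by Li's change of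
  variables `iteratedDeriv_pow_mul_eq_iteratedDeriv_comp_liMap` transported from `s = 1` to `s = τ`
  by the scaling `s ↦ τ s` (`iteratedDeriv_pow_mul_eq_comp_liMap_scaled`); finally
  `|1 − τ/s| < 1 ⟺ Re s > τ/2`.
* `Freitas2006_lemma_3_1_i_holds` — Lemma 3.1 (i), the zero-sum form
  `α_n(τ) = (1/τ) Σ_ρ m(ρ) Re[1 − (ρ/(ρ−τ))ⁿ]` (`τ ≠ 0`), with its absolute convergence
  (`summable_freitasTerm`, Bombieri–Lagarias' weight bound for the rescaled family `ρ/τ`): the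
  tree's Hadamard-product machinery for `keiperLiCoeff_eq_zero_sum_holds`
  (`EquivalentsKeiperLiProofs.lean`) transported from `s = 1` to `s = τ` — termwise differentiation
  of the partial-fraction series of `ξ'/ξ` near a zero-free point
  (`IsHadamardSeq.hasSum_iteratedDeriv_term_at`), Leibniz and the binomial identity of
  (alphaexpderiv) (`IsHadamardSeq.hasSum_freitas_pairs`), multiplicities via
  `IsHadamardSeq.finsum_liZeroBox_eq_sum`, and identification of the box limits with the `tsum`.
* `Freitas2006_thm_1_holds` — Theorem 1 in full for every `τ ≥ 1/2` (the "only if" half,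
  `freitasAlpha_nonneg_of_riemannZeta_ne_zero`, holds for every `τ > 0`: termwise
  `|ρ/(ρ−τ)| ≤ 1 ⟺ Re ρ ≤ τ/2`); the RH-FREE rung `freitasAlpha_nonneg_of_two_le` (`τ ≥ 2`);
  `Freitas2006_alpha_eq_F_holds` (`α_n = F(n,·)`).
* `Freitas2006_lemma_3_1_ii_holds` — Lemma 3.1 (ii), `d_{n−1}(1−1/τ) = τ^{n+1} α_n(τ)` (the scaled
  Li identity read in the variable `z = z₀ + w/τ`); `Freitas2006_xi_half_holds` (the constant
  `ξ(1/2)`); `Freitas2006_thm_4_3_holds` (the ODE system, by Leibniz from (dcoeff):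
  `d^{n+1}[s·g] = s g^{(n+1)} + (n+1) g^{(n)}`) and `Freitas2006_lemma_4_4_holds` (FTC).
* §2: `Freitas2006_lemma_2_1_holds` (re-expansion inside the disc,
  `Complex.hasSum_taylorSeries_on_ball`), `Freitas2006_thm_2_3_holds` (`φ⁽ⁿ⁾(−1) > 0`, `n ≥ 2`: Faà
  di Bruno at `−1`, a partition with an even number of blocks), `Freitas2006_cor_2_4_holds`
  (`c_n > 0` on `(−1,1)`), `Freitas2006_cor_2_7_holds` (`c_n' = (n+1) c_{n+1} > 0`).
* `Freitas2006_recurrence_holds` (the recurrence (recurr), Leibniz on `φ' = φψ`),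
  `Freitas2006_thm_2_iii_holds` (Rolle for `t^{n+1}α_n`, via the ODE system),
  `Freitas2006_thm_2_ii_holds` (the sequence `a_n`: least zero of `α_{n+1}` in `(0, a_n)`, via
  Lemma 4.4 and the intermediate value theorem), `Freitas2006_prop_4_1_holds` (Proposition 4.1 as
  proved: Li's lemma for `e^{G(w)} ξ(τ/(1−w))`, `G = Σ γ_{k−1}τ^{−k}wᵏ/k`),
  `Freitas2006_cor_4_2_holds` (finitely supported correction).
* `Freitas2006_thm_2_8_false` — Theorem 2.8 AS PRINTED is false (its second clause contradicts
  Theorem 2.3 at `z₀ = −1`, `n = 2`); the first clause is proved as `freitasC_sub_pos`, together with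
  `Freitas2006_thm_2_9_holds` (`c_n(z₀) → ∞`), from the expansion
  `(1−z)φ(z) = s₀(1−z) + Σ_{m≥1} s_m zᵐ (1−z)^{1−m}` (`hasSum_one_sub_mul_liPhi`,
  `freitasC_zero_sub_ge`: `a_n − a_{n−1} ≥ ξ''(1)/2`); `Freitas2006_thm_2_8_pos_holds`.
* `Freitas2006_ell_coeff_holds` — the Taylor coefficients `ℓ_k` of `ξ'/ξ` at `0` (proof of Cor 5.3),
  from the tree's arithmetic formula (`Xiao2020.logXiTaylorCoeff_succ`, `Coffey2005_thm1_holds`,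
  `liEta_eq_neg_re_zetaOneLogDerivCoeff`) and `ξ'/ξ(1−s) = −ξ'/ξ(s)`.
* `freitasF_zero_left` (`F(0,τ) = 0`), `strictMonoOn_re_riemannXi`, `re_riemannXi_lt_half_iff`,
  `log_two_mul_re_riemannXi_div_neg/pos` (the sign of `log(2ξ(τ))/τ`, p0010:L33–36),
  `tsum_zeroOrder_mul_log_norm` (`Σ_ρ m(ρ) log|1 − τ/ρ| = log(2ξ(τ))`, absolutely convergent),
  `hasDerivAt_freitasF_zero` (`∂F/∂x(0,τ) = log(2ξ(τ))/τ`, termwise differentiation of the zero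
  sum) and `Freitas2006_F_at_zero_holds`.
* `Freitas2006_cor_5_2_holds` — Corollary 5.2 (`F(−p,τ)` is the polynomial
  `Σ_{k<p} ℓ_k/(k+1)! Π_{j≤k}(j−p) τᵏ`): finite binomial expansion of each term and the real power
  sums `Σ_ρ m(ρ) Re ρ^{−k} = Re σ_k = −ℓ_{k−1}` (`re_zetaZeroPowerSum_eq_tsum`,
  `freitasEllCoeff_zero_eq_neg_re_zetaZeroPowerSum`, from the tree's `zetaZeroPowerSum_succ_eq`).
* `Freitas2006_thm_5_1_holds` — Theorem 5.1 (`F(x,τ) = Σ_k ℓ_k/(k+1)! x(x+1)⋯(x+k) τᵏ` for real `x`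
  and `|τ| < |ρ|` for all zeros): the binomial series of each zero (`hasSum_inv_one_sub_cpow`, from
  Mathlib's `Complex.one_div_one_sub_cpow_hasFPowerSeriesOnBall_zero`), absolute convergence of the
  double family (`|τ| ≤ s|ρ|` with `s < 1`, `exists_ratio_lt_one`; the `k = 1` row through
  `Re(1/ρ) = Re ρ/|ρ|²`) and `HasSum.prod_fiberwise` in both orders.

## References

* P. Freitas, J. London Math. Soc. (2) 73 (2006) 399–414, Thm 1, Thm 2, §§2–5.
  [Freitas2006LiHalfPlanes]
* X.-J. Li, J. Number Theory 65 (1997) 325–333 (the method). [Li1997]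
-/

noncomputable section

open Complex Filter Set Metric
open scoped Nat Topology ComplexOrder ComplexConjugate

namespace Literature.NumberTheory.LFunctions

/-! ## Theorem 2.2: signs of the derivatives of `ξ` on the real axis -/

/-- Taylor expansion of `ξ⁽ʲ⁾` about `1/2` at a real point, real parts:
`Re ξ⁽ʲ⁾(z) = Σ_i (z − 1/2)ⁱ/i! · Re ξ⁽ʲ⁺ⁱ⁾(1/2)` (the series (xiseries) of the proof of Thm 2.2,
differentiated). [cite: Freitas2006LiHalfPlanes, proof of Theorem 2.2, eq. (xiseries)] -/
theorem hasSum_re_iteratedDeriv_riemannXi (j : ℕ) (z : ℝ) :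
    HasSum (fun i : ℕ ↦ (z - 1 / 2) ^ i / i ! * (iteratedDeriv (i + j) riemannXi (1 / 2)).re)
      (iteratedDeriv j riemannXi z).re := by
  have hdiff : Differentiable ℂ (iteratedDeriv j riemannXi) :=
    differentiable_riemannXi.contDiff.differentiable_iteratedDeriv' j
  have H := (Complex.hasSum_taylorSeries_of_entire hdiff (1 / 2) z).mapL Complex.reCLM
  simp only [Complex.reCLM_apply] at H
  convert H using 2 with i
  rw [iteratedDeriv_iteratedDeriv, smul_eq_mul, smul_eq_mul, ← mul_assoc,
    show ((i ! : ℂ))⁻¹ * ((z : ℂ) - 1 / 2) ^ i = (((z - 1 / 2) ^ i / i ! : ℝ) : ℂ) by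
      push_cast; ring, Complex.re_ofReal_mul]

/-- The derivatives of `ξ` at `1/2` are real with the even ones positive and the odd ones zero
(tree: `iteratedDeriv_two_mul_riemannXi_half_pos`, `iteratedDeriv_riemannXi_half_odd`).
[folklore] -/
private theorem re_iteratedDeriv_riemannXi_half (k : ℕ) :
    (Even k → 0 < (iteratedDeriv k riemannXi (1 / 2)).re) ∧
      (Odd k → iteratedDeriv k riemannXi (1 / 2) = 0) := by
  constructor
  · rintro ⟨m, rfl⟩
    rw [← two_mul]
    exact (iteratedDeriv_two_mul_riemannXi_half_pos m).1
  · rintro ⟨m, rfl⟩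
    exact iteratedDeriv_riemannXi_half_odd m

/-- **Freitas 2006, Theorem 2.2** — DISCHARGED: even derivatives of `ξ` are positive at every real
point, odd derivatives are positive to the right of `1/2` and negative to the left (Taylor expansion
about `1/2`, where the odd derivatives vanish and the even ones are positive).
[cite: Freitas2006LiHalfPlanes, Theorem 2.2] -/
theorem Freitas2006_thm_2_2_holds : Freitas2006_thm_2_2 := by
  intro z m
  refine ⟨?_, ?_, ?_⟩
  · -- even order `2m`: all terms `≥ 0`, the `i = 0` term `> 0`
    have H := hasSum_re_iteratedDeriv_riemannXi (2 * m) z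
    have hnn : ∀ i, 0 ≤ (z - 1 / 2) ^ i / i ! * (iteratedDeriv (i + 2 * m) riemannXi (1 / 2)).re := by
      intro i
      rcases Nat.even_or_odd i with hi | hi
      · exact mul_nonneg (div_nonneg (hi.pow_nonneg _) (Nat.cast_nonneg _))
          ((re_iteratedDeriv_riemannXi_half _).1 (hi.add (even_two_mul m))).le
      · rw [(re_iteratedDeriv_riemannXi_half _).2 (hi.add_even (even_two_mul m)),
          Complex.zero_re, mul_zero]
    have h0 : 0 < (z - 1 / 2) ^ 0 / (0 ! : ℕ) * (iteratedDeriv (0 + 2 * m) riemannXi (1 / 2)).re := by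
      simp only [pow_zero, Nat.factorial_zero, Nat.cast_one, div_one, one_mul, zero_add]
      exact (re_iteratedDeriv_riemannXi_half _).1 (even_two_mul m)
    exact hasSum_lt hnn h0 hasSum_zero H
  · intro hz
    have H := hasSum_re_iteratedDeriv_riemannXi (2 * m + 1) z
    have hz' : 0 < z - 1 / 2 := by linarith
    have hnn : ∀ i, 0 ≤ (z - 1 / 2) ^ i / i ! *
        (iteratedDeriv (i + (2 * m + 1)) riemannXi (1 / 2)).re := by
      intro i
      rcases Nat.even_or_odd i with hi | hi
      · rw [(re_iteratedDeriv_riemannXi_half _).2 (hi.add_odd (odd_two_mul_add_one m)),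
          Complex.zero_re, mul_zero]
      · exact mul_nonneg (div_nonneg (pow_nonneg hz'.le _) (Nat.cast_nonneg _))
          ((re_iteratedDeriv_riemannXi_half _).1 (hi.add_odd (odd_two_mul_add_one m))).le
    have h1 : 0 < (z - 1 / 2) ^ 1 / (1 ! : ℕ) *
        (iteratedDeriv (1 + (2 * m + 1)) riemannXi (1 / 2)).re := by
      simp only [pow_one, Nat.factorial_one, Nat.cast_one, div_one]
      refine mul_pos hz' ((re_iteratedDeriv_riemannXi_half _).1 ?_)
      exact ⟨m + 1, by ring⟩
    exact hasSum_lt hnn h1 hasSum_zero H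
  · intro hz
    have H := hasSum_re_iteratedDeriv_riemannXi (2 * m + 1) z
    have hz' : z - 1 / 2 < 0 := by linarith
    have hnp : ∀ i, (z - 1 / 2) ^ i / i ! *
        (iteratedDeriv (i + (2 * m + 1)) riemannXi (1 / 2)).re ≤ 0 := by
      intro i
      rcases Nat.even_or_odd i with hi | hi
      · rw [(re_iteratedDeriv_riemannXi_half _).2 (hi.add_odd (odd_two_mul_add_one m)),
          Complex.zero_re, mul_zero]
      · exact mul_nonpos_of_nonpos_of_nonneg
          (div_nonpos_of_nonpos_of_nonneg (hi.pow_neg hz').le (Nat.cast_nonneg _))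
          ((re_iteratedDeriv_riemannXi_half _).1 (hi.add_odd (odd_two_mul_add_one m))).le
    have h1 : (z - 1 / 2) ^ 1 / (1 ! : ℕ) *
        (iteratedDeriv (1 + (2 * m + 1)) riemannXi (1 / 2)).re < 0 := by
      simp only [pow_one, Nat.factorial_one, Nat.cast_one, div_one]
      refine mul_neg_of_neg_of_pos hz' ((re_iteratedDeriv_riemannXi_half _).1 ?_)
      exact ⟨m + 1, by ring⟩
    exact hasSum_lt hnp h1 H hasSum_zero

/-- The derivatives of `ξ` at a real point are real (Schwarz reflection `riemannXi_conj_holds`; the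
real numbers whose signs Theorem 2.2 is about). [cite: Freitas2006LiHalfPlanes, Theorem 2.2 (realness of the derivatives)] -/
theorem im_iteratedDeriv_riemannXi_ofReal (k : ℕ) (τ : ℝ) :
    (iteratedDeriv k riemannXi τ).im = 0 := by
  have h := iteratedDeriv_conj_of_conj riemannXi_conj_holds k (τ : ℂ)
  rw [Complex.conj_ofReal] at h
  exact Complex.conj_eq_iff_im.1 h.symm

/-- For real `τ ≥ 1/2` every derivative of `ξ` at `τ` is a non-negative real, and `ξ(τ) > 0`
(Theorem 2.2). [cite: Freitas2006LiHalfPlanes, Theorem 2.2] -/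
theorem iteratedDeriv_riemannXi_nonneg_of_half_le {τ : ℝ} (hτ : 1 / 2 ≤ τ) (k : ℕ) :
    0 ≤ iteratedDeriv k riemannXi τ := by
  refine Complex.nonneg_iff.2 ⟨?_, (im_iteratedDeriv_riemannXi_ofReal k τ).symm⟩
  obtain ⟨m, rfl | rfl⟩ := Nat.even_or_odd' k
  · exact (Freitas2006_thm_2_2_holds τ m).1.le
  · rcases hτ.eq_or_lt with h | h
    · rw [← h, show ((1 / 2 : ℝ) : ℂ) = 1 / 2 by push_cast; ring, iteratedDeriv_riemannXi_half_odd]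
      simp
    · exact ((Freitas2006_thm_2_2_holds τ m).2.1 h).le

/-- `ξ(τ) > 0` (as a real number, i.e. `0 < ξ(τ)` in `ℂ`) at every real `τ` (Theorem 2.2, order `0`).
[cite: Freitas2006LiHalfPlanes, Theorem 2.2 (order 0)] -/
theorem riemannXi_ofReal_pos (τ : ℝ) : 0 < riemannXi τ := by
  refine Complex.pos_iff.2 ⟨?_, ?_⟩
  · simpa using (Freitas2006_thm_2_2_holds τ 0).1
  · simpa using (im_iteratedDeriv_riemannXi_ofReal 0 τ).symm

/-! ## Theorem 2 (i): `α_n(0) = n ξ'(0)/ξ(0) < 0` -/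

/-- `log ξ` (principal branch) is analytic at every real point (`ξ > 0` on `ℝ`): "these functions are
analytic for real values of `τ`" (p0003:L122–124). [cite: Freitas2006LiHalfPlanes, §1 (after eq. (dcoeff))] -/
theorem analyticAt_log_riemannXi_ofReal (τ : ℝ) :
    AnalyticAt ℂ (fun s ↦ Complex.log (riemannXi s)) τ :=
  (differentiable_riemannXi.analyticAt _).clog
    (Complex.mem_slitPlane_iff.2 (Or.inl (Complex.pos_iff.1 (riemannXi_ofReal_pos τ)).1))

/-- Leibniz at `s = 0`: `dⁿ/dsⁿ [s^{n−1} G(s)]|_{s=0} = n! · G'(0)` for `n ≥ 1` and `G` smooth at `0`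
(only the term with `n − 1` derivatives on `s^{n−1}` survives; the computation `α_n(0) = n ξ'(0)/ξ(0)`
of the proof of Thm 2 (i), p0009:L20–22). [cite: Freitas2006LiHalfPlanes, proof of Theorem 2 (i)] -/
theorem iteratedDeriv_pow_mul_zero {G : ℂ → ℂ} {n : ℕ} (hn : 1 ≤ n) (hG : ContDiffAt ℂ n G 0) :
    iteratedDeriv n (fun s ↦ s ^ (n - 1) * G s) 0 = (n ! : ℂ) * deriv G 0 := by
  have hp : ContDiffAt ℂ n (fun s : ℂ ↦ s ^ (n - 1)) 0 := (contDiff_id.pow _).contDiffAt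
  rw [iteratedDeriv_fun_mul hp hG, Finset.sum_eq_single (n - 1)]
  · rw [iteratedDeriv_fun_pow_zero, if_pos rfl, show n - (n - 1) = 1 by omega, iteratedDeriv_one,
      Nat.choose_symm hn, Nat.choose_one_right, ← Nat.mul_factorial_pred (by omega : n ≠ 0)]
    push_cast
    ring
  · intro i _ hi
    rw [iteratedDeriv_fun_pow_zero, if_neg hi]
    simp
  · intro h
    exact absurd (Finset.mem_range.2 (by omega)) h

/-- **Freitas 2006, Theorem 2 (i)** — DISCHARGED: `α_n(0) = n ξ'(0)/ξ(0)` (Leibniz' rule at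
`s = 0`: only `k = n−1` derivatives may fall on `s^{n−1}`) and this is `< 0` because `ξ(0) = 1/2 > 0`
and `ξ'(0) < 0` (Theorem 2.2: odd derivatives are negative to the left of `1/2`).
[cite: Freitas2006LiHalfPlanes, Theorem 2 (i)] -/
theorem Freitas2006_thm_2_i_holds : Freitas2006_thm_2_i := by
  intro n hn
  have hL := analyticAt_log_riemannXi_ofReal 0
  rw [Complex.ofReal_zero] at hL
  have h0 : riemannXi 0 ∈ Complex.slitPlane := by
    rw [riemannXi_zero]; exact Complex.mem_slitPlane_iff.2 (Or.inl (by norm_num))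
  have hderiv : deriv (fun s ↦ Complex.log (riemannXi s)) 0 = deriv riemannXi 0 / riemannXi 0 :=
    ((differentiable_riemannXi 0).hasDerivAt.clog h0).deriv
  set D : ℂ := deriv riemannXi 0 / riemannXi 0 with hD
  have hα : freitasAlpha 0 n = n * D.re := by
    rw [freitasAlpha, Complex.ofReal_zero, iteratedDeriv_pow_mul_zero hn (hL.contDiffAt.of_le le_top),
      hderiv]
    have h1 : ((n ! : ℕ) : ℂ) * D / ((n - 1)! : ℂ) = (n : ℂ) * D := by
      rw [← Nat.mul_factorial_pred (by omega : n ≠ 0)]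
      have : (((n - 1)! : ℕ) : ℂ) ≠ 0 := by exact_mod_cast Nat.factorial_ne_zero _
      push_cast
      field_simp
    rw [h1]
    simp [Complex.mul_re]
  refine ⟨hα, ?_⟩
  rw [hα]
  have hn' : (0 : ℝ) < n := by exact_mod_cast hn
  refine mul_neg_of_pos_of_neg hn' ?_
  have hd : (deriv riemannXi 0).re < 0 := by
    have := (Freitas2006_thm_2_2_holds 0 0).2.2 (by norm_num)
    simpa using this
  have hD2 : D = 2 * deriv riemannXi 0 := by
    rw [hD, riemannXi_zero]; ring
  have h2 : (2 * deriv riemannXi 0 : ℂ).re = 2 * (deriv riemannXi 0).re := by simp [Complex.mul_re]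
  rw [hD2, h2]
  linarith

/-! ## Theorem 1, "if" direction: `α_n(τ) ≥ 0 ∀ n ⟹ ζ ≠ 0` on `Re s > τ/2` (Li's road) -/

/-- Local chain rule for a scaling: if `K` is analytic at `c z` then
`dⁿ/dsⁿ [K(c s)]|_{s=z} = cⁿ K⁽ⁿ⁾(c z)` (Mathlib's `iteratedDeriv_comp_const_mul` needs `K` globally
smooth; `log ξ` is not). [folklore] -/
private theorem iteratedDeriv_comp_const_mul_of_analyticAt (n : ℕ) :
    ∀ {K : ℂ → ℂ} {c z : ℂ}, AnalyticAt ℂ K (c * z) →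
      iteratedDeriv n (fun s ↦ K (c * s)) z = c ^ n * iteratedDeriv n K (c * z) := by
  induction n with
  | zero => intro K c z _; simp
  | succ n ih =>
    intro K c z hK
    have hev : deriv (fun s ↦ K (c * s)) =ᶠ[𝓝 z] fun s ↦ c * deriv K (c * s) := by
      have h1 : ∀ᶠ s in 𝓝 z, AnalyticAt ℂ K (c * s) := by
        have hc : ContinuousAt (fun s : ℂ ↦ c * s) z := by fun_prop
        exact hc.eventually hK.eventually_analyticAt
      filter_upwards [h1] with s hs
      have h2 : HasDerivAt (fun s ↦ K (c * s)) (deriv K (c * s) * (c * 1)) s :=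
        hs.differentiableAt.hasDerivAt.comp s ((hasDerivAt_id s).const_mul c)
      rw [h2.deriv]
      ring
    rw [iteratedDeriv_succ', hev.iteratedDeriv_eq, iteratedDeriv_const_mul_field, ih hK.deriv,
      ← iteratedDeriv_succ', pow_succ]
    ring

/-- **Li's change of variables at a general point** (Freitas' setting, the disc about
`z₀ = 1 − 1/τ` of radius `1/τ` rescaled to the unit disc): for `τ ≠ 0` and `G` analytic at `τ`,
`dⁿ/dsⁿ[s^{n−1} G(s)]|_{s=τ} = τ⁻¹ · dⁿ/dwⁿ[G(τ/(1−w))]|_{w=0}` (the tree's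
`iteratedDeriv_pow_mul_eq_iteratedDeriv_comp_liMap` is `τ = 1`; the general case follows from it
applied to `s ↦ G(τ s)` and the scaling rule). [cite: Freitas2006LiHalfPlanes, Lemma 3.1 (ii) (the computation behind it)] -/
theorem iteratedDeriv_pow_mul_eq_comp_liMap_scaled {n : ℕ} (hn : 1 ≤ n) {G : ℂ → ℂ} {τ : ℂ}
    (hτ : τ ≠ 0) (hG : AnalyticAt ℂ G τ) :
    iteratedDeriv n (fun s ↦ s ^ (n - 1) * G s) τ =
      τ⁻¹ * iteratedDeriv n (fun w ↦ G (τ * liMap w)) 0 := by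
  -- the tree identity for `G_τ(s) = G(τ s)`, analytic at `1`
  have hGτ : AnalyticAt ℂ (fun s ↦ G (τ * s)) 1 := by
    refine (show AnalyticAt ℂ G (τ * 1) by rwa [mul_one]).comp ?_
    exact analyticAt_const.mul analyticAt_id
  have h1 := iteratedDeriv_pow_mul_eq_iteratedDeriv_comp_liMap n hGτ
  -- its left side is `dⁿ[K(τ s)](1)` with `K(u) = (τ⁻¹ u)^{n−1} G(u)`
  set K : ℂ → ℂ := fun u ↦ (τ⁻¹ * u) ^ (n - 1) * G u with hK
  have hKan : AnalyticAt ℂ K (τ * 1) := by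
    rw [mul_one]
    exact ((analyticAt_const.mul analyticAt_id).pow _).mul hG
  have hfun : (fun s : ℂ ↦ s ^ (n - 1) * G (τ * s)) = fun s ↦ K (τ * s) := by
    funext s
    simp only [hK, ← mul_assoc, inv_mul_cancel₀ hτ, one_mul]
  rw [hfun, iteratedDeriv_comp_const_mul_of_analyticAt n hKan, mul_one] at h1
  -- and `K = τ^{−(n−1)} · (u^{n−1} G u)`
  have hK' : K = fun u ↦ (τ⁻¹) ^ (n - 1) * (u ^ (n - 1) * G u) := by
    funext u; simp only [hK, mul_pow]; ring
  rw [hK', iteratedDeriv_const_mul_field, ← mul_assoc] at h1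
  have hτn : τ ^ n * τ⁻¹ ^ (n - 1) = τ := by
    obtain ⟨k, rfl⟩ := Nat.exists_eq_add_of_le hn
    rw [Nat.add_sub_cancel_left, pow_add, pow_one, mul_assoc, ← mul_pow, mul_inv_cancel₀ hτ, one_pow,
      mul_one]
  rw [hτn] at h1
  have hcomp : (fun s ↦ G (τ * s)) ∘ liMap = fun w ↦ G (τ * liMap w) := rfl
  rw [hcomp] at h1
  rw [← h1, ← mul_assoc, inv_mul_cancel₀ hτ, one_mul]

/-- The Taylor coefficients at `0` of the rescaled Möbius map `w ↦ τ/(1 − w)` are `τ · m!`.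
[folklore] -/
private theorem iteratedDeriv_const_mul_liMap_zero (τ : ℂ) (m : ℕ) :
    iteratedDeriv m (fun w ↦ τ * liMap w) 0 = τ * m ! := by
  rw [iteratedDeriv_const_mul_field, iteratedDeriv_liMap_zero]

/-- **Corollary 2.4 in the form Li's lemma needs**: for real `τ ≥ 1/2` all Taylor coefficients of
`f(w) = ξ(τ/(1−w))` at `w = 0` are `≥ 0` (Faà di Bruno: `ξ⁽ⁱ⁾(τ) ≥ 0` by Theorem 2.2 and
`dⁱ[τ/(1−w)](0) = τ·i! ≥ 0`).  (Freitas: `c_n(z₀) > 0` for `z₀ = 1 − 1/τ ∈ (−1,1)`, Cor. 2.4; the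
rescaling `w = (z − z₀)/(1 − z₀)` multiplies `c_n` by `(1−z₀)ⁿ > 0`.)
[cite: Freitas2006LiHalfPlanes, Corollary 2.4] -/
theorem iteratedDeriv_riemannXi_comp_liMap_scaled_nonneg {τ : ℝ} (hτ : 1 / 2 ≤ τ) (k : ℕ) :
    0 ≤ iteratedDeriv k (fun w ↦ riemannXi (τ * liMap w)) 0 := by
  have hcomp : (fun w ↦ riemannXi (τ * liMap w)) = riemannXi ∘ (fun w ↦ (τ : ℂ) * liMap w) := rfl
  have hg : AnalyticAt ℂ (fun w ↦ (τ : ℂ) * liMap w) 0 :=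
    analyticAt_const.mul (analyticAt_liMap zero_ne_one)
  rw [hcomp, iteratedDeriv_comp_eq_sum_orderedFinpartition
    differentiable_riemannXi.contDiff.contDiffAt hg.contDiffAt (le_refl (k : WithTop ℕ∞))]
  refine Finset.sum_nonneg fun c _ ↦ mul_nonneg ?_ (Finset.prod_nonneg fun j _ ↦ ?_)
  · rw [liMap_zero, mul_one]
    exact iteratedDeriv_riemannXi_nonneg_of_half_le hτ _
  · rw [iteratedDeriv_const_mul_liMap_zero]
    exact mul_nonneg (Complex.zero_le_real.2 (by linarith)) (by exact_mod_cast Nat.cast_nonneg _)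

/-- **`dᵏ[log ξ(τ/(1−w))](0) = τ · dᵏ/dsᵏ[s^{k−1} log ξ(s)]|_{s=τ}`**, whose real part is
`τ (k−1)! α_k(τ)` — the identity behind Lemma 3.1 (ii) (`α_k(τ) = τ^{−(k+1)} d_{k−1}(1−1/τ)`), in the
rescaled variable `w = τ(z − z₀)`. [cite: Freitas2006LiHalfPlanes, Lemma 3.1 (ii)] -/
theorem re_iteratedDeriv_log_riemannXi_comp_liMap_scaled {τ : ℝ} (hτ : τ ≠ 0) {k : ℕ} (hk : 1 ≤ k) :
    (iteratedDeriv k (fun w ↦ Complex.log (riemannXi (τ * liMap w))) 0).re =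
      τ * (k - 1)! * freitasAlpha τ k := by
  have hτ' : (τ : ℂ) ≠ 0 := Complex.ofReal_ne_zero.2 hτ
  have h := iteratedDeriv_pow_mul_eq_comp_liMap_scaled hk hτ' (analyticAt_log_riemannXi_ofReal τ)
  have h' : iteratedDeriv k (fun w ↦ Complex.log (riemannXi (τ * liMap w))) 0 =
      τ * iteratedDeriv k (fun s : ℂ ↦ s ^ (k - 1) * Complex.log (riemannXi s)) τ := by
    rw [h, ← mul_assoc, mul_inv_cancel₀ hτ', one_mul]
  rw [h', Complex.re_ofReal_mul, freitasAlpha, Complex.div_natCast_re, mul_assoc]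
  congr 1
  have : (0 : ℝ) < (k - 1)! := by exact_mod_cast Nat.factorial_pos _
  field_simp

/-- **Freitas 2006, Theorem 1, the "if" half, for every `τ ≥ 1/2`** (RH-FREE theorem): if
`α_n(τ) ≥ 0` for all `n ≥ 1` then `ζ(s) ≠ 0` for `Re s > τ/2`.  Li's road (Freitas §3, p0007:L100–152
follows Li 1997, pp. 327–328): the tree's `li_lemma_ne_zero` for `f(w) = ξ(τ/(1−w))` on the unit disc
— Taylor coefficients `≥ 0` (`iteratedDeriv_riemannXi_comp_liMap_scaled_nonneg`), `f(0) = ξ(τ) > 0`,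
`Re dᵏ[log f](0) = τ (k−1)! α_k(τ) ≥ 0` — so `f ≠ 0` on `|w| < 1`, i.e. `ξ ≠ 0` on the image
half-plane `Re s > τ/2` (`w = 1 − τ/s`, `|s − τ| < |s| ⟺ Re s > τ/2`), and a zero of `ζ` with
`Re s > τ/2 ≥ 1/4` would be a zero of `ξ` (`riemannXi_eq_zero_iff_holds`,
`riemannZeta_ne_zero_of_one_le_re`). [cite: Freitas2006LiHalfPlanes, Theorem 1 ("if" direction)] -/
theorem riemannZeta_ne_zero_of_freitasAlpha_nonneg {τ : ℝ} (hτ : 1 / 2 ≤ τ)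
    (hα : ∀ n : ℕ, 1 ≤ n → 0 ≤ freitasAlpha τ n) {s : ℂ} (hs : τ / 2 < s.re) :
    riemannZeta s ≠ 0 := by
  have hτ0 : (0 : ℝ) < τ := by linarith
  set f : ℂ → ℂ := fun w ↦ riemannXi (τ * liMap w) with hf
  have hd : DifferentiableOn ℂ f (ball 0 1) := by
    intro z hz
    have hz1 : z ≠ 1 := by
      rintro rfl
      simp at hz
    exact ((differentiable_riemannXi _).comp z
      (((analyticAt_liMap hz1).differentiableAt).const_mul (τ : ℂ))).differentiableWithinAt
  have h0 : f 0 ≠ 0 := by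
    simp only [hf, liMap_zero, mul_one]
    exact (riemannXi_ofReal_pos τ).ne'
  have hlam : ∀ k, 1 ≤ k → 0 ≤ (iteratedDeriv k (Complex.log ∘ f) 0).re := by
    intro k hk
    rw [show Complex.log ∘ f = fun w ↦ Complex.log (riemannXi (τ * liMap w)) from rfl,
      re_iteratedDeriv_log_riemannXi_comp_liMap_scaled hτ0.ne' hk]
    exact mul_nonneg (mul_nonneg hτ0.le (Nat.cast_nonneg _)) (hα k hk)
  have hne := li_lemma_ne_zero hd (iteratedDeriv_riemannXi_comp_liMap_scaled_nonneg hτ) h0 hlam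
  intro hζ
  have hs0 : s ≠ 0 := fun h ↦ by rw [h] at hs; simp at hs; linarith
  have hs1 : s.re < 1 := by
    by_contra h
    exact riemannZeta_ne_zero_of_one_le_re (not_lt.1 h) hζ
  have hξ : riemannXi s = 0 := (riemannXi_eq_zero_iff_holds s).2 ⟨hζ, by linarith, hs1⟩
  have hw : 1 - τ / s ∈ ball (0 : ℂ) 1 := by
    rw [Metric.mem_ball, dist_zero_right,
      show (1 : ℂ) - τ / s = (s - τ) / s by field_simp, norm_div,
      div_lt_one (norm_pos_iff.2 hs0), ← sq_lt_sq₀ (norm_nonneg _) (norm_nonneg _),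
      Complex.sq_norm, Complex.sq_norm, Complex.normSq_apply, Complex.normSq_apply]
    simp only [sub_re, ofReal_re, sub_im, ofReal_im, sub_zero]
    nlinarith
  refine hne _ hw ?_
  have hsub : (τ : ℂ) * liMap (1 - τ / s) = s := by
    have hτ' : (τ : ℂ) ≠ 0 := Complex.ofReal_ne_zero.2 hτ0.ne'
    simp only [liMap, sub_sub_cancel]
    field_simp
  show riemannXi (τ * liMap (1 - τ / s)) = 0
  rw [hsub, hξ]

/-- **The "if" half of `Freitas2006_thm_1`, all `τ ≥ 1/2`** (restatement of
`riemannZeta_ne_zero_of_freitasAlpha_nonneg` in the shape of the named fact). RH-FREE.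
[cite: Freitas2006LiHalfPlanes, Theorem 1 ("if" direction)] -/
theorem Freitas2006_thm_1_if (τ : ℝ) (hτ : 1 / 2 ≤ τ)
    (hα : ∀ n : ℕ, 1 ≤ n → 0 ≤ freitasAlpha τ n) :
    ∀ s : ℂ, τ / 2 < s.re → riemannZeta s ≠ 0 :=
  fun _ hs ↦ riemannZeta_ne_zero_of_freitasAlpha_nonneg hτ hα hs

/-! ## Lemma 3.1 (i): the zero-sum form `α_n(τ) = (1/τ) Σ_ρ [1 − (ρ/(ρ−τ))ⁿ]`

Freitas (p0007:L39–94) starts from the Hadamard product `ξ(s) = Π_ρ (1 − s/ρ)` and differentiates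
`s^{n} log ξ(s)` at `s = τ`.  We follow the tree's formalisation of the same computation at `s = 1`
(`EquivalentsKeiperLiProofs.lean`, `keiperLiCoeff_eq_zero_sum_holds`): the partial-fraction series
of `ξ'/ξ` from the genus-zero Hadamard product of de Bruijn's `H₀` (`IsHadamardSeq`) converges
normally near any point where `ξ ≠ 0`, so it may be differentiated termwise there; Leibniz' rule and
the binomial theorem give the pair sum, and the multiplicity bookkeeping
(`IsHadamardSeq.finsum_liZeroBox_eq_sum`) turns the sum over Hadamard pairs into the sum over the
zeros with multiplicity. -/

namespace IsHadamardSeq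

variable {b : ℕ → ℂ}

/-- A closed disc about a point `c` with `ξ(c) ≠ 0` on which `ξ` has no zeros. [folklore] -/
private theorem exists_closedBall_riemannXi_ne_zero {c : ℂ} (hc : riemannXi c ≠ 0) :
    ∃ r : ℝ, 0 < r ∧ ∀ s ∈ closedBall c r, riemannXi s ≠ 0 := by
  have hev : ∀ᶠ s in 𝓝 c, riemannXi s ≠ 0 :=
    differentiable_riemannXi.continuous.continuousAt.eventually_ne hc
  obtain ⟨ε, hε, hball⟩ := Metric.eventually_nhds_iff_ball.1 hev
  refine ⟨ε / 2, by positivity, fun s hs ↦ hball s ?_⟩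
  exact closedBall_subset_ball (by linarith) hs

/-- **Normal convergence near a zero-free point.** On a disc `|s − c| < r` whose closure avoids the
zeros of `ξ`, the terms of `ξ'/ξ` are bounded by a summable sequence (as in the tree's
`exists_summable_bound_term` at `c = 1`: `8A‖bₖ‖` with `A = 2r + |2c−1|` once `‖bₖ‖ ≤ 1/(2A²)`,
a compactness bound for the finitely many other `k`). [folklore] -/
private theorem exists_summable_bound_term_at (h : IsHadamardSeq 0 b) {c : ℂ} {r : ℝ} (hr : 0 < r)
    (hξ : ∀ s ∈ closedBall c r, riemannXi s ≠ 0) :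
    ∃ u : ℕ → ℝ, Summable u ∧ ∀ k, ∀ w ∈ ball c r,
      ‖-(4 * b k * (2 * w - 1)) / (1 - b k * (2 * w - 1) ^ 2)‖ ≤ u k := by
  classical
  have hbd : ∀ k, ∃ M : ℝ, ∀ w ∈ closedBall c r,
      ‖-(4 * b k * (2 * w - 1)) / (1 - b k * (2 * w - 1) ^ 2)‖ ≤ M := by
    intro k
    refine (isCompact_closedBall c r).exists_bound_of_continuousOn ?_
    exact ((h.differentiableOn_term k).mono fun w hw ↦ hξ w hw).continuousOn
  choose M hM using hbd
  set A : ℝ := 2 * r + ‖2 * c - 1‖ with hA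
  have hA0 : 0 < A := by positivity
  refine ⟨fun k ↦ if ‖b k‖ ≤ 1 / (2 * A ^ 2) then 8 * A * ‖b k‖ else M k, ?_, ?_⟩
  · refine Summable.of_norm_bounded_eventually (g := fun k ↦ 8 * A * ‖b k‖)
      (h.summable.mul_left (8 * A)) ?_
    have hev : ∀ᶠ k in cofinite, ‖b k‖ ≤ 1 / (2 * A ^ 2) := by
      have := (Summable.of_norm h.summable).tendsto_cofinite_zero.norm
      rw [norm_zero] at this
      exact this.eventually (ge_mem_nhds (by positivity))
    filter_upwards [hev] with k hk
    simp only [hk, if_true, Real.norm_eq_abs]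
    rw [abs_of_nonneg (by positivity)]
  · intro k w hw
    have hw' : w ∈ closedBall c r := ball_subset_closedBall hw
    beta_reduce
    split_ifs with hk
    · have h2w : ‖2 * w - 1‖ ≤ A := by
        have : ‖w - c‖ < r := by simpa [dist_eq_norm] using hw
        calc ‖2 * w - 1‖ = ‖2 * (w - c) + (2 * c - 1)‖ := by ring_nf
          _ ≤ ‖2 * (w - c)‖ + ‖2 * c - 1‖ := norm_add_le _ _
          _ ≤ A := by
            rw [norm_mul, Complex.norm_two, hA]; nlinarith [norm_nonneg (w - c)]
      have hsq : ‖b k * (2 * w - 1) ^ 2‖ ≤ 1 / 2 := by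
        rw [norm_mul, norm_pow]
        have h3 : ‖2 * w - 1‖ ^ 2 ≤ A ^ 2 := pow_le_pow_left₀ (norm_nonneg _) h2w 2
        calc ‖b k‖ * ‖2 * w - 1‖ ^ 2 ≤ 1 / (2 * A ^ 2) * A ^ 2 :=
              mul_le_mul hk h3 (by positivity) (by positivity)
          _ = 1 / 2 := by field_simp
      have hden : 1 / 2 ≤ ‖1 - b k * (2 * w - 1) ^ 2‖ := by
        have := norm_sub_norm_le (1 : ℂ) (b k * (2 * w - 1) ^ 2)
        rw [norm_one] at this
        linarith
      have hnum : ‖-(4 * b k * (2 * w - 1))‖ ≤ 4 * A * ‖b k‖ := by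
        rw [norm_neg, norm_mul, norm_mul, Complex.norm_ofNat]
        nlinarith [norm_nonneg (b k), norm_nonneg (2 * w - 1)]
      rw [norm_div, div_le_iff₀ (by linarith)]
      calc ‖-(4 * b k * (2 * w - 1))‖ ≤ 4 * A * ‖b k‖ := hnum
        _ = 8 * A * ‖b k‖ * (1 / 2) := by ring
        _ ≤ 8 * A * ‖b k‖ * ‖1 - b k * (2 * w - 1) ^ 2‖ :=
          mul_le_mul_of_nonneg_left hden (by positivity)
    · exact hM k w hw'

/-- **The derivatives of `ξ'/ξ` at a zero-free point, termwise**: for a Hadamard sequence `b` of `H₀`,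
a point `c` with `ξ(c) ≠ 0` and every `j`,
`(ξ'/ξ)^{(j)}(c) = ∑ₖ dʲ/dsʲ[−4bₖ(2s−1)/(1 − bₖ(2s−1)²)]|_{s=c}` (termwise differentiation of the
normally convergent partial-fraction series; Freitas p0007:L55–70 "by taking the logarithmic
derivative"). [cite: Freitas2006LiHalfPlanes, proof of Lemma 3.1] -/
theorem hasSum_iteratedDeriv_term_at (h : IsHadamardSeq 0 b) {c : ℂ} (hc : riemannXi c ≠ 0)
    (j : ℕ) :
    HasSum
      (fun k ↦ iteratedDeriv j (fun s ↦ -(4 * b k * (2 * s - 1)) / (1 - b k * (2 * s - 1) ^ 2)) c)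
      (iteratedDeriv j (logDeriv riemannXi) c) := by
  obtain ⟨r, hr, hξ⟩ := exists_closedBall_riemannXi_ne_zero hc
  obtain ⟨u, hu, hle⟩ := h.exists_summable_bound_term_at hr hξ
  have hU : IsOpen (ball c r) := isOpen_ball
  have h1 : c ∈ ball c r := mem_ball_self hr
  have hdiff : ∀ k, DifferentiableOn ℂ
      (fun s ↦ -(4 * b k * (2 * s - 1)) / (1 - b k * (2 * s - 1) ^ 2)) (ball c r) :=
    fun k ↦ (h.differentiableOn_term k).mono fun w hw ↦ hξ w (ball_subset_closedBall hw)
  have H := hasSum_iteratedDeriv_of_summable_norm hu hdiff hU hle j h1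
  have heq : EqOn (fun w ↦ ∑' k, -(4 * b k * (2 * w - 1)) / (1 - b k * (2 * w - 1) ^ 2))
      (logDeriv riemannXi) (ball c r) := fun w hw ↦
    (h.logDeriv_riemannXi_eq_tsum (hξ w (ball_subset_closedBall hw))).symm
  rwa [heq.iteratedDeriv_of_isOpen hU j h1] at H

/-- **The derivatives of one pair of terms at a zero-free point `c`**: for `bₖ ≠ 0`, near `c` the
`k`-th term is `1/(s−ρₖ) + 1/(s−(1−ρₖ))`, so its `j`-th derivative at `c` is
`(−1)ʲ j! [(c−ρₖ)^{−(j+1)} + (c−(1−ρₖ))^{−(j+1)}]`. [folklore] -/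
private theorem iteratedDeriv_term_at (h : IsHadamardSeq 0 b) {k : ℕ} (hk : b k ≠ 0) {c : ℂ}
    (hc : riemannXi c ≠ 0) (j : ℕ) :
    iteratedDeriv j (fun s ↦ -(4 * b k * (2 * s - 1)) / (1 - b k * (2 * s - 1) ^ 2)) c =
      (-1) ^ j * j ! * (((c - xiZero b k)⁻¹) ^ (j + 1) + ((c - (1 - xiZero b k))⁻¹) ^ (j + 1)) := by
  set ρ := xiZero b k with hρ
  have hρ0 : riemannXi ρ = 0 := h.riemannXi_xiZero hk
  have hρ1 : riemannXi (1 - ρ) = 0 := h.riemannXi_one_sub_xiZero hk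
  have hev : ∀ᶠ s in 𝓝 c, riemannXi s ≠ 0 :=
    differentiable_riemannXi.continuous.continuousAt.eventually_ne hc
  have hfe : (fun s ↦ -(4 * b k * (2 * s - 1)) / (1 - b k * (2 * s - 1) ^ 2)) =ᶠ[𝓝 c]
      fun s ↦ (1 * s - ρ)⁻¹ + (1 * s - (1 - ρ))⁻¹ := by
    filter_upwards [hev] with s hs
    have hs1 : s ≠ ρ := fun e ↦ hs (by rw [e]; exact hρ0)
    have hs2 : s ≠ 1 - ρ := fun e ↦ hs (by rw [e]; exact hρ1)
    rw [term_eq_inv_add_inv b hk hs1 hs2]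
    simp only [one_div, one_mul]
    rfl
  rw [hfe.iteratedDeriv_eq]
  have hne1 : c - ρ ≠ 0 := fun e ↦ hc (by rw [sub_eq_zero.1 e]; exact hρ0)
  have hne2 : c - (1 - ρ) ≠ 0 := fun e ↦ hc (by rw [sub_eq_zero.1 e]; exact hρ1)
  have hc1 : ContDiffAt ℂ j (fun s : ℂ ↦ (1 * s - ρ)⁻¹) c := by
    refine ContDiffAt.inv (by fun_prop) (by simpa using hne1)
  have hc2 : ContDiffAt ℂ j (fun s : ℂ ↦ (1 * s - (1 - ρ))⁻¹) c := by
    refine ContDiffAt.inv (by fun_prop) (by simpa using hne2)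
  rw [iteratedDeriv_fun_add hc1 hc2, iteratedDeriv_eq_iterate, iteratedDeriv_eq_iterate,
    iter_deriv_inv_linear_sub j 1 ρ, iter_deriv_inv_linear_sub j 1 (1 - ρ)]
  simp only [one_pow, mul_one, one_mul]
  have ez : ∀ a : ℂ, a ^ (-1 - j : ℤ) = (a⁻¹) ^ (j + 1) := by
    intro a
    rw [show (-1 - j : ℤ) = -((j + 1 : ℕ) : ℤ) by push_cast; ring, zpow_neg, zpow_natCast, inv_pow]
  rw [ez, ez]
  ring

end IsHadamardSeq

/-- Near a real point the principal `log ξ` is a primitive of `ξ'/ξ` (`ξ > 0` on `ℝ`), hence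
`(log ξ)^{(j+1)}(τ) = (ξ'/ξ)^{(j)}(τ)`. [folklore] -/
private theorem iteratedDeriv_succ_log_riemannXi_ofReal (τ : ℝ) (j : ℕ) :
    iteratedDeriv (j + 1) (fun s ↦ Complex.log (riemannXi s)) τ =
      iteratedDeriv j (logDeriv riemannXi) τ := by
  rw [iteratedDeriv_succ']
  refine Filter.EventuallyEq.iteratedDeriv_eq j ?_
  have h1 : riemannXi τ ∈ slitPlane :=
    mem_slitPlane_iff.2 (Or.inl (Complex.pos_iff.1 (riemannXi_ofReal_pos τ)).1)
  have hV : ∀ᶠ s in 𝓝 (τ : ℂ), riemannXi s ∈ slitPlane :=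
    differentiable_riemannXi.continuous.continuousAt.eventually_mem (isOpen_slitPlane.mem_nhds h1)
  filter_upwards [hV] with s hs
  rw [((differentiable_riemannXi s).hasDerivAt.clog hs).deriv, logDeriv_apply]

/-- **Leibniz' rule for `s^{n−1} g(s)` at a point `c`**: for `n ≥ 1` and `g` of class `Cⁿ` at `c`,
`dⁿ/dsⁿ[s^{n−1} g(s)]|_{s=c} = ∑_{i<n} C(n,i) (n−1)^{(i)} c^{n−1−i} g^{(n−i)}(c)` (falling factorial
`(n−1)^{(i)}`; the term `i = n` vanishes). [folklore] -/
private theorem iteratedDeriv_pow_mul_eq_sum_at {g : ℂ → ℂ} {n : ℕ} (hn : 1 ≤ n) (c : ℂ)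
    (hg : ContDiffAt ℂ n g c) :
    iteratedDeriv n (fun s ↦ s ^ (n - 1) * g s) c =
      ∑ i ∈ Finset.range n, (n.choose i : ℂ) * ((n - 1).descFactorial i : ℂ) * c ^ (n - 1 - i) *
        iteratedDeriv (n - i) g c := by
  have hp : ContDiffAt ℂ n (fun s : ℂ ↦ s ^ (n - 1)) c := (contDiff_id.pow _).contDiffAt
  rw [iteratedDeriv_fun_mul hp hg, Finset.sum_range_succ,
    show iteratedDeriv n (fun s : ℂ ↦ s ^ (n - 1)) c = 0 by
      rw [iteratedDeriv_pow, Nat.descFactorial_eq_zero_iff_lt.2 (by omega : n - 1 < n)]; simp]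
  simp only [mul_zero, zero_mul, add_zero]
  refine Finset.sum_congr rfl fun i _ ↦ ?_
  rw [iteratedDeriv_pow]
  ring

/-- **The binomial identity of (alphaexpderiv)** (p0007:L86–92): for `τ ≠ 0`,
`∑_{i<n} C(n,i) τ^{n−1−i} (−1)^{n−1−i} x^{n−i} = τ⁻¹ [1 − (1 − τ x)ⁿ]`
(with `x = 1/(τ − ρ)`: `1 − τ/(τ−ρ) = ρ/(ρ−τ)`). [cite: Freitas2006LiHalfPlanes, proof of Lemma 3.1, eq. (alphaexpderiv)] -/
theorem sum_range_choose_mul_pow_eq (x : ℂ) {τ : ℂ} (hτ : τ ≠ 0) (n : ℕ) :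
    ∑ i ∈ Finset.range n, (n.choose i : ℂ) * τ ^ (n - 1 - i) * ((-1) ^ (n - 1 - i) * x ^ (n - i)) =
      τ⁻¹ * (1 - (1 - τ * x) ^ n) := by
  rw [← sum_range_choose_succ_mul_neg_pow (τ * x) n, Finset.mul_sum, ← Finset.sum_range_reflect]
  refine Finset.sum_congr rfl fun j hj ↦ ?_
  have hj' : j < n := Finset.mem_range.1 hj
  rw [show n - (n - 1 - j) = j + 1 by omega, show n - 1 - (n - 1 - j) = j by omega,
    Nat.choose_symm_of_eq_add (by omega : n = (n - 1 - j) + (j + 1)), mul_pow]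
  field_simp
  ring

/-- **Freitas' computation (alphaexpderiv), pair by pair** (p0007:L82–94): for a Hadamard sequence
`b` of `H₀`, `n ≥ 1` and real `τ ≠ 0`,
`τ · (1/(n−1)!) dⁿ/dsⁿ[s^{n−1} log ξ(s)]|_{s=τ} = ∑ₖ ([1 − (ρₖ/(ρₖ−τ))ⁿ] + [1 − ((1−ρₖ)/(1−ρₖ−τ))ⁿ])`,
summed over the pairs `{ρₖ, 1 − ρₖ}` of the Hadamard product (unconditionally convergent; the
padding indices `bₖ = 0` contribute `0`).  The tree's `hasSum_keiperLi_pairs` is `τ = 1`.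
[cite: Freitas2006LiHalfPlanes, proof of Lemma 3.1, eq. (alphaexpderiv)] -/
theorem IsHadamardSeq.hasSum_freitas_pairs {b : ℕ → ℂ} (h : IsHadamardSeq 0 b) {n : ℕ} (hn : 1 ≤ n)
    {τ : ℝ}
    (hτ : τ ≠ 0) :
    HasSum (fun k ↦ if b k = 0 then (0 : ℂ) else
        ((1 - (xiZero b k / (xiZero b k - τ)) ^ n) +
          (1 - ((1 - xiZero b k) / ((1 - xiZero b k) - τ)) ^ n)))
      (τ * (iteratedDeriv n (fun s : ℂ ↦ s ^ (n - 1) * Complex.log (riemannXi s)) τ /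
        ((n - 1)! : ℂ))) := by
  have hτ' : (τ : ℂ) ≠ 0 := Complex.ofReal_ne_zero.2 hτ
  have hξ : riemannXi τ ≠ 0 := (riemannXi_ofReal_pos τ).ne'
  have hg : ContDiffAt ℂ n (fun s ↦ Complex.log (riemannXi s)) τ :=
    (analyticAt_log_riemannXi_ofReal τ).contDiffAt
  -- the coefficient of the `(n−i)`-th derivative of `log ξ`, times `τ/(n−1)!`
  set a : ℕ → ℂ := fun i ↦ (τ : ℂ) * ((n.choose i : ℂ) * ((n - 1).descFactorial i : ℂ) *
    (τ : ℂ) ^ (n - 1 - i)) / ((n - 1)! : ℂ) with ha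
  have hsum := hasSum_sum (s := Finset.range n)
    (f := fun i k ↦ a i *
      iteratedDeriv (n - 1 - i) (fun s ↦ -(4 * b k * (2 * s - 1)) / (1 - b k * (2 * s - 1) ^ 2)) τ)
    fun i _ ↦ (h.hasSum_iteratedDeriv_term_at hξ (n - 1 - i)).mul_left (a i)
  convert hsum using 1
  · funext k
    split_ifs with hk
    · simp [hk]
    · simp only [h.iteratedDeriv_term_at hk hξ]
      set ρ := xiZero b k
      -- `(n−1)^{(i)} (n−1−i)! = (n−1)!`
      have hfac : ∀ i ∈ Finset.range n,
          a i * ((-1) ^ (n - 1 - i) * ((n - 1 - i)! : ℂ) *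
            ((((τ : ℂ) - ρ)⁻¹) ^ (n - 1 - i + 1) + (((τ : ℂ) - (1 - ρ))⁻¹) ^ (n - 1 - i + 1))) =
          τ * ((n.choose i : ℂ) * (τ : ℂ) ^ (n - 1 - i) *
              ((-1) ^ (n - 1 - i) * (((τ : ℂ) - ρ)⁻¹) ^ (n - i))) +
            τ * ((n.choose i : ℂ) * (τ : ℂ) ^ (n - 1 - i) *
              ((-1) ^ (n - 1 - i) * (((τ : ℂ) - (1 - ρ))⁻¹) ^ (n - i))) := by
        intro i hi
        have hi' : i < n := Finset.mem_range.1 hi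
        have key : (((n - 1).descFactorial i : ℕ) : ℂ) * ((n - 1 - i)! : ℂ) = ((n - 1)! : ℂ) := by
          have e := Nat.factorial_mul_descFactorial (show i ≤ n - 1 by omega)
          rw [mul_comm] at e
          exact_mod_cast e
        have h0 : ((n - 1)! : ℂ) ≠ 0 := by exact_mod_cast (Nat.factorial_pos _).ne'
        rw [show n - 1 - i + 1 = n - i by omega, ha]
        simp only
        rw [show (τ : ℂ) * ((n.choose i : ℂ) * ((n - 1).descFactorial i : ℂ) * (τ : ℂ) ^ (n - 1 - i)) /
            ((n - 1)! : ℂ) * ((-1) ^ (n - 1 - i) * ((n - 1 - i)! : ℂ) *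
              ((((τ : ℂ) - ρ)⁻¹) ^ (n - i) + (((τ : ℂ) - (1 - ρ))⁻¹) ^ (n - i))) =
            (τ : ℂ) * (n.choose i : ℂ) * (τ : ℂ) ^ (n - 1 - i) * (-1) ^ (n - 1 - i) *
              ((((n - 1).descFactorial i : ℕ) : ℂ) * ((n - 1 - i)! : ℂ) / ((n - 1)! : ℂ)) *
              ((((τ : ℂ) - ρ)⁻¹) ^ (n - i) + (((τ : ℂ) - (1 - ρ))⁻¹) ^ (n - i)) by ring,
          key, div_self h0]
        ring
      rw [Finset.sum_congr rfl hfac, Finset.sum_add_distrib, ← Finset.mul_sum, ← Finset.mul_sum,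
        sum_range_choose_mul_pow_eq _ hτ', sum_range_choose_mul_pow_eq _ hτ', ← mul_assoc,
        ← mul_assoc, mul_inv_cancel₀ hτ', one_mul, one_mul]
      have hτρ : (τ : ℂ) - ρ ≠ 0 := fun e ↦ hξ (by rw [sub_eq_zero.1 e]; exact h.riemannXi_xiZero hk)
      have hτρ' : (τ : ℂ) - (1 - ρ) ≠ 0 := fun e ↦
        hξ (by rw [sub_eq_zero.1 e]; exact h.riemannXi_one_sub_xiZero hk)
      have hρτ : ρ - (τ : ℂ) ≠ 0 := fun e ↦ hτρ (by rw [← neg_sub, e, neg_zero])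
      have hρτ' : (1 - ρ) - (τ : ℂ) ≠ 0 := fun e ↦ hτρ' (by rw [← neg_sub, e, neg_zero])
      have e1 : 1 - (τ : ℂ) * ((τ : ℂ) - ρ)⁻¹ = ρ / (ρ - τ) := by
        rw [eq_div_iff hρτ]
        field_simp
        ring
      have e2 : 1 - (τ : ℂ) * ((τ : ℂ) - (1 - ρ))⁻¹ = (1 - ρ) / ((1 - ρ) - τ) := by
        rw [eq_div_iff hρτ']
        field_simp
        ring
      rw [e1, e2]
  · rw [iteratedDeriv_pow_mul_eq_sum_at hn _ hg, Finset.sum_div, Finset.mul_sum]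
    refine Finset.sum_congr rfl fun i hi ↦ ?_
    have hi' : i < n := Finset.mem_range.1 hi
    rw [show n - i = (n - 1 - i) + 1 by omega, iteratedDeriv_succ_log_riemannXi_ofReal, ha]
    ring

/-! ### From the Hadamard pairs to the zeros with multiplicity -/

open BombieriLagarias ZetaZeros in
/-- **Absolute convergence of Freitas' zero sum** (real parts, multiplicities): for real `τ ≠ 0`
and every `n`, `Σ_ρ m(ρ) Re[1 − (ρ/(ρ−τ))ⁿ]` converges absolutely — Bombieri–Lagarias' bound
(`BombieriLagarias.summable_term`) for the rescaled family `ρ/τ`, whose weight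
`m (1+|Re(ρ/τ)|)/(1+|ρ/τ|)²` is `≤ C(τ) · m/(1+γ²)` (`0 < Re ρ < 1`,
`ZetaZeroSum.summable_zeroOrder_div_one_add_sq`); and `(1 − τ/ρ)⁻¹ = ρ/(ρ−τ)`.
(Freitas: "the terms corresponding to `ρ` and `1−ρ` are paired together", p0007:L21–23; cf. the
remark after Thm 1, p0004:L1–4, "replacing `ρ` by `ρ/τ`" in [bola].)
[cite: Freitas2006LiHalfPlanes, Lemma 3.1 (i) (convergence of the zero sum)] -/
theorem summable_freitasTerm (n : ℕ) {τ : ℝ} (hτ : τ ≠ 0) :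
    Summable (fun ρ : ZetaZeros.riemannZetaNontrivialZeros ↦
      (riemannZetaZeroOrder (ρ : ℂ) : ℝ) * (1 - ((ρ : ℂ) / ((ρ : ℂ) - τ)) ^ n).re) := by
  set t : ℝ := |τ| with ht
  have ht0 : 0 < t := abs_pos.2 hτ
  have hτ' : (τ : ℂ) ≠ 0 := Complex.ofReal_ne_zero.2 hτ
  -- multiplicities as naturals
  set m : ZetaZeros.riemannZetaNontrivialZeros → ℕ := fun ρ ↦ (riemannZetaZeroOrder (ρ : ℂ)).toNat
  have hm : ∀ ρ, 0 < m ρ := fun ρ ↦ by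
    have := riemannZetaNontrivialZeros.one_le_order ρ.2; simp only [m]; omega
  have hmcast : ∀ ρ : ZetaZeros.riemannZetaNontrivialZeros,
      ((m ρ : ℕ) : ℝ) = (riemannZetaZeroOrder (ρ : ℂ) : ℝ) := by
    intro ρ
    have h := riemannZetaNontrivialZeros.one_le_order ρ.2
    have : ((riemannZetaZeroOrder (ρ : ℂ)).toNat : ℤ) = riemannZetaZeroOrder (ρ : ℂ) :=
      Int.toNat_of_nonneg (by omega)
    exact_mod_cast this
  -- the Bombieri–Lagarias weight of the rescaled family
  have hW : Summable (weight (fun ρ : ZetaZeros.riemannZetaNontrivialZeros ↦ (ρ : ℂ) / τ) m) := by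
    set C : ℝ := (1 + 1 / t) * max 1 (t ^ 2) with hC
    refine Summable.of_nonneg_of_le (fun ρ ↦ weight_nonneg _ _ ρ) (fun ρ ↦ ?_)
      (ZetaZeroSum.summable_zeroOrder_div_one_add_sq.mul_left C)
    have h0 := riemannZetaNontrivialZeros.re_pos ρ.2
    have h1 := riemannZetaNontrivialZeros.re_lt_one ρ.2
    have hm0 : (0 : ℝ) ≤ riemannZetaZeroOrder (ρ : ℂ) := ZetaZeroSum.zeroOrder_nonneg ρ
    unfold weight
    rw [hmcast]
    have hre : |((ρ : ℂ) / τ).re| ≤ 1 / t := by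
      rw [Complex.div_ofReal_re, abs_div, ← ht]
      exact div_le_div_of_nonneg_right (by rw [abs_le]; constructor <;> linarith) ht0.le
    have hnorm : ‖(ρ : ℂ) / τ‖ = ‖(ρ : ℂ)‖ / t := by
      rw [norm_div, Complex.norm_real, Real.norm_eq_abs]
    have him : ((ρ : ℂ)).im ^ 2 ≤ ‖(ρ : ℂ)‖ ^ 2 := by
      have := Complex.abs_im_le_norm (ρ : ℂ)
      have h2 := pow_le_pow_left₀ (abs_nonneg _) this 2
      rwa [sq_abs] at h2
    have hden : 1 + ((ρ : ℂ)).im ^ 2 ≤ max 1 (t ^ 2) * (1 + ‖(ρ : ℂ) / τ‖) ^ 2 := by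
      rw [hnorm]
      have hM1 : (1 : ℝ) ≤ max 1 (t ^ 2) := le_max_left _ _
      have hM2 : t ^ 2 ≤ max 1 (t ^ 2) := le_max_right _ _
      have hsq : (‖(ρ : ℂ)‖ / t) ^ 2 = ‖(ρ : ℂ)‖ ^ 2 / t ^ 2 := by rw [div_pow]
      have hexp : (1 + ‖(ρ : ℂ)‖ / t) ^ 2 ≥ 1 + ‖(ρ : ℂ)‖ ^ 2 / t ^ 2 := by
        rw [← hsq]; nlinarith [div_nonneg (norm_nonneg (ρ : ℂ)) ht0.le]
      have h3 : max 1 (t ^ 2) * (‖(ρ : ℂ)‖ ^ 2 / t ^ 2) ≥ ‖(ρ : ℂ)‖ ^ 2 := by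
        calc max 1 (t ^ 2) * (‖(ρ : ℂ)‖ ^ 2 / t ^ 2) ≥ t ^ 2 * (‖(ρ : ℂ)‖ ^ 2 / t ^ 2) :=
              mul_le_mul_of_nonneg_right hM2 (by positivity)
          _ = ‖(ρ : ℂ)‖ ^ 2 := by field_simp
      nlinarith [mul_le_mul_of_nonneg_left hexp (le_trans zero_le_one hM1)]
    calc (riemannZetaZeroOrder (ρ : ℂ) : ℝ) * ((1 + |((ρ : ℂ) / τ).re|) / (1 + ‖(ρ : ℂ) / τ‖) ^ 2)
        ≤ (riemannZetaZeroOrder (ρ : ℂ) : ℝ) * ((1 + 1 / t) * (max 1 (t ^ 2) / (1 + ((ρ : ℂ)).im ^ 2))) := by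
          refine mul_le_mul_of_nonneg_left ?_ hm0
          rw [div_eq_mul_one_div]
          refine mul_le_mul (by linarith) ?_ (by positivity) (by positivity)
          rw [one_div_le (by positivity) (by positivity), one_div_div]
          calc (1 + ((ρ : ℂ)).im ^ 2) / max 1 (t ^ 2) ≤ (max 1 (t ^ 2) * (1 + ‖(ρ : ℂ) / τ‖) ^ 2) /
                max 1 (t ^ 2) := div_le_div_of_nonneg_right hden (by positivity)
            _ = (1 + ‖(ρ : ℂ) / τ‖) ^ 2 := by field_simp
      _ = C * ((riemannZetaZeroOrder (ρ : ℂ) : ℝ) / (1 + ((ρ : ℂ)).im ^ 2)) := by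
          rw [hC]; ring
  have H := summable_term (ρ := fun ρ : ZetaZeros.riemannZetaNontrivialZeros ↦ (ρ : ℂ) / τ) hm hW n
  refine H.congr fun ρ ↦ ?_
  have hρ0 : (ρ : ℂ) ≠ 0 := fun e ↦ by
    have := riemannZetaNontrivialZeros.re_pos ρ.2; rw [e] at this; simp at this
  rw [hmcast]
  congr 3
  rw [one_div, inv_div, one_sub_div hρ0, inv_div]

/-- `liZeroBox T` is the box `weilZeroIndex T` of the explicit-formula files. [folklore] -/
private theorem liZeroBox_eq_weilZeroIndex' (T : ℝ) : liZeroBox T = weilZeroIndex T := by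
  ext ρ
  simp only [liZeroBox, weilZeroIndex, mem_setOf_eq, abs_pos]

open ZetaZeros in
/-- **Freitas 2006, Lemma 3.1 (i)** — DISCHARGED: for every positive integer `n` and real `τ ≠ 0`,
`α_n(τ) = (1/τ) Σ_ρ m(ρ) Re[1 − (ρ/(ρ−τ))ⁿ]`, the absolutely convergent sum over the non-trivial
zeros of `ζ` with multiplicities.  Proof as in print (p0007:L39–98): the logarithmic derivative of
the Hadamard product, differentiated termwise at `s = τ` (`IsHadamardSeq.hasSum_freitas_pairs`),
gives the pair sum; the pairs `{ρₖ, 1−ρₖ}` enumerate the zeros with multiplicity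
(`IsHadamardSeq.finsum_liZeroBox_eq_sum`), so the box truncations converge to `τ·α_n(τ)`; and by
absolute convergence (`summable_freitasTerm`) the box sums of the real parts converge to the `tsum`.
[cite: Freitas2006LiHalfPlanes, Lemma 3.1 (i)] -/
theorem Freitas2006_lemma_3_1_i_holds : Freitas2006_lemma_3_1_i := by
  intro n hn τ hτ
  refine ⟨summable_freitasTerm n hτ, ?_⟩
  classical
  obtain ⟨b, hb⟩ := exists_isHadamardSeq 0
  set D : ℂ := iteratedDeriv n (fun s : ℂ ↦ s ^ (n - 1) * Complex.log (riemannXi s)) τ /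
    ((n - 1)! : ℂ) with hD
  set f : ℂ → ℂ := fun ρ ↦ 1 - (ρ / (ρ - τ)) ^ n with hf
  set G : ℕ → ℂ := fun k ↦
    if b k = 0 then 0 else f (IsHadamardSeq.xiZero b k) + f (1 - IsHadamardSeq.xiZero b k)
    with hG
  have hGD : HasSum G (τ * D) := hb.hasSum_freitas_pairs hn hτ
  set K : ℝ → Finset ℕ := fun T ↦ (hb.finite_setOf_abs_im_xiZero_le T).toFinset with hKdef
  have hK : ∀ T k, k ∈ K T ↔ b k ≠ 0 ∧ |(IsHadamardSeq.xiZero b k).im| ≤ T := fun T k ↦ by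
    simp [hKdef, Set.Finite.mem_toFinset]
  have hlim : Tendsto (fun T ↦ ∑ k ∈ K T, G k) atTop (𝓝 (τ * D)) :=
    IsHadamardSeq.tendsto_sum_truncation hGD (fun k hk ↦ by simp [hG, hk]) K hK
  have heq : ∀ T, ∑ᶠ ρ ∈ liZeroBox T, (riemannZetaZeroOrder ρ : ℂ) * f ρ = ∑ k ∈ K T, G k := by
    intro T
    rw [hb.finsum_liZeroBox_eq_sum f T (K T) (hK T)]
    refine Finset.sum_congr rfl fun k hk ↦ ?_
    simp [hG, ((hK T k).1 hk).1]
  have hbox : Tendsto (fun T ↦ (∑ᶠ ρ ∈ liZeroBox T, (riemannZetaZeroOrder ρ : ℂ) * f ρ).re)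
      atTop (𝓝 ((τ : ℂ) * D).re) := by
    have h1 : Tendsto (fun T ↦ ∑ᶠ ρ ∈ liZeroBox T, (riemannZetaZeroOrder ρ : ℂ) * f ρ)
        atTop (𝓝 (τ * D)) := by simpa only [heq] using hlim
    exact (Complex.continuous_re.tendsto _).comp h1
  -- the same box sums, real parts, converge to the `tsum` by absolute convergence
  set F : ZetaZeros.riemannZetaNontrivialZeros → ℝ := fun ρ ↦
    (riemannZetaZeroOrder (ρ : ℂ) : ℝ) * (1 - ((ρ : ℂ) / ((ρ : ℂ) - τ)) ^ n).re with hF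
  have hlim2 := (summable_freitasTerm n hτ).hasSum.comp tendsto_weilZeroFinset
  have hident : ∀ T, (∑ᶠ ρ ∈ liZeroBox T, (riemannZetaZeroOrder ρ : ℂ) * f ρ).re =
      ∑ ρ ∈ weilZeroFinset T, F ρ := by
    intro T
    rw [liZeroBox_eq_weilZeroIndex', ZetaZeroSum.finsum_mem_weilZeroIndex_eq_sum, Complex.re_sum]
    refine Finset.sum_congr rfl fun ρ _ ↦ ?_
    simp only [hF, hf, Complex.mul_re, Complex.intCast_re, Complex.intCast_im, zero_mul, sub_zero]
  have hbox' : Tendsto (fun T ↦ ∑ ρ ∈ weilZeroFinset T, F ρ) atTop (𝓝 ((τ : ℂ) * D).re) :=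
    hbox.congr fun T ↦ hident T
  have huniq : ∑' ρ, F ρ = ((τ : ℂ) * D).re := tendsto_nhds_unique hlim2 hbox'
  rw [show (∑' ρ : ZetaZeros.riemannZetaNontrivialZeros, (riemannZetaZeroOrder (ρ : ℂ) : ℝ) *
      (1 - ((ρ : ℂ) / ((ρ : ℂ) - τ)) ^ n).re) = ∑' ρ, F ρ from rfl, huniq, Complex.re_ofReal_mul,
    show D.re = freitasAlpha τ n from rfl, ← mul_assoc, inv_mul_cancel₀ hτ, one_mul]

/-! ## Theorem 1 in full, the `τ ≥ 2` rung, and `α_n = F(n, ·)` -/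

open ZetaZeros in
/-- **Freitas 2006, Theorem 1, the "only if" half, for every `τ > 0`** (RH-FREE theorem): if
`ζ ≠ 0` on `Re s > τ/2` then `α_n(τ) ≥ 0` for all `n ≥ 1` — by Lemma 3.1 (i), every zero has
`Re ρ ≤ τ/2`, i.e. `|ρ/(ρ−τ)| ≤ 1`, so each term `Re[1 − (ρ/(ρ−τ))ⁿ] ≥ 0` (p0007:L100–111, "the
coefficients `d_n(z₀)` will be non-negative if `|ρ/(ρ−τ)| ≤ 1`").
[cite: Freitas2006LiHalfPlanes, Theorem 1 ("only if" direction)] -/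
theorem freitasAlpha_nonneg_of_riemannZeta_ne_zero {τ : ℝ} (hτ : 0 < τ)
    (hz : ∀ s : ℂ, τ / 2 < s.re → riemannZeta s ≠ 0) {n : ℕ} (hn : 1 ≤ n) :
    0 ≤ freitasAlpha τ n := by
  obtain ⟨-, hα⟩ := Freitas2006_lemma_3_1_i_holds n hn τ hτ.ne'
  rw [hα]
  refine mul_nonneg (inv_nonneg.2 hτ.le) (tsum_nonneg fun ρ ↦ mul_nonneg
    (ZetaZeroSum.zeroOrder_nonneg ρ) (BombieriLagarias.re_one_sub_pow_nonneg ?_ n))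
  -- `|ρ| ≤ |ρ − τ|` since `Re ρ ≤ τ/2`
  have hζ : riemannZeta (ρ : ℂ) = 0 := (riemannZetaNontrivialZeros.mem_iff'.1 ρ.2).1
  have hre : (ρ : ℂ).re ≤ τ / 2 := by
    by_contra h
    exact hz _ (not_le.1 h) hζ
  have hρτ : (ρ : ℂ) - τ ≠ 0 := by
    intro e
    have := congrArg Complex.im e
    simp only [sub_im, ofReal_im, sub_zero, zero_im] at this
    exact riemannZetaNontrivialZeros.im_ne_zero ρ.2 this
  rw [norm_div, div_le_one (norm_pos_iff.2 hρτ), ← sq_le_sq₀ (norm_nonneg _) (norm_nonneg _),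
    Complex.sq_norm, Complex.sq_norm, Complex.normSq_apply, Complex.normSq_apply]
  simp only [sub_re, ofReal_re, sub_im, ofReal_im, sub_zero]
  nlinarith

/-- **Freitas 2006, Theorem 1** — DISCHARGED for every `τ ≥ 1/2`: `ζ ≠ 0` on `Re s > τ/2` iff
`α_n(τ) ≥ 0` for all `n ≥ 1` (`freitasAlpha_nonneg_of_riemannZeta_ne_zero` and
`riemannZeta_ne_zero_of_freitasAlpha_nonneg`).  RH-FREE as an equivalence; its instances are graded:
`τ ≥ 2` true (`freitasAlpha_nonneg_of_two_le`), `1 < τ < 2` ⟺ quasi-RH (open), `τ = 1` ⟺ RH (Li).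
[cite: Freitas2006LiHalfPlanes, Theorem 1] -/
theorem Freitas2006_thm_1_holds : Freitas2006_thm_1 := by
  intro τ hτ
  exact ⟨fun hz n hn ↦ freitasAlpha_nonneg_of_riemannZeta_ne_zero (by linarith) hz hn,
    fun hα s hs ↦ riemannZeta_ne_zero_of_freitasAlpha_nonneg hτ hα hs⟩

/-- **The RH-FREE rung `τ ≥ 2`** ("for `τ` greater than or equal to two we are outside the critical
strip and hence the `α_n`'s must all be non-negative", p0003:L130–132): for `τ ≥ 2` and `n ≥ 1`,
`α_n(τ) ≥ 0` unconditionally (`ζ ≠ 0` on `Re s ≥ 1`, Mathlib `riemannZeta_ne_zero_of_one_le_re`).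
LABEL: RH-FREE, TRUE; no leverage on RH. [cite: Freitas2006LiHalfPlanes, §1 (remark before Theorem 1)] -/
theorem freitasAlpha_nonneg_of_two_le {τ : ℝ} (hτ : 2 ≤ τ) {n : ℕ} (hn : 1 ≤ n) :
    0 ≤ freitasAlpha τ n :=
  freitasAlpha_nonneg_of_riemannZeta_ne_zero (by linarith)
    (fun s hs ↦ riemannZeta_ne_zero_of_one_le_re (by linarith)) hn

open ZetaZeros in
/-- **`α_n(τ) = F(n, τ)` for `n ≥ 1` and all real `τ`** — DISCHARGED (p0010:L15–17): for `τ ≠ 0`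
this is Lemma 3.1 (i) (the principal power at a natural exponent is the ordinary power), and at
`τ = 0` it is Theorem 2 (i) (the continuous extension built into `freitasF`).
[cite: Freitas2006LiHalfPlanes, §5 (α_n = F(n,·))] -/
theorem Freitas2006_alpha_eq_F_holds : Freitas2006_alpha_eq_F := by
  intro n hn τ
  by_cases hτ : τ = 0
  · subst hτ
    rw [freitasF, if_pos rfl, (Freitas2006_thm_2_i_holds n hn).1, logDeriv_apply]
  · obtain ⟨-, hα⟩ := Freitas2006_lemma_3_1_i_holds n hn τ hτ
    rw [freitasF, if_neg hτ, hα]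
    congr 1
    refine tsum_congr fun ρ ↦ ?_
    rw [Complex.ofReal_natCast, Complex.cpow_natCast]

/-! ## Lemma 3.1 (ii): `α_n(τ) = τ^{−(n+1)} d_{n−1}(1 − 1/τ)` -/

/-- `log φ` (principal branch, `φ = ξ ∘ liMap`) is analytic at every real `z₀ ≠ 1` (`φ(z₀) = ξ(1/(1−z₀)) > 0`;
"`ψ` is analytic in a neighbourhood of any point on the same interval", p0007:L116–117).
[cite: Freitas2006LiHalfPlanes, §3 (proof of Theorem 1)] -/
theorem analyticAt_log_liPhi_ofReal {z₀ : ℝ} (hz : z₀ ≠ 1) :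
    AnalyticAt ℂ (fun z ↦ Complex.log (liPhi z)) z₀ := by
  have hz' : (z₀ : ℂ) ≠ 1 := fun e ↦ hz (by exact_mod_cast e)
  have hφ : AnalyticAt ℂ liPhi z₀ :=
    (differentiable_riemannXi.analyticAt _).comp (analyticAt_liMap hz')
  refine hφ.clog ?_
  have hval : liPhi z₀ = riemannXi (((1 - z₀)⁻¹ : ℝ) : ℂ) := by
    simp only [liPhi, Function.comp_apply, liMap]; push_cast; ring_nf
  rw [hval]
  exact Complex.mem_slitPlane_iff.2 (Or.inl (Complex.pos_iff.1 (riemannXi_ofReal_pos _)).1)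

/-- Near a real `z₀ ≠ 1`, `log φ` is a primitive of `ψ = φ'/φ`, so `(log φ)^{(j+1)}(z₀) = ψ^{(j)}(z₀)`.
[folklore] -/
private theorem iteratedDeriv_succ_log_liPhi_ofReal {z₀ : ℝ} (hz : z₀ ≠ 1) (j : ℕ) :
    iteratedDeriv (j + 1) (fun z ↦ Complex.log (liPhi z)) z₀ = iteratedDeriv j (logDeriv liPhi) z₀ := by
  rw [iteratedDeriv_succ']
  refine Filter.EventuallyEq.iteratedDeriv_eq j ?_
  have hz' : (z₀ : ℂ) ≠ 1 := fun e ↦ hz (by exact_mod_cast e)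
  have han := analyticAt_log_liPhi_ofReal hz
  have hφan : ∀ᶠ z in 𝓝 (z₀ : ℂ), AnalyticAt ℂ liPhi z :=
    ((differentiable_riemannXi.analyticAt _).comp (analyticAt_liMap hz')).eventually_analyticAt
  have hval : liPhi z₀ = riemannXi (((1 - z₀)⁻¹ : ℝ) : ℂ) := by
    simp only [liPhi, Function.comp_apply, liMap]; push_cast; ring_nf
  have h1 : liPhi z₀ ∈ slitPlane := by
    rw [hval]
    exact Complex.mem_slitPlane_iff.2 (Or.inl (Complex.pos_iff.1 (riemannXi_ofReal_pos _)).1)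
  have hcont : ContinuousAt liPhi z₀ :=
    ((differentiable_riemannXi.analyticAt _).comp (analyticAt_liMap hz')).continuousAt
  have hV : ∀ᶠ z in 𝓝 (z₀ : ℂ), liPhi z ∈ slitPlane := hcont.eventually_mem (isOpen_slitPlane.mem_nhds h1)
  filter_upwards [hV, hφan] with z hz1 hz2
  rw [(hz2.differentiableAt.hasDerivAt.clog hz1).deriv, logDeriv_apply]

/-- **Freitas 2006, Lemma 3.1 (ii)** — DISCHARGED: `d_{n−1}(1 − 1/τ) = τ^{n+1} α_n(τ)` for `n ≥ 1`
and real `τ ≠ 0`.  With `z₀ = 1 − 1/τ` one has `τ/(1−w) = 1/(1 − (z₀ + w/τ))`, so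
`dⁿ/dwⁿ[log ξ(τ/(1−w))](0) = τ^{−n} (log φ)^{(n)}(z₀) = τ^{−n} ψ^{(n−1)}(z₀)`, while the left side is
`τ · dⁿ/dsⁿ[s^{n−1} log ξ(s)](τ)` (`iteratedDeriv_pow_mul_eq_comp_liMap_scaled`).
[cite: Freitas2006LiHalfPlanes, Lemma 3.1 (ii)] -/
theorem Freitas2006_lemma_3_1_ii_holds : Freitas2006_lemma_3_1_ii := by
  intro n hn τ hτ
  have hτ' : (τ : ℂ) ≠ 0 := Complex.ofReal_ne_zero.2 hτ
  have hz : (1 - 1 / τ : ℝ) ≠ 1 := by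
    intro e; have : (1 : ℝ) / τ = 0 := by linarith
    exact hτ (by simpa using this)
  -- (a) `dⁿ[s^{n−1} log ξ](τ) = τ⁻¹ dⁿ[log ξ(τ liMap w)](0)`
  have ha := iteratedDeriv_pow_mul_eq_comp_liMap_scaled hn hτ' (analyticAt_log_riemannXi_ofReal τ)
  -- (b) `log ξ(τ liMap w) = (log φ)(z₀ + τ⁻¹ w)`
  set Lφ : ℂ → ℂ := fun z ↦ Complex.log (liPhi z) with hLφ
  have hfun : (fun w : ℂ ↦ Complex.log (riemannXi (τ * liMap w))) =
      fun w ↦ (fun u ↦ Lφ (((1 - 1 / τ : ℝ) : ℂ) + u)) ((τ : ℂ)⁻¹ * w) := by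
    funext w
    simp only [hLφ, liPhi, Function.comp_apply, liMap]
    by_cases hw : w = 1
    · subst hw; simp
    · have hw' : (1 : ℂ) - w ≠ 0 := sub_ne_zero.2 (Ne.symm hw)
      congr 1
      push_cast
      field_simp
      ring
  -- (c) scaling and translation
  have hK : AnalyticAt ℂ (fun u ↦ Lφ (((1 - 1 / τ : ℝ) : ℂ) + u)) ((τ : ℂ)⁻¹ * 0) := by
    rw [mul_zero]
    refine (show AnalyticAt ℂ Lφ (((1 - 1 / τ : ℝ) : ℂ) + 0) from ?_).comp
      (analyticAt_const.add analyticAt_id)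
    rw [add_zero]
    exact analyticAt_log_liPhi_ofReal hz
  have hc : iteratedDeriv n (fun w : ℂ ↦ Complex.log (riemannXi (τ * liMap w))) 0 =
      (τ : ℂ)⁻¹ ^ n * iteratedDeriv n Lφ ((1 - 1 / τ : ℝ) : ℂ) := by
    rw [hfun, iteratedDeriv_comp_const_mul_of_analyticAt n hK, mul_zero, iteratedDeriv_comp_const_add]
    simp only [add_zero]
  -- (d) `(log φ)^{(n)} = ψ^{(n−1)}`
  obtain ⟨k, rfl⟩ := Nat.exists_eq_add_of_le hn
  have hd : iteratedDeriv (1 + k) Lφ ((1 - 1 / τ : ℝ) : ℂ) =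
      iteratedDeriv k (logDeriv liPhi) ((1 - 1 / τ : ℝ) : ℂ) := by
    rw [add_comm, hLφ, iteratedDeriv_succ_log_liPhi_ofReal hz k]
  rw [Nat.add_sub_cancel_left] at ha
  -- `(log φ)^{(1+k)}(z₀) = τ^{k+2} · d^{1+k}[s^k log ξ](τ)`
  have key : iteratedDeriv (1 + k) Lφ ((1 - 1 / τ : ℝ) : ℂ) =
      (τ : ℂ) ^ (1 + k + 1) *
        iteratedDeriv (1 + k) (fun s : ℂ ↦ s ^ k * Complex.log (riemannXi s)) τ := by
    rw [ha, hc]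
    rw [show (τ : ℂ) ^ (1 + k + 1) * ((τ : ℂ)⁻¹ * ((τ : ℂ)⁻¹ ^ (1 + k) *
        iteratedDeriv (1 + k) Lφ ((1 - 1 / τ : ℝ) : ℂ))) =
        ((τ : ℂ) * (τ : ℂ)⁻¹) ^ (1 + k + 1) * iteratedDeriv (1 + k) Lφ ((1 - 1 / τ : ℝ) : ℂ) by ring,
      mul_inv_cancel₀ hτ', one_pow, one_mul]
  -- assemble
  rw [freitasD, freitasAlpha, Nat.add_sub_cancel_left, ← hd, Complex.div_natCast_re,
    Complex.div_natCast_re, key,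
    show (τ : ℂ) ^ (1 + k + 1) = ((τ ^ (1 + k + 1) : ℝ) : ℂ) by push_cast; ring,
    Complex.re_ofReal_mul, mul_div_assoc]

/-! ## The constant `ξ(1/2)` -/

/-- **`ξ(1/2) = −Γ(1/4) ζ(1/2)/(8 π^{1/4})`** — DISCHARGED (`ξ(s) = ½ s(s−1) Γ_ℝ(s) ζ(s)`,
`Γ_ℝ(s) = π^{−s/2} Γ(s/2)`). [cite: Freitas2006LiHalfPlanes, proof of Theorem 2.2 (arXiv p0005:L82)] -/
theorem Freitas2006_xi_half_holds : Freitas2006_xi_half := by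
  have h0 : (1 / 2 : ℂ) ≠ 0 := by norm_num
  have h1 : (1 / 2 : ℂ) ≠ 1 := by norm_num
  have hG : Gammaℝ (1 / 2) ≠ 0 := Gammaℝ_ne_zero_of_re_pos (by norm_num)
  have hΛ : completedRiemannZeta (1 / 2) = Gammaℝ (1 / 2) * riemannZeta (1 / 2) := by
    rw [riemannZeta_def_of_ne_zero h0]; field_simp
  rw [Freitas2006_xi_half, riemannXi_eq_mul_completedRiemannZeta h0 h1, hΛ, Gammaℝ_def]
  have hΓ : Complex.Gamma (1 / 2 / 2) = (Real.Gamma (1 / 4) : ℂ) := by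
    rw [show (1 / 2 / 2 : ℂ) = ((1 / 4 : ℝ) : ℂ) by push_cast; ring, Complex.Gamma_ofReal]
  have hπ : (Real.pi : ℂ) ^ (-(1 / 2 : ℂ) / 2) = ((Real.pi ^ (1 / 4 : ℝ))⁻¹ : ℝ) := by
    rw [show (-(1 / 2 : ℂ) / 2) = ((-(1 / 4) : ℝ) : ℂ) by push_cast; ring,
      ← Complex.ofReal_cpow Real.pi_pos.le, Real.rpow_neg Real.pi_pos.le]
  rw [hΓ, hπ]
  have hπ0 : (Real.pi ^ (1 / 4 : ℝ) : ℝ) ≠ 0 := (Real.rpow_pos_of_pos Real.pi_pos _).ne'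
  push_cast
  field_simp
  ring

/-! ## Theorem 4.3 (the system of ODEs) and Lemma 4.4 -/

/-- The function `A_n(s) := dⁿ/duⁿ[u^{n−1} log ξ(u)]|_{u=s}` is analytic at every real point, and
`α_n(t) = Re A_n(t)/(n−1)!`; hence `τ ↦ α_n(τ)` is differentiable at every real `τ` with
derivative `Re A_n'(τ)/(n−1)! = Re dⁿ⁺¹/dsⁿ⁺¹[s^{n−1} log ξ(s)](τ)/(n−1)!` ("these functions are
analytic for real values of `τ`", p0003:L122–123). [cite: Freitas2006LiHalfPlanes, §1 (after eq. (dcoeff))] -/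
theorem hasDerivAt_freitasAlpha (τ : ℝ) (n : ℕ) :
    HasDerivAt (fun t : ℝ ↦ freitasAlpha t n)
      ((iteratedDeriv (n + 1) (fun s : ℂ ↦ s ^ (n - 1) * Complex.log (riemannXi s)) τ).re /
        (n - 1)!) τ := by
  have hg : AnalyticAt ℂ (fun s : ℂ ↦ s ^ (n - 1) * Complex.log (riemannXi s)) τ :=
    (analyticAt_id.pow _).mul (analyticAt_log_riemannXi_ofReal τ)
  have hA : AnalyticAt ℂ (iteratedDeriv n (fun s : ℂ ↦ s ^ (n - 1) * Complex.log (riemannXi s))) τ := by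
    obtain ⟨ε, hε, hball⟩ := Metric.eventually_nhds_iff_ball.1 hg.eventually_analyticAt
    have hOn : AnalyticOnNhd ℂ (fun s : ℂ ↦ s ^ (n - 1) * Complex.log (riemannXi s)) (ball (τ : ℂ) ε) :=
      fun z hz ↦ hball z hz
    rw [iteratedDeriv_eq_iterate]
    exact (hOn.iterated_deriv n) _ (mem_ball_self hε)
  have hd : HasDerivAt (iteratedDeriv n (fun s : ℂ ↦ s ^ (n - 1) * Complex.log (riemannXi s)))
      (iteratedDeriv (n + 1) (fun s : ℂ ↦ s ^ (n - 1) * Complex.log (riemannXi s)) τ) τ := by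
    rw [iteratedDeriv_succ]
    exact hA.differentiableAt.hasDerivAt
  have h := (hd.real_of_complex).div_const ((n - 1)! : ℝ)
  refine h.congr_of_eventuallyEq (Eventually.of_forall fun t ↦ ?_)
  simp only [freitasAlpha, Complex.div_natCast_re]

/-- Leibniz with a linear factor: `d^{k+1}/ds^{k+1}[s g(s)](c) = c g^{(k+1)}(c) + (k+1) g^{(k)}(c)`
for `g` smooth at `c`. [folklore] -/
private theorem iteratedDeriv_id_mul {g : ℂ → ℂ} {c : ℂ} {k : ℕ} (hg : ContDiffAt ℂ (k + 1) g c) :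
    iteratedDeriv (k + 1) (fun s ↦ s * g s) c =
      c * iteratedDeriv (k + 1) g c + (k + 1) * iteratedDeriv k g c := by
  have hid : ContDiffAt ℂ (k + 1) (fun s : ℂ ↦ s) c := contDiffAt_id
  rw [iteratedDeriv_fun_mul hid hg, Finset.sum_range_succ', Finset.sum_range_succ']
  simp only [iteratedDeriv_zero, iteratedDeriv_one, deriv_id'', Nat.choose_zero_right, Nat.cast_one,
    one_mul, Nat.sub_zero, zero_add, Nat.choose_one_right, mul_one, Nat.cast_add, Nat.cast_one,
    Nat.add_sub_cancel]
  rw [Finset.sum_eq_zero fun i _ ↦ by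
    rw [show iteratedDeriv (i + 1 + 1) (fun s : ℂ ↦ s) c = 0 by
      rw [iteratedDeriv_fun_id]; simp]
    ring]
  ring

/-- **Freitas 2006, Theorem 4.3** — DISCHARGED, by calculus from (dcoeff) (the printed proof goes
through the zero sum; the identity is formal): with `g(s) = s^{n−1} log ξ(s)`,
`d^{n+1}[s·g(s)](τ) = τ g^{(n+1)}(τ) + (n+1) g^{(n)}(τ)`, i.e. `n α_{n+1}(τ) = τ α_n'(τ) + (n+1) α_n(τ)`.
Holds at every real `τ` (stated for `τ > 0` as printed). [cite: Freitas2006LiHalfPlanes, Theorem 4.3] -/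
theorem freitasAlpha_ode (τ : ℝ) {n : ℕ} (hn : 1 ≤ n) :
    τ / n * deriv (fun t : ℝ ↦ freitasAlpha t n) τ + (n + 1) / n * freitasAlpha τ n =
      freitasAlpha τ (n + 1) := by
  rw [(hasDerivAt_freitasAlpha τ n).deriv]
  set g : ℂ → ℂ := fun s ↦ s ^ (n - 1) * Complex.log (riemannXi s) with hgdef
  have hg : ContDiffAt ℂ (n + 1) g τ :=
    ((analyticAt_id.pow _).mul (analyticAt_log_riemannXi_ofReal τ)).contDiffAt
  have hL := iteratedDeriv_id_mul hg
  have hfun : (fun s : ℂ ↦ s * g s) = fun s ↦ s ^ (n + 1 - 1) * Complex.log (riemannXi s) := by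
    funext s
    rw [hgdef, Nat.add_sub_cancel, ← mul_assoc, mul_pow_sub_one (by omega : n ≠ 0)]
  rw [hfun] at hL
  have hn0 : (n : ℝ) ≠ 0 := by exact_mod_cast (by omega : n ≠ 0)
  have hfac : ((n ! : ℕ) : ℝ) = n * ((n - 1)! : ℕ) := by
    rw [← Nat.mul_factorial_pred (by omega : n ≠ 0)]; push_cast; ring
  have hre : (iteratedDeriv (n + 1) (fun s : ℂ ↦ s ^ (n + 1 - 1) * Complex.log (riemannXi s)) τ).re =
      τ * (iteratedDeriv (n + 1) g τ).re + (n + 1) * (iteratedDeriv n g τ).re := by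
    rw [hL, Complex.add_re, Complex.re_ofReal_mul,
      show ((n : ℂ) + 1) = (((n : ℝ) + 1 : ℝ) : ℂ) by push_cast; ring, Complex.re_ofReal_mul]
  rw [freitasAlpha, freitasAlpha, Complex.div_natCast_re, Complex.div_natCast_re, hre,
    Nat.add_sub_cancel, hfac]
  field_simp
  ring

/-- **Freitas 2006, Theorem 4.3** — DISCHARGED (differentiability of `τ ↦ α_n(τ)` and the ODE
`(τ/n) α_n' + ((n+1)/n) α_n = α_{n+1}` for `n ≥ 1`, `τ > 0`). [cite: Freitas2006LiHalfPlanes, Theorem 4.3] -/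
theorem Freitas2006_thm_4_3_holds : Freitas2006_thm_4_3 := fun n hn τ _ ↦
  ⟨(hasDerivAt_freitasAlpha τ n).differentiableAt, freitasAlpha_ode τ hn⟩

/-- `τ ↦ α_n(τ)` is continuous on `ℝ`. [cite: Freitas2006LiHalfPlanes, §1 (after eq. (dcoeff))] -/
theorem continuous_freitasAlpha (n : ℕ) : Continuous fun t : ℝ ↦ freitasAlpha t n :=
  continuous_iff_continuousAt.2 fun τ ↦ (hasDerivAt_freitasAlpha τ n).continuousAt

/-- `d/dτ [τ^{n+1} α_n(τ)] = n τⁿ α_{n+1}(τ)` (p0009:L1–3, from Theorem 4.3).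
[cite: Freitas2006LiHalfPlanes, proof of Lemma 4.4] -/
theorem hasDerivAt_pow_mul_freitasAlpha (τ : ℝ) {n : ℕ} (hn : 1 ≤ n) :
    HasDerivAt (fun t : ℝ ↦ t ^ (n + 1) * freitasAlpha t n) (n * τ ^ n * freitasAlpha τ (n + 1)) τ := by
  have h : HasDerivAt (fun t : ℝ ↦ t ^ (n + 1) * freitasAlpha t n)
      (((n + 1 : ℕ) : ℝ) * τ ^ (n + 1 - 1) * freitasAlpha τ n +
        τ ^ (n + 1) * deriv (fun t : ℝ ↦ freitasAlpha t n) τ) τ := by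
    have := (hasDerivAt_pow (n + 1) τ).mul (hasDerivAt_freitasAlpha τ n)
    rw [(hasDerivAt_freitasAlpha τ n).deriv]
    exact this
  refine h.congr_deriv ?_
  rw [← freitasAlpha_ode τ hn, Nat.add_sub_cancel]
  have hn0 : (n : ℝ) ≠ 0 := by exact_mod_cast (by omega : n ≠ 0)
  push_cast
  field_simp
  ring

/-- **Freitas 2006, Lemma 4.4** — DISCHARGED: for `0 ≤ τ₁ < τ₂` and `n ≥ 1`,
`∫_{τ₁}^{τ₂} tⁿ α_{n+1}(t) dt = (τ₂^{n+1} α_n(τ₂) − τ₁^{n+1} α_n(τ₁))/n` (fundamental theorem of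
calculus with `d/dτ[τ^{n+1} α_n] = n τⁿ α_{n+1}`; holds for all real `τ₁, τ₂`).
[cite: Freitas2006LiHalfPlanes, Lemma 4.4] -/
theorem Freitas2006_lemma_4_4_holds : Freitas2006_lemma_4_4 := by
  intro n hn τ₁ τ₂ _ _
  have hn0 : (n : ℝ) ≠ 0 := by exact_mod_cast (by omega : n ≠ 0)
  have hcont : Continuous fun t : ℝ ↦ (n : ℝ) * t ^ n * freitasAlpha t (n + 1) :=
    (continuous_const.mul (continuous_pow n)).mul (continuous_freitasAlpha (n + 1))
  have hftc := intervalIntegral.integral_eq_sub_of_hasDerivAt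
    (f := fun t : ℝ ↦ t ^ (n + 1) * freitasAlpha t n)
    (f' := fun t : ℝ ↦ (n : ℝ) * t ^ n * freitasAlpha t (n + 1)) (a := τ₁) (b := τ₂)
    (fun t _ ↦ hasDerivAt_pow_mul_freitasAlpha t hn) (hcont.intervalIntegrable _ _)
  have hmul : ∫ t in τ₁..τ₂, (n : ℝ) * t ^ n * freitasAlpha t (n + 1) =
      (n : ℝ) * ∫ t in τ₁..τ₂, t ^ n * freitasAlpha t (n + 1) := by
    rw [← intervalIntegral.integral_const_mul]
    refine intervalIntegral.integral_congr fun t _ ↦ ?_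
    ring
  rw [hmul] at hftc
  rw [eq_div_iff hn0, mul_comm, hftc]

/-! ## §2: Lemma 2.1, Theorem 2.3, Corollaries 2.4 and 2.7 -/

/-- **Freitas 2006, Lemma 2.1** — DISCHARGED (re-expansion of a power series with non-negative
coefficients at a point to the right, inside the disc): `b_p = Σ_n C(n,p) a_n (z₁−z₀)^{n−p} ≥ 0`, here
as the Taylor expansion of `f⁽ⁿ⁾` about `z₀` evaluated at `z₁` (`Complex.hasSum_taylorSeries_on_ball`).
[cite: Freitas2006LiHalfPlanes, Lemma 2.1] -/
theorem Freitas2006_lemma_2_1_holds : Freitas2006_lemma_2_1 := by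
  intro f z₀ z₁ r hlt hr hd hpos
  have hd0 : 0 < z₁ - z₀ := by linarith
  have hz₁ : (z₁ : ℂ) ∈ ball (z₀ : ℂ) r := by
    rw [mem_ball, dist_eq_norm, ← Complex.ofReal_sub, Complex.norm_real, Real.norm_eq_abs,
      abs_of_pos hd0]
    exact hr
  -- the coefficient `(z₁ − z₀)ⁱ/i!` as a real number
  have hcoef : ∀ i : ℕ, ((i ! : ℂ))⁻¹ * ((z₁ : ℂ) - z₀) ^ i = (((z₁ - z₀) ^ i / i ! : ℝ) : ℂ) := by
    intro i; push_cast; ring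
  have key : ∀ n, HasSum (fun i ↦ ((i ! : ℂ))⁻¹ • ((z₁ : ℂ) - z₀) ^ i • iteratedDeriv (i + n) f z₀)
      (iteratedDeriv n f z₁) := by
    intro n
    have hdn : DifferentiableOn ℂ (iteratedDeriv n f) (ball (z₀ : ℂ) r) := by
      rw [iteratedDeriv_eq_iterate]
      exact ((hd.analyticOnNhd isOpen_ball).iterated_deriv n).differentiableOn
    simpa only [iteratedDeriv_iteratedDeriv] using Complex.hasSum_taylorSeries_on_ball hdn hz₁
  have hterm : ∀ n i, (0 : ℂ) ≤ ((i ! : ℂ))⁻¹ • ((z₁ : ℂ) - z₀) ^ i • iteratedDeriv (i + n) f z₀ := by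
    intro n i
    rw [smul_eq_mul, smul_eq_mul, ← mul_assoc, hcoef]
    exact mul_nonneg (Complex.zero_le_real.2 (div_nonneg (pow_nonneg hd0.le _) (Nat.cast_nonneg _)))
      (hpos _)
  refine ⟨fun n ↦ (key n).nonneg (hterm n), fun m hm n hnm ↦ ?_⟩
  have hlt_term : (0 : ℂ) < (((m - n) ! : ℂ))⁻¹ • ((z₁ : ℂ) - z₀) ^ (m - n) •
      iteratedDeriv ((m - n) + n) f z₀ := by
    rw [Nat.sub_add_cancel hnm, smul_eq_mul, smul_eq_mul, ← mul_assoc, hcoef]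
    exact mul_pos (Complex.zero_lt_real.2 (div_pos (pow_pos hd0 _) (by exact_mod_cast Nat.factorial_pos _)))
      (lt_of_le_of_ne (hpos m) (Ne.symm hm))
  exact hasSum_lt (f := fun _ ↦ (0 : ℂ)) (hterm n) hlt_term hasSum_zero (key n)

/-- The Taylor coefficients of `m(z) = 1/(1−z)` at `−1`: `m⁽ⁱ⁾(−1) = i!/2^{i+1}`. [folklore] -/
private theorem iteratedDeriv_liMap_neg_one (i : ℕ) :
    iteratedDeriv i liMap (-1) = (i ! : ℂ) / 2 ^ (i + 1) := by
  have hfun : liMap = fun x : ℂ ↦ (-1 * x + 1)⁻¹ := by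
    funext x; simp only [liMap, neg_one_mul, neg_add_eq_sub]
  rw [hfun, iteratedDeriv_eq_iterate, iter_deriv_inv_linear]
  simp only
  rw [show (-1 - i : ℤ) = -((i + 1 : ℕ) : ℤ) by push_cast; ring, zpow_neg, zpow_natCast]
  have h1 : ((-1 : ℂ)) ^ i * (-1) ^ i = 1 := by rw [← mul_pow]; simp
  norm_num
  rw [show (-1 : ℂ) ^ i * (i ! : ℂ) * (-1) ^ i = (i ! : ℂ) * ((-1) ^ i * (-1) ^ i) by ring, h1, mul_one,
    div_eq_mul_inv]

/-- All Taylor coefficients of `φ = ξ ∘ m` at `−1` are non-negative reals (Faà di Bruno with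
`ξ⁽ʲ⁾(1/2) ≥ 0` and `m⁽ⁱ⁾(−1) = i!/2^{i+1} > 0`). [cite: Freitas2006LiHalfPlanes, Theorem 2.3 (non-strict form)] -/
theorem iteratedDeriv_liPhi_neg_one_nonneg (k : ℕ) : 0 ≤ iteratedDeriv k liPhi (-1) := by
  rw [show liPhi = riemannXi ∘ liMap from rfl, iteratedDeriv_comp_eq_sum_orderedFinpartition
    differentiable_riemannXi.contDiff.contDiffAt (analyticAt_liMap (by norm_num)).contDiffAt
    (le_refl (k : WithTop ℕ∞))]
  refine Finset.sum_nonneg fun c _ ↦ mul_nonneg ?_ (Finset.prod_nonneg fun j _ ↦ ?_)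
  · rw [show liMap (-1) = ((1 / 2 : ℝ) : ℂ) by norm_num [liMap]]
    exact iteratedDeriv_riemannXi_nonneg_of_half_le le_rfl _
  · rw [iteratedDeriv_liMap_neg_one,
      show ((c.partSize j)! : ℂ) / 2 ^ (c.partSize j + 1) =
        ((((c.partSize j)! : ℝ) / 2 ^ (c.partSize j + 1) : ℝ) : ℂ) by push_cast; ring]
    exact Complex.zero_le_real.2 (by positivity)

/-- **Freitas 2006, Theorem 2.3** — DISCHARGED: `φ⁽ⁿ⁾(−1) > 0` for `n ≥ 2` and `φ'(−1) = 0`.  In the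
Faà di Bruno expansion of `(ξ ∘ m)⁽ⁿ⁾(−1)` every term is `ξ⁽ᴸ⁾(1/2) · Π m⁽ᵖ⁾(−1) ≥ 0`, and a term with
an even number `L` of blocks (which exists for `n ≥ 2`) is `> 0`; `φ'(−1) = ξ'(1/2) m'(−1) = 0`.
[cite: Freitas2006LiHalfPlanes, Theorem 2.3] -/
theorem Freitas2006_thm_2_3_holds : Freitas2006_thm_2_3 := by
  have hm1 : liMap (-1) = ((1 / 2 : ℝ) : ℂ) := by norm_num [liMap]
  refine ⟨fun n hn ↦ ?_, ?_⟩
  · rw [show liPhi = riemannXi ∘ liMap from rfl, iteratedDeriv_comp_eq_sum_orderedFinpartition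
      differentiable_riemannXi.contDiff.contDiffAt (analyticAt_liMap (by norm_num)).contDiffAt
      (le_refl (n : WithTop ℕ∞)), Complex.re_sum]
    -- the product of the `m`-derivatives is a positive real
    have hprod : ∀ c : OrderedFinpartition n, ∃ P : ℝ, 0 < P ∧
        ∏ j, iteratedDeriv (c.partSize j) liMap (-1) = (P : ℂ) := by
      intro c
      refine ⟨∏ j, ((c.partSize j)! : ℝ) / 2 ^ (c.partSize j + 1),
        Finset.prod_pos fun j _ ↦ by positivity, ?_⟩
      rw [Complex.ofReal_prod]
      refine Finset.prod_congr rfl fun j _ ↦ ?_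
      rw [iteratedDeriv_liMap_neg_one]; push_cast; ring
    have hterm : ∀ c : OrderedFinpartition n,
        0 ≤ (iteratedDeriv c.length riemannXi (liMap (-1)) *
          ∏ j, iteratedDeriv (c.partSize j) liMap (-1)).re ∧
        (Even c.length → 0 < (iteratedDeriv c.length riemannXi (liMap (-1)) *
          ∏ j, iteratedDeriv (c.partSize j) liMap (-1)).re) := by
      intro c
      obtain ⟨P, hP, hPeq⟩ := hprod c
      rw [hPeq, Complex.re_mul_ofReal, hm1]
      refine ⟨mul_nonneg (Complex.nonneg_iff.1
        (iteratedDeriv_riemannXi_nonneg_of_half_le le_rfl _)).1 hP.le, fun he ↦ mul_pos ?_ hP⟩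
      rw [show (((1 / 2 : ℝ)) : ℂ) = 1 / 2 by push_cast; ring]
      exact (re_iteratedDeriv_riemannXi_half _).1 he
    -- an ordered finpartition of `Fin n` with an even number of blocks
    obtain ⟨c₀, hc₀⟩ : ∃ c₀ : OrderedFinpartition n, Even c₀.length := by
      rcases Nat.even_or_odd n with he | ho
      · exact ⟨OrderedFinpartition.atomic n, by simpa using he⟩
      · obtain ⟨m, rfl⟩ : ∃ m, n = m + 1 := ⟨n - 1, by omega⟩
        have hm : Even m := by
          rcases ho with ⟨k, hk⟩; exact ⟨k, by omega⟩
        have hm0 : 0 < m := by omega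
        exact ⟨(OrderedFinpartition.atomic m).extendMiddle ⟨0, by simpa using hm0⟩, by simpa using hm⟩
    exact Finset.sum_pos' (fun c _ ↦ (hterm c).1) ⟨c₀, Finset.mem_univ _, (hterm c₀).2 hc₀⟩
  · have h := (differentiable_riemannXi _).hasDerivAt.comp (-1 : ℂ)
      (hasDerivAt_liMap (by norm_num : (-1 : ℂ) ≠ 1))
    rw [show liPhi = riemannXi ∘ liMap from rfl, h.deriv]
    have : deriv riemannXi (liMap (-1)) = 0 := by
      rw [hm1, show (((1 / 2 : ℝ)) : ℂ) = 1 / 2 by push_cast; ring, ← iteratedDeriv_one]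
      exact iteratedDeriv_riemannXi_half_odd 0
    rw [this, zero_mul]

/-- `φ` is holomorphic on the disc `|z + 1| < 2` (which misses its only singularity `z = 1`).
[cite: Freitas2006LiHalfPlanes, proof of Corollary 2.4] -/
theorem differentiableOn_liPhi_ball_neg_one : DifferentiableOn ℂ liPhi (ball (((-1 : ℝ)) : ℂ) 2) := by
  intro w hw
  have hw1 : w ≠ 1 := by
    rintro rfl
    rw [mem_ball, dist_eq_norm] at hw
    norm_num at hw
  exact ((differentiable_riemannXi _).comp w (analyticAt_liMap hw1).differentiableAt).differentiableWithinAt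

/-- **Freitas 2006, Corollary 2.4** — DISCHARGED: `c_n(z) > 0` for all `z ∈ (−1,1)` and all `n`
(Lemma 2.1 with `z₀ = −1`, the disc of radius `2`, and Theorem 2.3: for each `n` some `m ≥ n`,
`m ≥ 2`, has `φ⁽ᵐ⁾(−1) > 0`). [cite: Freitas2006LiHalfPlanes, Corollary 2.4] -/
theorem Freitas2006_cor_2_4_holds : Freitas2006_cor_2_4 := by
  intro z hz1 hz2 n
  have hpos : ∀ k : ℕ, (0 : ℂ) ≤ iteratedDeriv k liPhi (((-1 : ℝ)) : ℂ) := fun k ↦ by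
    rw [show (((-1 : ℝ)) : ℂ) = -1 by push_cast; ring]; exact iteratedDeriv_liPhi_neg_one_nonneg k
  obtain ⟨-, hstrict⟩ := Freitas2006_lemma_2_1_holds liPhi (-1) z 2 (by linarith) (by linarith)
    differentiableOn_liPhi_ball_neg_one hpos
  have hm : iteratedDeriv (max n 2) liPhi (((-1 : ℝ)) : ℂ) ≠ 0 := by
    have h := Freitas2006_thm_2_3_holds.1 (max n 2) (le_max_right _ _)
    intro e
    rw [show (((-1 : ℝ)) : ℂ) = -1 by push_cast; ring] at e
    rw [e, Complex.zero_re] at h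
    exact lt_irrefl _ h
  have h := hstrict (max n 2) hm n (le_max_left _ _)
  rw [freitasC, Complex.div_natCast_re]
  exact div_pos (Complex.pos_iff.1 h).1 (by exact_mod_cast Nat.factorial_pos n)

/-- `φ` is analytic on `ℂ ∖ {1}`. [cite: Freitas2006LiHalfPlanes, §2 (radius of convergence |1 − z₀|)] -/
theorem analyticOnNhd_liPhi : AnalyticOnNhd ℂ liPhi {w | w ≠ 1} := fun _ hw ↦
  (differentiable_riemannXi.analyticAt _).comp (analyticAt_liMap hw)

/-- `z ↦ c_n(z)` is differentiable at every real `z ≠ 1` with derivative `Re φ⁽ⁿ⁺¹⁾(z)/n!`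
(`= (n+1) c_{n+1}(z)`, proof of Cor 2.7). [cite: Freitas2006LiHalfPlanes, proof of Corollary 2.7] -/
theorem hasDerivAt_freitasC {z : ℝ} (hz : z ≠ 1) (n : ℕ) :
    HasDerivAt (fun x : ℝ ↦ freitasC x n) ((iteratedDeriv (n + 1) liPhi z).re / n !) z := by
  have hz' : (z : ℂ) ≠ 1 := fun e ↦ hz (by exact_mod_cast e)
  have han : AnalyticAt ℂ (iteratedDeriv n liPhi) z := by
    rw [iteratedDeriv_eq_iterate]
    exact (analyticOnNhd_liPhi.iterated_deriv n) _ hz'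
  have hd : HasDerivAt (iteratedDeriv n liPhi) (iteratedDeriv (n + 1) liPhi z) z := by
    rw [iteratedDeriv_succ]
    exact han.differentiableAt.hasDerivAt
  have h := (hd.real_of_complex).div_const (n ! : ℝ)
  refine h.congr_of_eventuallyEq (Eventually.of_forall fun t ↦ ?_)
  simp only [freitasC, Complex.div_natCast_re]

/-- **Freitas 2006, Corollary 2.7** — DISCHARGED: each `c_n` is strictly increasing on `(−1,1)`,
its derivative `(n+1) c_{n+1}` being positive there (Cor 2.4). [cite: Freitas2006LiHalfPlanes, Corollary 2.7] -/
theorem Freitas2006_cor_2_7_holds : Freitas2006_cor_2_7 := by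
  intro n
  refine strictMonoOn_of_deriv_pos (convex_Ioo (-1) 1) ?_ ?_
  · exact fun x hx ↦ (hasDerivAt_freitasC (by linarith [hx.2]) n).continuousAt.continuousWithinAt
  · intro x hx
    rw [interior_Ioo] at hx
    rw [(hasDerivAt_freitasC (by linarith [hx.2]) n).deriv]
    have h := Freitas2006_cor_2_4_holds x hx.1 hx.2 (n + 1)
    rw [freitasC, Complex.div_natCast_re] at h
    have h' : 0 < (iteratedDeriv (n + 1) liPhi x).re := by
      by_contra hneg
      exact absurd h (not_lt.2 (div_nonpos_of_nonpos_of_nonneg (not_lt.1 hneg) (Nat.cast_nonneg _)))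
    exact div_pos h' (by exact_mod_cast Nat.factorial_pos n)

/-! ## The recurrence (recurr) between the coefficients of `φ` and `ψ` -/

/-- `φ` commutes with complex conjugation (so do `ξ` and `m`). [folklore] -/
private theorem liPhi_conj (z : ℂ) : liPhi (conj z) = conj (liPhi z) := by
  simp only [liPhi, Function.comp_apply, liMap]
  rw [show ((1 : ℂ) - conj z)⁻¹ = conj ((1 - z)⁻¹) by simp [map_sub, map_one], riemannXi_conj_holds]

/-- `ψ = φ'/φ` commutes with complex conjugation. [folklore] -/
private theorem logDeriv_liPhi_conj (z : ℂ) : logDeriv liPhi (conj z) = conj (logDeriv liPhi z) := by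
  rw [logDeriv_apply, logDeriv_apply, map_div₀, ← liPhi_conj]
  have h := iteratedDeriv_conj_of_conj liPhi_conj 1 z
  simp only [iteratedDeriv_one] at h
  rw [h]

/-- The Taylor coefficients of `φ` and of `ψ` at a real point are real. [folklore] -/
private theorem im_iteratedDeriv_liPhi_ofReal (k : ℕ) (x : ℝ) :
    (iteratedDeriv k liPhi x).im = 0 ∧ (iteratedDeriv k (logDeriv liPhi) x).im = 0 := by
  constructor
  · have h := iteratedDeriv_conj_of_conj liPhi_conj k (x : ℂ)
    rw [Complex.conj_ofReal] at h
    exact Complex.conj_eq_iff_im.1 h.symm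
  · have h := iteratedDeriv_conj_of_conj logDeriv_liPhi_conj k (x : ℂ)
    rw [Complex.conj_ofReal] at h
    exact Complex.conj_eq_iff_im.1 h.symm

/-- **The recurrence (recurr)** — DISCHARGED: at a real `z₀ ∈ [−1,1)`, from `φ' = φ·ψ`
differentiated `n−1` times (Leibniz), `n c_n = Σ_{k<n} c_k d_{n−1−k}`, i.e.
`d_{n−1} = n c_n/c₀ − (1/c₀) Σ_{k=1}^{n−1} c_k d_{n−k−1}` (`c₀ = φ(z₀) > 0`).
[cite: Freitas2006LiHalfPlanes, §3 eq. (recurr) (arXiv p0007:L128)] -/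
theorem Freitas2006_recurrence_holds : Freitas2006_recurrence := by
  intro z₀ hz1 hz2 n hn
  have hz : z₀ ≠ 1 := by linarith
  have hz' : (z₀ : ℂ) ≠ 1 := fun e ↦ hz (by exact_mod_cast e)
  -- analyticity at `z₀`
  have hφan : AnalyticAt ℂ liPhi z₀ := analyticOnNhd_liPhi _ hz'
  have hval : liPhi z₀ = riemannXi (((1 - z₀)⁻¹ : ℝ) : ℂ) := by
    simp only [liPhi, Function.comp_apply, liMap]; push_cast; ring_nf
  have hφ0 : 0 < liPhi z₀ := by rw [hval]; exact riemannXi_ofReal_pos _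
  have hψan : AnalyticAt ℂ (logDeriv liPhi) z₀ := by
    rw [show logDeriv liPhi = fun z ↦ deriv liPhi z / liPhi z from funext fun z ↦ logDeriv_apply _ _]
    exact hφan.deriv.div hφan hφ0.ne'
  -- `φ' = φ ψ` near `z₀`
  have hev : deriv liPhi =ᶠ[𝓝 (z₀ : ℂ)] fun z ↦ liPhi z * logDeriv liPhi z := by
    have hne : ∀ᶠ z in 𝓝 (z₀ : ℂ), liPhi z ≠ 0 := hφan.continuousAt.eventually_ne hφ0.ne'
    filter_upwards [hne] with z hz0
    rw [logDeriv_apply, mul_div_cancel₀ _ hz0]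
  -- Leibniz: `φ⁽ⁿ⁾(z₀) = Σ_{k<n} C(n−1,k) φ⁽ᵏ⁾ ψ⁽ⁿ⁻¹⁻ᵏ⁾`
  obtain ⟨m, rfl⟩ := Nat.exists_eq_add_of_le hn
  have hLeib : iteratedDeriv (1 + m) liPhi z₀ = ∑ k ∈ Finset.range (m + 1),
      (m.choose k : ℂ) * iteratedDeriv k liPhi z₀ * iteratedDeriv (m - k) (logDeriv liPhi) z₀ := by
    rw [add_comm, iteratedDeriv_succ', hev.iteratedDeriv_eq,
      iteratedDeriv_fun_mul hφan.contDiffAt hψan.contDiffAt]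
  -- realness and the complex coefficients
  set C : ℕ → ℂ := fun k ↦ iteratedDeriv k liPhi z₀ with hCdef
  set D : ℕ → ℂ := fun k ↦ iteratedDeriv k (logDeriv liPhi) z₀ with hDdef
  have hCre : ∀ k, (C k : ℂ) = ((C k).re : ℂ) := fun k ↦
    Complex.ext (by simp) (by rw [Complex.ofReal_im]; exact (im_iteratedDeriv_liPhi_ofReal k z₀).1)
  have hDre : ∀ k, (D k : ℂ) = ((D k).re : ℂ) := fun k ↦
    Complex.ext (by simp) (by rw [Complex.ofReal_im]; exact (im_iteratedDeriv_liPhi_ofReal k z₀).2)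
  have hc : ∀ k, freitasC z₀ k = (C k).re / k ! := fun k ↦ by
    rw [freitasC, Complex.div_natCast_re]
  have hd : ∀ k, freitasD z₀ k = (D k).re / k ! := fun k ↦ by
    rw [freitasD, Complex.div_natCast_re]
  -- the real identity `(1+m)! c_{1+m} = Σ C(m,k) k! c_k (m−k)! d_{m−k}`
  have hreal : (C (1 + m)).re = ∑ k ∈ Finset.range (m + 1),
      (m.choose k : ℝ) * (C k).re * (D (m - k)).re := by
    have h := congrArg Complex.re hLeib
    rw [Complex.re_sum] at h
    rw [h]
    refine Finset.sum_congr rfl fun k _ ↦ ?_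
    rw [show (m.choose k : ℂ) * iteratedDeriv k liPhi ↑z₀ * iteratedDeriv (m - k) (logDeriv liPhi) ↑z₀ =
      (m.choose k : ℂ) * C k * D (m - k) from rfl, hCre k, hDre (m - k)]
    norm_cast
  -- `c₀ > 0`
  have hc0 : 0 < freitasC z₀ 0 := by
    rw [hc 0]; simp only [Nat.factorial_zero, Nat.cast_one, div_one]
    exact (Complex.pos_iff.1 hφ0).1
  -- the real identity `(1+m) c_{1+m} = Σ_{k ≤ m} c_k d_{m−k}`
  have KEY : ((1 + m : ℕ) : ℝ) * freitasC z₀ (1 + m) =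
      ∑ k ∈ Finset.range (m + 1), freitasC z₀ k * freitasD z₀ (m - k) := by
    have h1 : ((1 + m : ℕ) : ℝ) * freitasC z₀ (1 + m) = (C (1 + m)).re / m ! := by
      rw [hc, show 1 + m = m + 1 by ring, Nat.factorial_succ]
      push_cast
      field_simp
    rw [h1, hreal, Finset.sum_div]
    refine Finset.sum_congr rfl fun k hk ↦ ?_
    have hk' : k ≤ m := Nat.lt_succ_iff.1 (Finset.mem_range.1 hk)
    rw [hc, hd, Nat.choose_eq_factorial_div_factorial hk',
      Nat.cast_div (Nat.factorial_mul_factorial_dvd_factorial hk') (by positivity)]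
    push_cast
    field_simp
  rw [Finset.range_eq_Ico, Finset.sum_eq_sum_Ico_succ_bot (by omega : 0 < m + 1), Nat.sub_zero] at KEY
  -- conclude
  have hsum : ∑ k ∈ Finset.Ico 1 (1 + m), freitasC z₀ k * freitasD z₀ (1 + m - k - 1) =
      ∑ k ∈ Finset.Ico 1 (m + 1), freitasC z₀ k * freitasD z₀ (m - k) := by
    rw [show 1 + m = m + 1 by ring]
    refine Finset.sum_congr rfl fun k _ ↦ ?_
    rw [show m + 1 - k - 1 = m - k by omega]
  rw [show 1 + m - 1 = m by omega, hsum, KEY]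
  field_simp
  ring

/-! ## Theorem 2 (iii) and (ii): zeros of the `α_n` -/

/-- **Freitas 2006, Theorem 2 (iii)** — DISCHARGED: between two zeros `0 ≤ z₁ < z₂` of `α_n` lies a
zero of `α_{n+1}` — Rolle's theorem for `t ↦ t^{n+1} α_n(t)`, whose derivative is `n tⁿ α_{n+1}(t)`
(Lemma 4.4 / Theorem 4.3). [cite: Freitas2006LiHalfPlanes, Theorem 2 (iii)] -/
theorem Freitas2006_thm_2_iii_holds : Freitas2006_thm_2_iii := by
  intro n hn z₁ z₂ hz₁ hlt _ h1 h2
  obtain ⟨z, hz, hz'⟩ := exists_hasDerivAt_eq_zero (f := fun t : ℝ ↦ t ^ (n + 1) * freitasAlpha t n)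
    (f' := fun t ↦ (n : ℝ) * t ^ n * freitasAlpha t (n + 1)) hlt
    ((continuous_pow (n + 1)).mul (continuous_freitasAlpha n)).continuousOn
    (by simp only [h1, h2, mul_zero]) (fun t _ ↦ hasDerivAt_pow_mul_freitasAlpha t hn)
  refine ⟨z, hz.1, hz.2, ?_⟩
  have hzpos : 0 < z := lt_of_le_of_lt hz₁ hz.1
  have hn0 : (0 : ℝ) < n := by exact_mod_cast hn
  rcases mul_eq_zero.1 hz' with h | h
  · exfalso
    rcases mul_eq_zero.1 h with h' | h'
    · exact hn0.ne' h'
    · exact (pow_pos hzpos n).ne' h'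
  · exact h

/-- If `α_n(a) = 0` for some `a > 0` (`n ≥ 1`) then `α_{n+1}` has a zero in `(0, a)`: otherwise,
being negative at `0` (Thm 2 (i)) and continuous, it would be negative on `[0, a)` and
`∫_0^a tⁿ α_{n+1}(t) dt = a^{n+1} α_n(a)/n = 0` (Lemma 4.4) would be negative (proof of Thm 2 (ii),
p0009:L25–42). [cite: Freitas2006LiHalfPlanes, proof of Theorem 2 (ii)] -/
theorem exists_zero_freitasAlpha_succ {n : ℕ} (hn : 1 ≤ n) {a : ℝ} (ha : 0 < a)
    (hα : freitasAlpha a n = 0) : ∃ z : ℝ, 0 < z ∧ z < a ∧ freitasAlpha z (n + 1) = 0 := by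
  by_contra hne
  push Not at hne
  -- `α_{n+1} < 0` on `[0, a)`
  have h0 : freitasAlpha 0 (n + 1) < 0 := (Freitas2006_thm_2_i_holds (n + 1) (by omega)).2
  have hneg : ∀ t, 0 < t → t < a → freitasAlpha t (n + 1) < 0 := by
    intro t ht hta
    by_contra hge
    push Not at hge
    -- IVT on `[0, t]` gives a zero in `(0, t] ⊆ (0, a)`
    have hcont : ContinuousOn (fun s : ℝ ↦ freitasAlpha s (n + 1)) (Set.Icc 0 t) :=
      (continuous_freitasAlpha (n + 1)).continuousOn
    obtain ⟨c, hc, hc0⟩ := intermediate_value_Icc ht.le hcont ⟨h0.le, hge⟩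
    rcases hc.1.eq_or_lt with e | hcpos
    · rw [← e] at hc0; exact h0.ne hc0
    · exact hne c hcpos (lt_of_le_of_lt hc.2 hta) hc0
  -- the integral of `tⁿ α_{n+1}` over `[0,a]` is `0` by Lemma 4.4 …
  have hint := Freitas2006_lemma_4_4_holds n hn 0 a le_rfl ha
  rw [hα, mul_zero, zero_pow (by omega), zero_mul, sub_zero, zero_div] at hint
  -- … and negative since the integrand is negative on `(0,a)`
  have hlt : ∫ t in (0 : ℝ)..a, -(t ^ n * freitasAlpha t (n + 1)) > 0 := by
    refine intervalIntegral.intervalIntegral_pos_of_pos_on ?_ (fun t ht ↦ ?_) ha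
    · exact (((continuous_pow n).mul (continuous_freitasAlpha (n + 1))).neg).intervalIntegrable _ _
    · have := hneg t ht.1 ht.2
      have htn : 0 < t ^ n := pow_pos ht.1 n
      nlinarith
  rw [intervalIntegral.integral_neg, hint, neg_zero] at hlt
  exact lt_irrefl _ hlt

/-- **Freitas 2006, Theorem 2 (ii)** — DISCHARGED: a strictly decreasing sequence `1/2 = a_1 > a_2 > …`
with `α_n(a_n) = 0` and `α_n < 0` on `[0, a_n)`: `a_{n+1}` is the least zero of `α_{n+1}` in
`(0, a_n)` (`exists_zero_freitasAlpha_succ`, compactness), and `a_1 = 1/2` (`α_1 = ξ'/ξ` vanishes at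
`1/2` and is negative on `[0,1/2)`, Thm 2.2). [cite: Freitas2006LiHalfPlanes, Theorem 2 (ii)] -/
theorem Freitas2006_thm_2_ii_holds : Freitas2006_thm_2_ii := by
  -- the property propagated along the recursion
  let P : ℕ → ℝ → Prop := fun n a ↦ 0 < a ∧ freitasAlpha a n = 0 ∧
    ∀ τ : ℝ, 0 ≤ τ → τ < a → freitasAlpha τ n < 0
  -- step: from `P n a` (`n ≥ 1`) to some `a' < a` with `P (n+1) a'`
  have step : ∀ n, 1 ≤ n → ∀ a, P n a → ∃ a', a' < a ∧ P (n + 1) a' := by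
    intro n hn a ⟨ha, hα, _⟩
    obtain ⟨z, hz0, hza, hz⟩ := exists_zero_freitasAlpha_succ hn ha hα
    -- the least zero of `α_{n+1}` in `[0, a]`
    set Z : Set ℝ := {t | t ∈ Set.Icc 0 a ∧ freitasAlpha t (n + 1) = 0} with hZ
    have hZc : IsClosed Z :=
      (isClosed_Icc.inter (isClosed_eq (continuous_freitasAlpha (n + 1)) continuous_const))
    have hZb : BddBelow Z := ⟨0, fun t ht ↦ ht.1.1⟩
    have hzZ : z ∈ Z := ⟨⟨hz0.le, hza.le⟩, hz⟩
    have hZne : Z.Nonempty := ⟨z, hzZ⟩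
    set a' := sInf Z with ha'
    have ha'Z : a' ∈ Z := hZc.csInf_mem hZne hZb
    have ha'le : a' ≤ z := csInf_le hZb hzZ
    have h0 : freitasAlpha 0 (n + 1) < 0 := (Freitas2006_thm_2_i_holds (n + 1) (by omega)).2
    have ha'pos : 0 < a' := by
      rcases ha'Z.1.1.eq_or_lt with e | h
      · exfalso; rw [← e] at ha'Z; exact h0.ne ha'Z.2
      · exact h
    refine ⟨a', lt_of_le_of_lt ha'le hza, ha'pos, ha'Z.2, fun τ hτ0 hτa ↦ ?_⟩
    by_contra hge
    push Not at hge
    obtain ⟨c, hc, hc0⟩ := intermediate_value_Icc hτ0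
      (continuous_freitasAlpha (n + 1)).continuousOn ⟨h0.le, hge⟩
    have hcZ : c ∈ Z := ⟨⟨hc.1, by linarith [hc.2, ha'Z.1.2]⟩, hc0⟩
    have : a' ≤ c := csInf_le hZb hcZ
    linarith [hc.2]
  -- base: `P 1 (1/2)`
  have base : P 1 (1 / 2) := by
    refine ⟨by norm_num, ?_, fun τ _ hτ ↦ ?_⟩
    · -- `α_1(1/2) = ξ'(1/2)/ξ(1/2) = 0`
      simp only [freitasAlpha, Nat.sub_self, pow_zero, one_mul, iteratedDeriv_one, Nat.factorial_zero,
        Nat.cast_one, div_one]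
      have hL := analyticAt_log_riemannXi_ofReal (1 / 2)
      have h0 : riemannXi (((1 / 2 : ℝ)) : ℂ) ∈ Complex.slitPlane :=
        Complex.mem_slitPlane_iff.2 (Or.inl (Complex.pos_iff.1 (riemannXi_ofReal_pos _)).1)
      rw [((differentiable_riemannXi _).hasDerivAt.clog h0).deriv,
        show (((1 / 2 : ℝ)) : ℂ) = 1 / 2 by push_cast; ring, ← iteratedDeriv_one,
        iteratedDeriv_riemannXi_half_odd 0]
      simp
    · -- `α_1(τ) = ξ'(τ)/ξ(τ) < 0` for `τ < 1/2`
      simp only [freitasAlpha, Nat.sub_self, pow_zero, one_mul, iteratedDeriv_one, Nat.factorial_zero,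
        Nat.cast_one, div_one]
      have h0 : riemannXi (τ : ℂ) ∈ Complex.slitPlane :=
        Complex.mem_slitPlane_iff.2 (Or.inl (Complex.pos_iff.1 (riemannXi_ofReal_pos _)).1)
      rw [((differentiable_riemannXi _).hasDerivAt.clog h0).deriv]
      have hd : (deriv riemannXi τ).re < 0 := by
        have := (Freitas2006_thm_2_2_holds τ 0).2.2 hτ
        simpa using this
      have hξ := riemannXi_ofReal_pos τ
      obtain ⟨hre, him⟩ := Complex.pos_iff.1 hξ
      rw [Complex.div_re, ← him]
      simp only [mul_zero, zero_div, add_zero]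
      have hns : 0 < Complex.normSq (riemannXi τ) := Complex.normSq_pos.2 hξ.ne'
      exact div_neg_of_neg_of_pos (mul_neg_of_neg_of_pos hd hre) hns
  -- the sequence (a total step function first)
  have step' : ∀ n (a : ℝ), ∃ a' : ℝ, (1 ≤ n ∧ P n a) → (a' < a ∧ P (n + 1) a') := by
    intro n a
    by_cases h : 1 ≤ n ∧ P n a
    · obtain ⟨a', ha'⟩ := step n h.1 a h.2
      exact ⟨a', fun _ ↦ ha'⟩
    · exact ⟨0, fun h' ↦ absurd h' h⟩
  choose next hnext using step'
  let seq : ℕ → ℝ := fun k ↦ Nat.rec (1 / 2 : ℝ) (fun j x ↦ next (j + 1) x) k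
  have hseq : ∀ k, P (k + 1) (seq k) ∧ seq (k + 1) < seq k := by
    intro k
    induction k with
    | zero => exact ⟨base, (hnext 1 (1 / 2) ⟨le_rfl, base⟩).1⟩
    | succ k ih =>
      have hP : P (k + 1 + 1) (seq (k + 1)) := (hnext (k + 1) (seq k) ⟨by omega, ih.1⟩).2
      exact ⟨hP, (hnext (k + 1 + 1) (seq (k + 1)) ⟨by omega, hP⟩).1⟩
  refine ⟨fun n ↦ seq (n - 1), rfl, fun n hn ↦ ?_, fun n hn ↦ ?_⟩
  · obtain ⟨k, rfl⟩ : ∃ k, n = k + 1 := ⟨n - 1, by omega⟩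
    simp only [Nat.add_sub_cancel]
    exact (hseq k).2
  · obtain ⟨k, rfl⟩ : ∃ k, n = k + 1 := ⟨n - 1, by omega⟩
    simp only [Nat.add_sub_cancel]
    exact ⟨(hseq k).1.2.1, (hseq k).1.2.2⟩

/-! ## Proposition 4.1 (as proved) and Corollary 4.2 -/

/-- From "`ξ(τ/(1−w)) ≠ 0` on the unit disc" to "`ζ ≠ 0` on `Re s > τ/2`" (`w = 1 − τ/s`,
`|s − τ| < |s| ⟺ Re s > τ/2`; a zero of `ζ` with `Re s > 0` is a zero of `ξ`). [folklore] -/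
private theorem riemannZeta_ne_zero_of_ne_zero_on_ball {τ : ℝ} (hτ0 : 0 < τ)
    (hne : ∀ w ∈ ball (0 : ℂ) 1, riemannXi (τ * liMap w) ≠ 0) {s : ℂ} (hs : τ / 2 < s.re) :
    riemannZeta s ≠ 0 := by
  intro hζ
  have hs0 : s ≠ 0 := fun h ↦ by rw [h] at hs; simp at hs; linarith
  have hs1 : s.re < 1 := by
    by_contra h
    exact riemannZeta_ne_zero_of_one_le_re (not_lt.1 h) hζ
  have hξ : riemannXi s = 0 := (riemannXi_eq_zero_iff_holds s).2 ⟨hζ, by linarith, hs1⟩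
  have hw : 1 - τ / s ∈ ball (0 : ℂ) 1 := by
    rw [Metric.mem_ball, dist_zero_right,
      show (1 : ℂ) - τ / s = (s - τ) / s by field_simp, norm_div,
      div_lt_one (norm_pos_iff.2 hs0), ← sq_lt_sq₀ (norm_nonneg _) (norm_nonneg _),
      Complex.sq_norm, Complex.sq_norm, Complex.normSq_apply, Complex.normSq_apply]
    simp only [sub_re, ofReal_re, sub_im, ofReal_im, sub_zero]
    nlinarith
  refine hne _ hw ?_
  have hsub : (τ : ℂ) * liMap (1 - τ / s) = s := by
    have hτ' : (τ : ℂ) ≠ 0 := Complex.ofReal_ne_zero.2 hτ0.ne'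
    simp only [liMap, sub_sub_cancel]
    field_simp
  rw [hsub, hξ]

/-- The Taylor coefficients at `0` of the sum of a scalar power series with positive radius are its
coefficients: `dᵏ[p.sum](0) = k! · cₖ`. [folklore] -/
private theorem iteratedDeriv_ofScalars_sum {c : ℕ → ℂ}
    (hr : 0 < (FormalMultilinearSeries.ofScalars ℂ c).radius) (k : ℕ) :
    iteratedDeriv k (FormalMultilinearSeries.ofScalars ℂ c).sum 0 = k ! * c k := by
  set p := FormalMultilinearSeries.ofScalars ℂ c with hp
  have hps : HasFPowerSeriesOnBall p.sum p 0 p.radius := p.hasFPowerSeriesOnBall hr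
  have h1 : HasFPowerSeriesAt p.sum p 0 := hps.hasFPowerSeriesAt
  have h2 := hps.hasFPowerSeriesAt.analyticAt.hasFPowerSeriesAt
  have heq := (h2.eq_formalMultilinearSeries h1)
  rw [hp, FormalMultilinearSeries.ofScalars_series_eq_iff] at heq
  have hk := congrFun heq k
  have hk0 : (k ! : ℂ) ≠ 0 := by exact_mod_cast Nat.factorial_ne_zero k
  field_simp at hk
  rw [hk, mul_comm]

/-- **The sufficiency half of Proposition 4.1 (as proved)**: for `τ ≥ 1/2`, non-negative `γ_n` with
`Σ γ_n rⁿ < ∞` for every `0 ≤ r < 1/τ`, if `τ^{n+1} α_n(τ) + γ_{n−1} ≥ 0` for all `n ≥ 1` then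
`ζ ≠ 0` on `Re s > τ/2`.  Freitas' proof (p0008:L34–60): Li's lemma for
`h(w) = e^{G(w)} ξ(τ/(1−w))` with `G(w) = Σ_{k≥1} γ_{k−1} τ^{−k} wᵏ/k` (radius `≥ 1`): its Taylor
coefficients are `≥ 0` (Leibniz, Faà di Bruno for `exp ∘ G`) and
`Re dᵏ[log h](0) = k! γ_{k−1}τ^{−k}/k + τ (k−1)! α_k(τ) = (k−1)! τ^{−k} (γ_{k−1} + τ^{k+1} α_k(τ)) ≥ 0`.
[cite: Freitas2006LiHalfPlanes, Proposition 4.1 (proof, arXiv p0008:L34-60)] -/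
theorem riemannZeta_ne_zero_of_freitasAlpha_add_nonneg {τ : ℝ} (hτ : 1 / 2 ≤ τ) (γ : ℕ → ℝ)
    (hγ0 : ∀ n, 0 ≤ γ n) (hγs : ∀ r : ℝ, 0 ≤ r → r < 1 / τ → Summable (fun n : ℕ ↦ γ n * r ^ n))
    (hα : ∀ n : ℕ, 1 ≤ n → 0 ≤ τ ^ (n + 1) * freitasAlpha τ n + γ (n - 1)) {s : ℂ}
    (hs : τ / 2 < s.re) : riemannZeta s ≠ 0 := by
  have hτ0 : (0 : ℝ) < τ := by linarith
  -- the coefficients of `G`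
  set c : ℕ → ℝ := fun k ↦ if k = 0 then 0 else γ (k - 1) * (τ⁻¹) ^ k / k with hc
  have hc0 : ∀ k, 0 ≤ c k := fun k ↦ by
    simp only [hc]; split_ifs
    · exact le_rfl
    · exact div_nonneg (mul_nonneg (hγ0 _) (pow_nonneg (inv_nonneg.2 hτ0.le) _)) (Nat.cast_nonneg _)
  set p := FormalMultilinearSeries.ofScalars ℂ (fun k ↦ (c k : ℂ)) with hp
  -- radius `≥ 1`
  have hp_rad : 1 ≤ p.radius := by
    refine ENNReal.le_of_forall_nnreal_lt fun r hr ↦ p.le_radius_of_summable ?_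
    have hr1 : (r : ℝ) < 1 := by exact_mod_cast hr
    have hrτ : (r : ℝ) / τ < 1 / τ := div_lt_div_of_pos_right hr1 hτ0
    have hS := (hγs (r / τ) (by positivity) hrτ).mul_left ((r : ℝ) / τ)
    have htail : Summable (fun n : ℕ ↦ ‖p (n + 1)‖ * (r : ℝ) ^ (n + 1)) := by
      refine Summable.of_nonneg_of_le (fun n ↦ by positivity) (fun n ↦ ?_) hS
      rw [hp, FormalMultilinearSeries.ofScalars_norm, Complex.norm_real, Real.norm_eq_abs,
        abs_of_nonneg (hc0 _)]
      simp only [hc, Nat.add_sub_cancel, Nat.succ_ne_zero, if_false]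
      have hn1 : (1 : ℝ) ≤ (n + 1 : ℕ) := by exact_mod_cast Nat.succ_pos n
      calc γ n * (τ⁻¹) ^ (n + 1) / ((n + 1 : ℕ) : ℝ) * (r : ℝ) ^ (n + 1)
          ≤ γ n * (τ⁻¹) ^ (n + 1) * (r : ℝ) ^ (n + 1) := by
            refine mul_le_mul_of_nonneg_right (div_le_self (by
              exact mul_nonneg (hγ0 _) (pow_nonneg (inv_nonneg.2 hτ0.le) _)) hn1) (by positivity)
        _ = (r : ℝ) / τ * (γ n * ((r : ℝ) / τ) ^ n) := by ring
    exact (summable_nat_add_iff 1).1 htail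
  have hp_pos : 0 < p.radius := lt_of_lt_of_le zero_lt_one hp_rad
  set G : ℂ → ℂ := p.sum with hG
  have hps : HasFPowerSeriesOnBall G p 0 p.radius := p.hasFPowerSeriesOnBall hp_pos
  have hball : ball (0 : ℂ) 1 ⊆ Metric.eball (0 : ℂ) p.radius := by
    rw [← Metric.eball_ofReal]
    exact Metric.eball_subset_eball (by simpa using hp_rad)
  have hGdiff : DifferentiableOn ℂ G (ball 0 1) := hps.differentiableOn.mono hball
  have hGan : AnalyticAt ℂ G 0 := hps.hasFPowerSeriesAt.analyticAt
  have hGk : ∀ k, iteratedDeriv k G 0 = k ! * (c k : ℂ) := fun k ↦ iteratedDeriv_ofScalars_sum hp_pos k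
  have hG0 : G 0 = 0 := by
    have := hGk 0
    simp only [iteratedDeriv_zero, Nat.factorial_zero, Nat.cast_one, one_mul, hc, if_true,
      Complex.ofReal_zero] at this
    exact this
  -- `f` and `h = e^G f`
  set f : ℂ → ℂ := fun w ↦ riemannXi (τ * liMap w) with hf
  have hfan : AnalyticAt ℂ f 0 := by
    refine (differentiable_riemannXi.analyticAt _).comp ?_
    exact analyticAt_const.mul (analyticAt_liMap zero_ne_one)
  have hfd : DifferentiableOn ℂ f (ball 0 1) := by
    intro z hz
    have hz1 : z ≠ 1 := by
      rintro rfl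
      simp at hz
    exact ((differentiable_riemannXi _).comp z
      (((analyticAt_liMap hz1).differentiableAt).const_mul (τ : ℂ))).differentiableWithinAt
  have hf0 : f 0 = riemannXi τ := by simp [hf, liMap_zero]
  set h : ℂ → ℂ := fun w ↦ Complex.exp (G w) * f w with hh
  have hd : DifferentiableOn ℂ h (ball 0 1) := (hGdiff.cexp).mul hfd
  have h0 : h 0 ≠ 0 := by
    simp only [hh, hG0, Complex.exp_zero, one_mul, hf0]
    exact (riemannXi_ofReal_pos τ).ne'
  have hexpGan : AnalyticAt ℂ (fun w ↦ Complex.exp (G w)) 0 := hGan.cexp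
  -- Taylor coefficients of `exp ∘ G` at `0` are `≥ 0`
  have hexp_nonneg : ∀ i, 0 ≤ iteratedDeriv i (fun w ↦ Complex.exp (G w)) 0 := by
    intro i
    rw [show (fun w ↦ Complex.exp (G w)) = Complex.exp ∘ G from rfl,
      iteratedDeriv_comp_eq_sum_orderedFinpartition Complex.contDiff_exp.contDiffAt hGan.contDiffAt
        (le_refl (i : WithTop ℕ∞))]
    refine Finset.sum_nonneg fun c' _ ↦ mul_nonneg ?_ (Finset.prod_nonneg fun j _ ↦ ?_)
    · rw [iteratedDeriv_eq_iterate, Complex.iter_deriv_exp, hG0, Complex.exp_zero]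
      exact zero_le_one
    · rw [hGk, show (↑(c'.partSize j)! : ℂ) * ((c (c'.partSize j) : ℝ) : ℂ) =
        ((((c'.partSize j)! : ℝ) * c (c'.partSize j) : ℝ) : ℂ) by push_cast; ring]
      exact Complex.zero_le_real.2 (mul_nonneg (Nat.cast_nonneg _) (hc0 _))
  -- Taylor coefficients of `h` at `0` are `≥ 0`
  have hpos : ∀ k, 0 ≤ iteratedDeriv k h 0 := by
    intro k
    rw [hh, iteratedDeriv_fun_mul hexpGan.contDiffAt hfan.contDiffAt]
    refine Finset.sum_nonneg fun i _ ↦ mul_nonneg (mul_nonneg ?_ (hexp_nonneg i)) ?_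
    · exact_mod_cast Nat.cast_nonneg _
    · exact iteratedDeriv_riemannXi_comp_liMap_scaled_nonneg hτ _
  -- the logarithmic derivatives: `dᵏ[log h](0) = dᵏ G(0) + dᵏ[log f](0)` for `k ≥ 1`
  have hlogf_an : AnalyticAt ℂ (fun w ↦ Complex.log (f w)) 0 := by
    refine hfan.clog ?_
    rw [hf0]
    exact Complex.mem_slitPlane_iff.2 (Or.inl (Complex.pos_iff.1 (riemannXi_ofReal_pos τ)).1)
  have hderiv_eq : deriv (Complex.log ∘ h) =ᶠ[𝓝 0]
      fun w ↦ deriv G w + deriv (fun w ↦ Complex.log (f w)) w := by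
    have hh0 : h 0 ∈ Complex.slitPlane := by
      simp only [hh, hG0, Complex.exp_zero, one_mul, hf0]
      exact Complex.mem_slitPlane_iff.2 (Or.inl (Complex.pos_iff.1 (riemannXi_ofReal_pos τ)).1)
    have hf0' : f 0 ∈ Complex.slitPlane := by
      rw [hf0]; exact Complex.mem_slitPlane_iff.2 (Or.inl (Complex.pos_iff.1 (riemannXi_ofReal_pos τ)).1)
    have hhan : AnalyticAt ℂ h 0 := hexpGan.mul hfan
    have hev1 : ∀ᶠ w in 𝓝 (0 : ℂ), h w ∈ Complex.slitPlane :=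
      hhan.continuousAt.eventually_mem (Complex.isOpen_slitPlane.mem_nhds hh0)
    have hev2 : ∀ᶠ w in 𝓝 (0 : ℂ), f w ∈ Complex.slitPlane :=
      hfan.continuousAt.eventually_mem (Complex.isOpen_slitPlane.mem_nhds hf0')
    have hev3 : ∀ᶠ w in 𝓝 (0 : ℂ), AnalyticAt ℂ G w := hGan.eventually_analyticAt
    have hev4 : ∀ᶠ w in 𝓝 (0 : ℂ), AnalyticAt ℂ f w := hfan.eventually_analyticAt
    filter_upwards [hev1, hev2, hev3, hev4] with w hw1 hw2 hw3 hw4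
    have hfw : f w ≠ 0 := fun e ↦ by
      rw [e] at hw2; exact Complex.slitPlane_ne_zero hw2 rfl
    have hGd := hw3.differentiableAt.hasDerivAt
    have hfdw := hw4.differentiableAt.hasDerivAt
    have hhd : HasDerivAt h (Complex.exp (G w) * deriv G w * f w + Complex.exp (G w) * deriv f w) w :=
      (hGd.cexp).mul hfdw
    rw [Function.comp_def, (hhd.clog hw1).deriv, (hfdw.clog hw2).deriv]
    simp only [hh]
    field_simp
  have hlam : ∀ k, 1 ≤ k → 0 ≤ (iteratedDeriv k (Complex.log ∘ h) 0).re := by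
    intro k hk
    obtain ⟨j, rfl⟩ := Nat.exists_eq_add_of_le hk
    rw [add_comm, iteratedDeriv_succ', hderiv_eq.iteratedDeriv_eq,
      iteratedDeriv_fun_add hGan.deriv.contDiffAt hlogf_an.deriv.contDiffAt, ← iteratedDeriv_succ',
      ← iteratedDeriv_succ', hGk, Complex.add_re,
      re_iteratedDeriv_log_riemannXi_comp_liMap_scaled hτ0.ne' (by omega : 1 ≤ j + 1),
      show ((j + 1) ! : ℂ) * ((c (j + 1) : ℝ) : ℂ) = ((((j + 1) ! : ℝ) * c (j + 1) : ℝ) : ℂ) by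
        push_cast; ring, Complex.ofReal_re]
    simp only [hc, Nat.succ_ne_zero, if_false, Nat.add_sub_cancel]
    have hαk := hα (j + 1) (by omega)
    simp only [Nat.add_sub_cancel] at hαk
    -- `(j+1)! γ_j τ^{-(j+1)}/(j+1) + τ j! α_{j+1} = j! τ^{-(j+1)} (γ_j + τ^{j+2} α_{j+1})`
    have hfac : ((j + 1) ! : ℝ) = (j + 1 : ℕ) * (j ! : ℝ) := by
      rw [Nat.factorial_succ]; push_cast; ring
    rw [hfac]
    have hkey : ((j + 1 : ℕ) : ℝ) * (j ! : ℝ) * (γ j * τ⁻¹ ^ (j + 1) / ((j + 1 : ℕ) : ℝ)) +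
        τ * (j ! : ℝ) * freitasAlpha τ (j + 1) =
        (j ! : ℝ) * τ⁻¹ ^ (j + 1) * (τ ^ (j + 1 + 1) * freitasAlpha τ (j + 1) + γ j) := by
      have hj : ((j + 1 : ℕ) : ℝ) ≠ 0 := by positivity
      have hτne : τ ≠ 0 := hτ0.ne'
      simp only [inv_pow]
      field_simp
      ring
    rw [hkey]
    exact mul_nonneg (mul_nonneg (Nat.cast_nonneg _) (pow_nonneg (inv_nonneg.2 hτ0.le) _)) hαk
  -- Li's lemma
  have hne := li_lemma_ne_zero hd hpos h0 hlam
  refine riemannZeta_ne_zero_of_ne_zero_on_ball hτ0 (fun w hw e ↦ hne w hw ?_) hs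
  simp only [hh]
  rw [show f w = 0 from e, mul_zero]

/-- **Freitas 2006, Proposition 4.1 (as proved)** — DISCHARGED: with the weight `τ^{n+1}` of
Lemma 3.1 (ii) (see the typing note on `Freitas2006_prop_4_1`), "zero-free on `Re s > τ/2`" iff
`τ^{n+1} α_n(τ) + γ_{n−1} ≥ 0` for all `n ≥ 1`; "only if" by Theorem 1, "if" by
`riemannZeta_ne_zero_of_freitasAlpha_add_nonneg`. [cite: Freitas2006LiHalfPlanes, Proposition 4.1 (as proved; arXiv p0008:L15-60)] -/
theorem Freitas2006_prop_4_1_holds : Freitas2006_prop_4_1 := by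
  intro τ hτ γ hγ0 hγs
  constructor
  · intro hz n hn
    have hα := freitasAlpha_nonneg_of_riemannZeta_ne_zero (by linarith) hz hn
    exact add_nonneg (mul_nonneg (pow_nonneg (by linarith) _) hα) (hγ0 _)
  · intro hα s hs
    exact riemannZeta_ne_zero_of_freitasAlpha_add_nonneg hτ γ hγ0 hγs hα hs

/-- **Freitas 2006, Corollary 4.2** — DISCHARGED: if `Re s > τ₀/2` is not zero-free (`τ₀ ≥ 1/2`)
then `α_n(τ₀) < 0` for infinitely many `n` — otherwise the finitely supported correction
`γ_{n−1} = max(0, −τ₀^{n+1} α_n(τ₀))` in Proposition 4.1 would make the half-plane zero-free.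
[cite: Freitas2006LiHalfPlanes, Corollary 4.2] -/
theorem Freitas2006_cor_4_2_holds : Freitas2006_cor_4_2 := by
  intro τ₀ hτ₀ _ hnz
  -- the set of indices with `α_n(τ₀) < 0` is infinite
  set S : Set ℕ := {n | 1 ≤ n ∧ freitasAlpha τ₀ n < 0} with hS
  have hinf : S.Infinite := by
    intro hfin
    apply hnz
    set γ : ℕ → ℝ := fun n ↦ max 0 (-(τ₀ ^ (n + 2) * freitasAlpha τ₀ (n + 1))) with hγ
    have hγ0 : ∀ n, 0 ≤ γ n := fun n ↦ le_max_left _ _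
    have hsupp : ∀ n, n + 1 ∉ S → γ n = 0 := by
      intro n hn
      simp only [hS, Set.mem_setOf_eq, not_and, not_lt] at hn
      have := hn (by omega)
      simp only [hγ, max_eq_left_iff, neg_nonpos]
      exact mul_nonneg (pow_nonneg (by linarith) _) this
    have hγs : ∀ r : ℝ, 0 ≤ r → r < 1 / τ₀ → Summable (fun n : ℕ ↦ γ n * r ^ n) := by
      intro r _ _
      have hfin' : ((fun n : ℕ ↦ n + 1) ⁻¹' S).Finite :=
        hfin.preimage fun a _ b _ hab ↦ by simpa using hab
      refine summable_of_hasFiniteSupport (hfin'.subset ?_)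
      intro n hn
      simp only [Function.mem_support, ne_eq, mul_eq_zero, not_or] at hn
      by_contra hmem
      exact hn.1 (hsupp n hmem)
    refine (Freitas2006_prop_4_1_holds τ₀ hτ₀ γ hγ0 hγs).2 fun n hn ↦ ?_
    obtain ⟨k, rfl⟩ : ∃ k, n = k + 1 := ⟨n - 1, by omega⟩
    simp only [Nat.add_sub_cancel, hγ]
    have := le_max_right 0 (-(τ₀ ^ (k + 2) * freitasAlpha τ₀ (k + 1)))
    rw [show k + 1 + 1 = k + 2 by ring]
    linarith
  refine ⟨Nat.nth (· ∈ S), Nat.nth_strictMono hinf, fun k ↦ ?_⟩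
  have hk : Nat.nth (· ∈ S) k ∈ S := Nat.nth_mem_of_infinite hinf k
  exact hk

/-! ## Theorem 2.8 as printed is false (second clause) -/

/-- **Freitas 2006, Theorem 2.8 — REFUTED as printed.**  Its second clause ("`c_n(z₀) − c_{n−1}(z₀) < 0`
for `z₀ ∈ [−1,−1/2]`, `n = 2,3,…`") fails at `z₀ = −1`, `n = 2`: by Theorem 2.3 (the paper's own
statement, and its remark "the coefficients `c_n(−1)` are all positive with the exception of `c_1(−1)`
which vanishes", p0005:L106–107) `c_1(−1) = φ'(−1) = 0` while `c_2(−1) = φ''(−1)/2 > 0`, so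
`c_2(−1) − c_1(−1) > 0`.  (Source of the slip: the displayed `θ''` in the printed proof, p0005:L201–205;
for `θ(z) = [1 − (z−z₀)] ξ(1/(1−z))` one has `θ''(z) = ξ''(L)L³(1 + z₀L) + 2z₀ ξ'(L) L³`,
`L = 1/(1−z)`, e.g. `θ'' = 2z₀L³` for `ξ = id`, not `(1+2z₀)L³`.)  The first clause (`z₀ ∈ [0,1)`,
`c_n − c_{n−1} > 0`) is not affected by this counterexample.  RH-FREE; a statement about Taylor
coefficients of `ξ(1/(1−z))`, nothing here bears on RH. [cite: Freitas2006LiHalfPlanes, Theorem 2.8 (refutation of the printed second clause)] -/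
theorem Freitas2006_thm_2_8_false : ¬ Freitas2006_thm_2_8 := by
  intro h
  have h2 := (h 2 le_rfl).2 (-1) le_rfl (by norm_num)
  have hm1 : (((-1 : ℝ)) : ℂ) = -1 := by push_cast; ring
  have hc1 : freitasC (-1) 1 = 0 := by
    rw [freitasC, hm1, iteratedDeriv_one, Freitas2006_thm_2_3_holds.2]
    simp
  have hc2 : 0 < freitasC (-1) 2 := by
    rw [freitasC, hm1, Complex.div_natCast_re]
    exact div_pos (Freitas2006_thm_2_3_holds.1 2 le_rfl) (by norm_num)
  rw [show (2 : ℕ) - 1 = 1 from rfl, hc1, sub_zero] at h2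
  exact lt_irrefl _ (h2.trans hc2)

/-! ## Theorem 2.8 (first clause) and Theorem 2.9

Both follow from the expansion (proof of Thm 2.9, p0006:L28–38) `φ(z) = Σ_m s_m(1) (z/(1−z))ᵐ`,
`s_m(1) = ξ⁽ᵐ⁾(1)/m! > 0`, in the form `(1−z)φ(z) = s₀(1−z) + s₁ z + Σ_{m≥2} s_m zᵐ (1−z)^{1−m}`:
every term has non-negative Taylor coefficients at `0`, and the `m = 2` term contributes `n!·s₂` to
the `n`-th derivative, so `a_n − a_{n−1} ≥ s₂(1) > 0` (`a_n = c_n(0)`), whence `a_n → ∞`; the point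
`z₀ ∈ (0,1)` is reached by Lemma 2.1 (for 2.8) and Corollary 2.7 (for 2.9). -/

/-- Leibniz with an affine factor: `dᵏ/dzᵏ[(A − z) g(z)](c) = (A − c) g⁽ᵏ⁾(c) − k g⁽ᵏ⁻¹⁾(c)` (`k ≥ 1`).
[folklore] -/
private theorem iteratedDeriv_const_sub_mul {g : ℂ → ℂ} {c A : ℂ} {k : ℕ} (hk : 1 ≤ k)
    (hg : ContDiffAt ℂ k g c) :
    iteratedDeriv k (fun z ↦ (A - z) * g z) c =
      (A - c) * iteratedDeriv k g c - k * iteratedDeriv (k - 1) g c := by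
  obtain ⟨j, rfl⟩ := Nat.exists_eq_add_of_le' hk
  have ha : ContDiffAt ℂ (↑(j + 1)) (fun z : ℂ ↦ A - z) c :=
    (contDiff_const.sub contDiff_id).contDiffAt
  have hd1 : deriv (fun z : ℂ ↦ A - z) = fun _ ↦ (-1 : ℂ) := by
    funext z; rw [deriv_const_sub, deriv_id'']
  have h0 : iteratedDeriv 0 (fun z : ℂ ↦ A - z) c = A - c := by simp
  have h1 : iteratedDeriv 1 (fun z : ℂ ↦ A - z) c = -1 := by
    rw [iteratedDeriv_one, hd1]
  have h2 : ∀ i, iteratedDeriv (i + 1 + 1) (fun z : ℂ ↦ A - z) c = 0 := by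
    intro i
    rw [iteratedDeriv_succ', iteratedDeriv_succ', hd1]
    simp
  rw [iteratedDeriv_fun_mul ha hg, Finset.sum_range_succ', Finset.sum_range_succ']
  simp only [h0, h1, h2, mul_zero, zero_mul, Finset.sum_const_zero, zero_add,
    Nat.choose_zero_right, Nat.cast_one, one_mul, Nat.sub_zero, Nat.choose_one_right,
    Nat.add_sub_cancel]
  push_cast
  ring

/-- All Taylor coefficients of `m(z)ᵏ = (1−z)^{−k}` at `0` are non-negative reals. [folklore] -/
private theorem iteratedDeriv_liMap_pow_zero_nonneg (k i : ℕ) :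
    0 ≤ iteratedDeriv i (fun z ↦ liMap z ^ k) 0 := by
  induction k generalizing i with
  | zero =>
    simp only [pow_zero]
    rw [iteratedDeriv_const]
    split_ifs <;> simp
  | succ k ih =>
    have hl : AnalyticAt ℂ liMap 0 := analyticAt_liMap zero_ne_one
    have hfun : (fun z ↦ liMap z ^ (k + 1)) = fun z ↦ liMap z ^ k * liMap z := by
      funext z; rw [pow_succ]
    have hq : ContDiffAt ℂ i (fun z ↦ liMap z ^ k) 0 := hl.contDiffAt.pow k
    rw [hfun, iteratedDeriv_fun_mul hq hl.contDiffAt]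
    refine Finset.sum_nonneg fun j _ ↦ mul_nonneg (mul_nonneg ?_ (ih j)) ?_
    · exact_mod_cast Nat.cast_nonneg _
    · rw [iteratedDeriv_liMap_zero]; exact_mod_cast Nat.cast_nonneg _

/-- All Taylor coefficients of `z^{m+1} m(z)ᵐ` at `0` are non-negative reals. [folklore] -/
private theorem iteratedDeriv_pow_mul_liMap_pow_zero_nonneg (m i : ℕ) :
    0 ≤ iteratedDeriv i (fun z ↦ z ^ (m + 1) * liMap z ^ m) 0 := by
  have hl : AnalyticAt ℂ liMap 0 := analyticAt_liMap zero_ne_one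
  have hp : ContDiffAt ℂ i (fun z : ℂ ↦ z ^ (m + 1)) 0 := contDiffAt_id.pow _
  have hq : ContDiffAt ℂ i (fun z ↦ liMap z ^ m) 0 := hl.contDiffAt.pow m
  rw [iteratedDeriv_fun_mul hp hq]
  refine Finset.sum_nonneg fun j _ ↦ mul_nonneg (mul_nonneg ?_ ?_)
    (iteratedDeriv_liMap_pow_zero_nonneg m _)
  · exact_mod_cast Nat.cast_nonneg _
  · rw [iteratedDeriv_fun_pow_zero]
    split_ifs
    · exact Nat.cast_nonneg _
    · exact (Nat.cast_nonneg _)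

/-- `dⁿ/dzⁿ[z² m(z)](0) = n!` for `n ≥ 2`. [folklore] -/
private theorem iteratedDeriv_sq_mul_liMap_zero {n : ℕ} (hn : 2 ≤ n) :
    iteratedDeriv n (fun z ↦ z ^ 2 * liMap z) 0 = n ! := by
  have hl : AnalyticAt ℂ liMap 0 := analyticAt_liMap zero_ne_one
  have hp : ContDiffAt ℂ n (fun z : ℂ ↦ z ^ 2) 0 := contDiffAt_id.pow _
  rw [iteratedDeriv_fun_mul hp hl.contDiffAt, Finset.sum_eq_single 2]
  · rw [iteratedDeriv_fun_pow_zero, if_pos rfl, iteratedDeriv_liMap_zero,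
      Nat.choose_eq_factorial_div_factorial hn]
    have h := Nat.factorial_mul_factorial_dvd_factorial hn
    rw [Nat.cast_div h (by positivity)]
    push_cast
    field_simp
  · intro i _ hi
    rw [iteratedDeriv_fun_pow_zero, if_neg hi]; simp
  · intro h; exact absurd (Finset.mem_range.2 (by omega)) h

/-- **The expansion of the proof of Thm 2.9** (p0006:L28–38): for `|z| < 1`,
`(1−z) φ(z) = s₀(1−z) + Σ_{m≥1} s_m zᵐ m(z)^{m−1}` with `s_m = ξ⁽ᵐ⁾(1)/m!` (Taylor expansion of the
entire `ξ` about `1` at `1/(1−z)`, `1/(1−z) − 1 = z·m(z)`, `(1−z)·m(z) = 1`).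
[cite: Freitas2006LiHalfPlanes, proof of Theorem 2.9] -/
theorem hasSum_one_sub_mul_liPhi {z : ℂ} (hz : z ≠ 1) :
    HasSum (fun m : ℕ ↦ (iteratedDeriv m riemannXi 1 / m !) *
        (if m = 0 then (1 - z) else z ^ m * liMap z ^ (m - 1)))
      ((1 - z) * liPhi z) := by
  have H := (Complex.hasSum_taylorSeries_of_entire differentiable_riemannXi 1 (liMap z)).mul_left (1 - z)
  have hz' : (1 : ℂ) - z ≠ 0 := sub_ne_zero.2 (Ne.symm hz)
  have hsub : liMap z - 1 = z * liMap z := by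
    simp only [liMap]; field_simp; ring
  have hone : (1 - z) * liMap z = 1 := by simp only [liMap]; field_simp
  have hfun : (fun m : ℕ ↦ (iteratedDeriv m riemannXi 1 / m !) *
      (if m = 0 then (1 - z) else z ^ m * liMap z ^ (m - 1))) =
      fun i : ℕ ↦ (1 - z) * ((i ! : ℂ)⁻¹ • (liMap z - 1) ^ i • iteratedDeriv i riemannXi 1) := by
    funext m
    rw [smul_eq_mul, smul_eq_mul, hsub]
    rcases Nat.eq_zero_or_pos m with rfl | hm
    · simp [mul_comm]
    · rw [if_neg (by omega)]
      obtain ⟨k, rfl⟩ : ∃ k, m = k + 1 := ⟨m - 1, by omega⟩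
      rw [Nat.add_sub_cancel]
      linear_combination
        (-(iteratedDeriv (k + 1) riemannXi 1 / ((k + 1)! : ℂ) * z ^ (k + 1) * liMap z ^ k)) * hone
  rw [hfun]
  exact H

/-- **`a_n − a_{n−1} ≥ s₂(1) = ξ''(1)/2`** for `n ≥ 2` (`a_n = c_n(0)` Li's coefficients): termwise
differentiation of the normally convergent expansion `hasSum_one_sub_mul_liPhi` on `|z| < 1/3` — every
term has non-negative Taylor coefficients at `0` and the term `m = 2`, `s₂ z² m(z)`, contributes
`n! s₂` — combined with `dⁿ[(1−z)φ](0) = φ⁽ⁿ⁾(0) − n φ⁽ⁿ⁻¹⁾(0)`.  In particular Li's `a_n` increase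
(Theorem 2.8 at `z₀ = 0`) and tend to infinity. [cite: Freitas2006LiHalfPlanes, proof of Theorem 2.9] -/
theorem freitasC_zero_sub_ge {n : ℕ} (hn : 2 ≤ n) :
    (iteratedDeriv 2 riemannXi 1).re / 2 ≤ freitasC 0 n - freitasC 0 (n - 1) := by
  -- the coefficients `s_m` (real, `≥ 0`) and the terms
  set sC : ℕ → ℂ := fun m ↦ iteratedDeriv m riemannXi 1 / m ! with hsC
  have hs_nonneg : ∀ m, (0 : ℂ) ≤ sC m := fun m ↦ by
    rw [hsC]
    have h := iteratedDeriv_riemannXi_nonneg_of_half_le (τ := 1) (by norm_num) m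
    rw [Complex.ofReal_one] at h
    exact div_nonneg h (by exact_mod_cast Nat.cast_nonneg _)
  set T : ℕ → ℂ → ℂ := fun m z ↦ sC m * (if m = 0 then (1 - z) else z ^ m * liMap z ^ (m - 1))
    with hT
  -- normal convergence on `|z| < 1/3`
  set U : Set ℂ := ball 0 (1 / 3) with hU
  have hUo : IsOpen U := isOpen_ball
  have h0U : (0 : ℂ) ∈ U := mem_ball_self (by norm_num)
  have hU1 : ∀ w ∈ U, w ≠ 1 := by
    intro w hw e; subst e; simp [hU] at hw; norm_num at hw
  have hsRe : ∀ m, sC m = (((iteratedDeriv m riemannXi 1).re / m ! : ℝ) : ℂ) := by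
    intro m
    rw [hsC]
    apply Complex.ext
    · simp [Complex.div_natCast_re]
    · rw [Complex.div_natCast_im, Complex.ofReal_im, show (1 : ℂ) = ((1 : ℝ) : ℂ) by simp,
        im_iteratedDeriv_riemannXi_ofReal, zero_div]
  have hsum32 : Summable (fun m : ℕ ↦ (iteratedDeriv m riemannXi 1).re / m ! * (1 / 2 : ℝ) ^ m) := by
    have H := (Complex.hasSum_taylorSeries_of_entire differentiable_riemannXi 1 (3 / 2)).mapL Complex.reCLM
    simp only [Complex.reCLM_apply] at H
    refine H.summable.congr fun m ↦ ?_
    rw [smul_eq_mul, smul_eq_mul, ← mul_assoc, show ((m ! : ℂ))⁻¹ * ((3 / 2 : ℂ) - 1) ^ m =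
      ((((1 / 2 : ℝ) ^ m / m !) : ℝ) : ℂ) by push_cast; ring, Complex.re_ofReal_mul]
    ring
  set u : ℕ → ℝ := fun m ↦ 4 / 3 * ((iteratedDeriv m riemannXi 1).re / m ! * (1 / 2 : ℝ) ^ m) with hu
  have hu_sum : Summable u := hsum32.mul_left (4 / 3)
  have hT_le : ∀ m w, w ∈ U → ‖T m w‖ ≤ u m := by
    intro m w hw
    have hw3 : ‖w‖ < 1 / 3 := by simpa [hU] using hw
    have hs_norm : ‖sC m‖ = (iteratedDeriv m riemannXi 1).re / m ! := by
      rw [hsRe, Complex.norm_real, Real.norm_eq_abs, abs_of_nonneg]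
      have := hs_nonneg m
      rw [hsRe] at this
      exact Complex.zero_le_real.1 this
    have hl : ‖liMap w‖ ≤ 3 / 2 := by
      rw [liMap, norm_inv]
      have : 2 / 3 ≤ ‖1 - w‖ := by
        have := norm_sub_norm_le (1 : ℂ) w; rw [norm_one] at this; linarith
      calc ‖1 - w‖⁻¹ ≤ (2 / 3)⁻¹ := inv_anti₀ (by norm_num) this
        _ = 3 / 2 := by norm_num
    rw [hT, norm_mul, hs_norm]
    have hsm : 0 ≤ (iteratedDeriv m riemannXi 1).re / m ! := by rw [← hs_norm]; exact norm_nonneg _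
    show _ ≤ 4 / 3 * ((iteratedDeriv m riemannXi 1).re / m ! * (1 / 2 : ℝ) ^ m)
    rw [show 4 / 3 * ((iteratedDeriv m riemannXi 1).re / m ! * (1 / 2 : ℝ) ^ m) =
      (iteratedDeriv m riemannXi 1).re / m ! * (4 / 3 * (1 / 2 : ℝ) ^ m) by ring]
    refine mul_le_mul_of_nonneg_left ?_ hsm
    split_ifs with hm
    · subst hm
      simp only [pow_zero, mul_one]
      calc ‖1 - w‖ ≤ ‖(1 : ℂ)‖ + ‖w‖ := norm_sub_le _ _
        _ ≤ 4 / 3 := by rw [norm_one]; linarith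
    · obtain ⟨k, rfl⟩ := Nat.exists_eq_succ_of_ne_zero hm
      rw [Nat.succ_sub_one, norm_mul, norm_pow, norm_pow, pow_succ]
      calc ‖w‖ ^ k * ‖w‖ * ‖liMap w‖ ^ k ≤ (1 / 3) ^ k * (1 / 3) * (3 / 2) ^ k := by
            gcongr
        _ = 1 / 3 * ((1 / 3 : ℝ) * (3 / 2)) ^ k := by rw [mul_pow]; ring
        _ = 1 / 3 * (1 / 2) ^ k := by norm_num
        _ ≤ 4 / 3 * (1 / 2 : ℝ) ^ (k + 1) := by
            rw [pow_succ]; nlinarith [pow_pos (by norm_num : (0 : ℝ) < 1 / 2) k]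
  have hT_diff : ∀ m, DifferentiableOn ℂ (T m) U := by
    intro m
    refine DifferentiableOn.const_mul ?_ _
    split_ifs
    · exact (differentiableOn_const _).sub differentiableOn_id
    · intro w hw
      exact ((differentiableAt_id.pow _).mul
        (((analyticAt_liMap (hU1 w hw)).differentiableAt).pow _)).differentiableWithinAt
  -- termwise differentiation at `0`
  have HD := hasSum_iteratedDeriv_of_summable_norm hu_sum hT_diff hUo hT_le n h0U
  have heq : EqOn (fun w ↦ ∑' m, T m w) (fun w ↦ (1 - w) * liPhi w) U := fun w hw ↦
    (hasSum_one_sub_mul_liPhi (hU1 w hw)).tsum_eq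
  rw [heq.iteratedDeriv_of_isOpen hUo n h0U] at HD
  -- the terms' derivatives at `0`
  have hterm : ∀ m, iteratedDeriv n (T m) 0 = sC m * iteratedDeriv n
      (fun z : ℂ ↦ if m = 0 then (1 - z) else z ^ m * liMap z ^ (m - 1)) 0 := by
    intro m; rw [hT]; exact iteratedDeriv_const_mul_field _ _
  have hterm_nonneg : ∀ m, 0 ≤ iteratedDeriv n (T m) 0 := by
    intro m
    rw [hterm]
    refine mul_nonneg (hs_nonneg m) ?_
    rcases Nat.eq_zero_or_pos m with rfl | hm
    · simp only [if_true]
      have : iteratedDeriv n (fun z : ℂ ↦ 1 - z) 0 = 0 := by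
        have h := iteratedDeriv_const_sub_mul (g := fun _ ↦ (1 : ℂ)) (c := 0) (A := 1) (k := n)
          (by omega) contDiffAt_const
        simp only [mul_one] at h
        rw [h, iteratedDeriv_const, iteratedDeriv_const, if_neg (by omega), if_neg (by omega)]
        ring
      rw [this]
    · obtain ⟨k, rfl⟩ : ∃ k, m = k + 1 := ⟨m - 1, by omega⟩
      have hfk : (fun z : ℂ ↦ if k + 1 = 0 then (1 - z) else z ^ (k + 1) * liMap z ^ (k + 1 - 1)) =
          fun z ↦ z ^ (k + 1) * liMap z ^ k := by
        funext z; rw [if_neg (by omega), Nat.add_sub_cancel]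
      rw [hfk]
      exact iteratedDeriv_pow_mul_liMap_pow_zero_nonneg k n
  have hterm2 : iteratedDeriv n (T 2) 0 = sC 2 * n ! := by
    rw [hterm]
    simp only [show (2 : ℕ) ≠ 0 by norm_num, if_false, show 2 - 1 = 1 from rfl, pow_one]
    rw [iteratedDeriv_sq_mul_liMap_zero hn]
  -- `dⁿ[(1−z)φ](0) ≥ s₂ n!`
  have hge : sC 2 * n ! ≤ iteratedDeriv n (fun w ↦ (1 - w) * liPhi w) 0 := by
    rw [← hterm2]
    exact le_hasSum HD 2 fun j _ ↦ hterm_nonneg j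
  -- Leibniz: `dⁿ[(1−z)φ](0) = φ⁽ⁿ⁾(0) − n φ⁽ⁿ⁻¹⁾(0)`
  have hφan : AnalyticAt ℂ liPhi 0 := analyticOnNhd_liPhi 0 (by simp)
  have hL := iteratedDeriv_const_sub_mul (A := 1) (c := 0) (by omega : 1 ≤ n) hφan.contDiffAt
  simp only [sub_zero, one_mul] at hL
  rw [hL] at hge
  -- read off real parts
  have hre := (Complex.nonneg_iff.1 (sub_nonneg.2 hge)).1
  rw [Complex.sub_re, Complex.sub_re] at hre
  have h2re : (sC 2 * n !).re = (iteratedDeriv 2 riemannXi 1).re / 2 * n ! := by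
    rw [hsRe, ← Complex.ofReal_natCast, ← Complex.ofReal_mul, Complex.ofReal_re, Nat.factorial_two]
    push_cast; ring
  have hnre : ((n : ℂ) * iteratedDeriv (n - 1) liPhi 0).re = n * (iteratedDeriv (n - 1) liPhi 0).re := by
    rw [← Complex.ofReal_natCast, Complex.re_ofReal_mul]
  rw [h2re, hnre] at hre
  rw [freitasC, freitasC, Complex.ofReal_zero, Complex.div_natCast_re, Complex.div_natCast_re]
  have hfac : (n ! : ℝ) = n * ((n - 1)! : ℝ) := by
    rw [← Nat.mul_factorial_pred (by omega : n ≠ 0)]; push_cast; ring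
  have hn1 : (0 : ℝ) < ((n - 1)! : ℝ) := by exact_mod_cast Nat.factorial_pos _
  have hnpos : (0 : ℝ) < n := by exact_mod_cast (by omega : 0 < n)
  rw [hfac] at hre ⊢
  have key : (iteratedDeriv n liPhi 0).re / (n * ((n - 1)! : ℝ)) -
      (iteratedDeriv (n - 1) liPhi 0).re / ((n - 1)! : ℝ) =
      ((iteratedDeriv n liPhi 0).re - n * (iteratedDeriv (n - 1) liPhi 0).re) /
        (n * ((n - 1)! : ℝ)) := by
    field_simp
  rw [key, le_div_iff₀ (by positivity)]
  linarith

/-- `ξ''(1) > 0` (Theorem 2.2). [cite: Freitas2006LiHalfPlanes, Theorem 2.2] -/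
private theorem re_iteratedDeriv_two_riemannXi_one_pos : 0 < (iteratedDeriv 2 riemannXi 1).re := by
  have := (Freitas2006_thm_2_2_holds 1 1).1
  simpa using this

/-- **Freitas 2006, Theorem 2.9** — DISCHARGED: `c_n(z₀) → ∞` for `z₀ ∈ [0,1)`: `c_n(0) ≥ c_1(0) + (n−1)s₂(1)`
(`freitasC_zero_sub_ge`) and `c_n(z₀) ≥ c_n(0)` (Corollary 2.7). [cite: Freitas2006LiHalfPlanes, Theorem 2.9] -/
theorem Freitas2006_thm_2_9_holds : Freitas2006_thm_2_9 := by
  intro z₀ hz0 hz1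
  set s₂ : ℝ := (iteratedDeriv 2 riemannXi 1).re / 2 with hs₂
  have hs₂pos : 0 < s₂ := by rw [hs₂]; exact div_pos re_iteratedDeriv_two_riemannXi_one_pos two_pos
  -- `c_n(0) ≥ c_1(0) + (n − 1) s₂` for `n ≥ 1`
  have hlow : ∀ n : ℕ, 1 ≤ n → freitasC 0 1 + (n - 1 : ℕ) * s₂ ≤ freitasC 0 n := by
    intro n hn
    induction n with
    | zero => exact absurd hn (by omega)
    | succ k ih =>
      rcases Nat.eq_zero_or_pos k with rfl | hk
      · simp
      · have h1 := ih hk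
        have h2 := freitasC_zero_sub_ge (n := k + 1) (by omega)
        rw [Nat.add_sub_cancel] at h2
        rw [show k + 1 - 1 = (k - 1) + 1 by omega]
        push_cast
        rw [show ((k - 1 : ℕ) : ℝ) = (k : ℝ) - 1 by rw [Nat.cast_sub (by omega)]; simp] at h1 ⊢
        linarith
  have h0 : Tendsto (fun n : ℕ ↦ freitasC 0 n) atTop atTop := by
    have hlin : Tendsto (fun n : ℕ ↦ freitasC 0 1 + ((n - 1 : ℕ) : ℝ) * s₂) atTop atTop := by
      refine tendsto_atTop_add_const_left _ _ ?_
      refine Tendsto.atTop_mul_const hs₂pos ?_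
      have : Tendsto (fun n : ℕ ↦ ((n - 1 : ℕ) : ℝ)) atTop atTop :=
        tendsto_natCast_atTop_atTop.comp (tendsto_sub_atTop_nat 1)
      exact this
    refine tendsto_atTop_mono' atTop ?_ hlin
    filter_upwards [eventually_ge_atTop 1] with n hn
    exact hlow n hn
  rcases hz0.eq_or_lt with e | hpos
  · rw [← e]; exact h0
  · refine tendsto_atTop_mono (fun n ↦ ?_) h0
    exact (Freitas2006_cor_2_7_holds n (by simp : (0 : ℝ) ∈ Set.Ioo (-1) 1)
      ⟨by linarith, hz1⟩ hpos).le

/-- **Freitas 2006, Theorem 2.8, first clause** — PROVED: `c_n(z₀) − c_{n−1}(z₀) > 0` for `n ≥ 2` and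
`z₀ ∈ [0,1)`.  At `z₀ = 0` this is `freitasC_zero_sub_ge`; for `z₀ ∈ (0,1)` apply Lemma 2.1 to
`θ̃(z) = (1 + z₀ − z)φ(z) − t₁ z` (Freitas' `θ` of the proof of Thm 2.8, p0005:L194–196, with its
linear term removed), whose Taylor coefficients at `0` are `(1+z₀)a_0`, `0`, and
`k![(1+z₀)a_k − a_{k−1}] ≥ k!(a_k − a_{k−1}) > 0` (`k ≥ 2`), and whose `n`-th coefficient at `z₀` is
`c_n(z₀) − c_{n−1}(z₀)`. [cite: Freitas2006LiHalfPlanes, Theorem 2.8 (first clause)] -/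
theorem freitasC_sub_pos {n : ℕ} (hn : 2 ≤ n) {z₀ : ℝ} (hz0 : 0 ≤ z₀) (hz1 : z₀ < 1) :
    0 < freitasC z₀ n - freitasC z₀ (n - 1) := by
  have hs₂ : 0 < (iteratedDeriv 2 riemannXi 1).re / 2 :=
    div_pos re_iteratedDeriv_two_riemannXi_one_pos two_pos
  rcases hz0.eq_or_lt with e | hpos
  · rw [← e]; exact lt_of_lt_of_le hs₂ (freitasC_zero_sub_ge hn)
  -- `z₀ ∈ (0,1)`: Lemma 2.1 for `θ̃`
  have hz1' : (z₀ : ℂ) ≠ 1 := fun e ↦ by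
    have := congrArg Complex.re e; simp at this; linarith
  set t₁ : ℂ := deriv (fun z : ℂ ↦ (1 + z₀ - z) * liPhi z) 0 with ht₁
  set θ : ℂ → ℂ := fun z ↦ (1 + (z₀ : ℂ) - z) * liPhi z - t₁ * z with hθ
  have hφan : ∀ {w : ℂ}, w ≠ 1 → AnalyticAt ℂ liPhi w := fun hw ↦ analyticOnNhd_liPhi _ hw
  have hθd : DifferentiableOn ℂ θ (ball (((0 : ℝ)) : ℂ) 1) := by
    intro w hw
    have hw1 : w ≠ 1 := by
      rintro rfl; simp at hw
    exact ((((differentiableAt_const _).sub differentiableAt_id).mul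
      (hφan hw1).differentiableAt).sub ((differentiableAt_const _).mul differentiableAt_id)).differentiableWithinAt
  -- Taylor coefficients of `θ` at a point `c ≠ 1`, `k ≥ 2`
  have hθk : ∀ {c : ℂ}, c ≠ 1 → ∀ k, 2 ≤ k → iteratedDeriv k θ c =
      (1 + z₀ - c) * iteratedDeriv k liPhi c - k * iteratedDeriv (k - 1) liPhi c := by
    intro c hc k hk
    have h1 : ContDiffAt ℂ k (fun z : ℂ ↦ (1 + (z₀ : ℂ) - z) * liPhi z) c :=
      ((contDiff_const.sub contDiff_id).contDiffAt).mul (hφan hc).contDiffAt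
    have h2 : ContDiffAt ℂ k (fun z : ℂ ↦ t₁ * z) c := (contDiff_const.mul contDiff_id).contDiffAt
    rw [hθ, iteratedDeriv_fun_sub h1 h2, iteratedDeriv_const_sub_mul (by omega) (hφan hc).contDiffAt,
      iteratedDeriv_const_mul_field]
    have : iteratedDeriv k (fun z : ℂ ↦ z) c = 0 := by
      rw [iteratedDeriv_fun_id]; simp [show k ≠ 0 by omega, show k ≠ 1 by omega]
    rw [this, mul_zero, sub_zero]
  -- all Taylor coefficients of `θ` at `0` are `≥ 0`, and the `n`-th is `≠ 0`
  have ha_nonneg : ∀ k, (0 : ℂ) ≤ iteratedDeriv k liPhi 0 := by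
    intro k
    have h := iteratedDeriv_liPhi_zero_nonneg xiTaylorCoeff_pos_holds k
    exact h
  have hmono : ∀ k : ℕ, 2 ≤ k → (k : ℂ) * iteratedDeriv (k - 1) liPhi 0 ≤ iteratedDeriv k liPhi 0 := by
    intro k hk
    -- from `a_k − a_{k−1} ≥ s₂ > 0`: `φ⁽ᵏ⁾(0) − k φ⁽ᵏ⁻¹⁾(0) = k! (a_k − a_{k−1}) ≥ 0`
    have h := freitasC_zero_sub_ge hk
    have hpos' : 0 ≤ freitasC 0 k - freitasC 0 (k - 1) := le_trans hs₂.le h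
    rw [freitasC, freitasC, Complex.ofReal_zero, Complex.div_natCast_re, Complex.div_natCast_re] at hpos'
    have hfac : (k ! : ℝ) = k * ((k - 1)! : ℝ) := by
      rw [← Nat.mul_factorial_pred (by omega : k ≠ 0)]; push_cast; ring
    have hk1 : (0 : ℝ) < ((k - 1)! : ℝ) := by exact_mod_cast Nat.factorial_pos _
    have hkpos : (0 : ℝ) < k := by exact_mod_cast (by omega : 0 < k)
    have hre : (k : ℝ) * (iteratedDeriv (k - 1) liPhi 0).re ≤ (iteratedDeriv k liPhi 0).re := by
      rw [hfac, sub_nonneg, div_le_div_iff₀ hk1 (by positivity)] at hpos'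
      -- `hpos' : Q * (k * F) ≤ P * F`
      have : ((k : ℝ) * (iteratedDeriv (k - 1) liPhi 0).re) * ((k - 1)! : ℝ) ≤
          (iteratedDeriv k liPhi 0).re * ((k - 1)! : ℝ) := by linarith
      exact le_of_mul_le_mul_right this hk1
    have him1 := (im_iteratedDeriv_liPhi_ofReal (k - 1) 0).1
    have him2 := (im_iteratedDeriv_liPhi_ofReal k 0).1
    rw [Complex.ofReal_zero] at him1 him2
    refine Complex.le_def.2 ⟨?_, ?_⟩
    · simpa [Complex.mul_re, him1] using hre
    · simp [Complex.mul_im, him1, him2]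
  have hθ_nonneg : ∀ k, (0 : ℂ) ≤ iteratedDeriv k θ (((0 : ℝ)) : ℂ) := by
    intro k
    rw [Complex.ofReal_zero]
    rcases Nat.lt_or_ge k 2 with hk | hk
    · interval_cases k
      · simp only [iteratedDeriv_zero, hθ, sub_zero, mul_zero, liPhi_zero]
        rw [show (1 + (z₀ : ℂ)) * (1 / 2) = (((1 + z₀) / 2 : ℝ) : ℂ) by push_cast; ring]
        exact Complex.zero_le_real.2 (by positivity)
      · -- `θ'(0) = t₁ − t₁ = 0`
        rw [iteratedDeriv_one, hθ]
        have hd1 : DifferentiableAt ℂ (fun z : ℂ ↦ (1 + (z₀ : ℂ) - z) * liPhi z) 0 :=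
          ((differentiableAt_const _).sub differentiableAt_id).mul (hφan (by simp)).differentiableAt
        have hd2 : DifferentiableAt ℂ (fun z : ℂ ↦ t₁ * z) 0 :=
          (differentiableAt_const _).mul differentiableAt_id
        rw [deriv_fun_sub hd1 hd2, ← ht₁, deriv_const_mul _ differentiableAt_fun_id, deriv_id'',
          mul_one, sub_self]
    · rw [hθk (by simp) k hk, sub_zero]
      have h1 : (k : ℂ) * iteratedDeriv (k - 1) liPhi 0 ≤ (1 + z₀) * iteratedDeriv k liPhi 0 := by
        refine (hmono k hk).trans ?_
        have : (1 : ℂ) * iteratedDeriv k liPhi 0 ≤ (1 + z₀) * iteratedDeriv k liPhi 0 := by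
          rw [show (1 + (z₀ : ℂ)) = (((1 + z₀ : ℝ)) : ℂ) by push_cast; ring,
            show (1 : ℂ) = ((1 : ℝ) : ℂ) by simp]
          exact mul_le_mul_of_nonneg_right (Complex.real_le_real.2 (by linarith)) (ha_nonneg k)
        simpa using this
      exact sub_nonneg.2 h1
  have hθn_ne : iteratedDeriv n θ (((0 : ℝ)) : ℂ) ≠ 0 := by
    rw [Complex.ofReal_zero, hθk (by simp) n hn, sub_zero]
    intro e
    -- `(1+z₀)φ⁽ⁿ⁾(0) = n φ⁽ⁿ⁻¹⁾(0)` contradicts `φ⁽ⁿ⁾(0) ≥ n φ⁽ⁿ⁻¹⁾(0) + n! s₂` with `z₀ > 0`, `φ⁽ⁿ⁾(0) > 0`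
    have h := freitasC_zero_sub_ge hn
    have hlt : 0 < freitasC 0 n - freitasC 0 (n - 1) := lt_of_lt_of_le hs₂ h
    rw [freitasC, freitasC, Complex.ofReal_zero, Complex.div_natCast_re, Complex.div_natCast_re] at hlt
    have hfac : (n ! : ℝ) = n * ((n - 1)! : ℝ) := by
      rw [← Nat.mul_factorial_pred (by omega : n ≠ 0)]; push_cast; ring
    have hn1 : (0 : ℝ) < ((n - 1)! : ℝ) := by exact_mod_cast Nat.factorial_pos _
    have hnpos : (0 : ℝ) < n := by exact_mod_cast (by omega : 0 < n)
    have hre := congrArg Complex.re (sub_eq_zero.1 e)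
    rw [show (1 + (z₀ : ℂ)) = (((1 + z₀ : ℝ)) : ℂ) by push_cast; ring, Complex.re_ofReal_mul,
      ← Complex.ofReal_natCast, Complex.re_ofReal_mul] at hre
    have hak : 0 ≤ (iteratedDeriv n liPhi 0).re := (Complex.nonneg_iff.1 (ha_nonneg n)).1
    rw [hfac, sub_pos, div_lt_div_iff₀ hn1 (by positivity)] at hlt
    -- `hlt : Q * (n * F) < P * F`, hence `n Q < P`
    have hlt' : (n : ℝ) * (iteratedDeriv (n - 1) liPhi 0).re < (iteratedDeriv n liPhi 0).re := by
      have : ((n : ℝ) * (iteratedDeriv (n - 1) liPhi 0).re) * ((n - 1)! : ℝ) <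
          (iteratedDeriv n liPhi 0).re * ((n - 1)! : ℝ) := by linarith
      exact lt_of_mul_lt_mul_right this hn1.le
    nlinarith [mul_nonneg hpos.le hak]
  -- Lemma 2.1
  obtain ⟨-, hstrict⟩ := Freitas2006_lemma_2_1_holds θ 0 z₀ 1 hpos (by linarith) hθd hθ_nonneg
  have hpos_n := hstrict n hθn_ne n le_rfl
  rw [hθk hz1' n hn] at hpos_n
  -- read off: `Re[(1+z₀−z₀)φ⁽ⁿ⁾(z₀) − n φ⁽ⁿ⁻¹⁾(z₀)] > 0`
  have hre := (Complex.pos_iff.1 hpos_n).1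
  rw [show (1 + (z₀ : ℂ) - z₀) = 1 by ring, one_mul, Complex.sub_re, ← Complex.ofReal_natCast,
    Complex.re_ofReal_mul] at hre
  rw [freitasC, freitasC, Complex.div_natCast_re, Complex.div_natCast_re]
  have hfac : (n ! : ℝ) = n * ((n - 1)! : ℝ) := by
    rw [← Nat.mul_factorial_pred (by omega : n ≠ 0)]; push_cast; ring
  have hn1 : (0 : ℝ) < ((n - 1)! : ℝ) := by exact_mod_cast Nat.factorial_pos _
  have hnpos : (0 : ℝ) < n := by exact_mod_cast (by omega : 0 < n)
  rw [hfac]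
  have key : (iteratedDeriv n liPhi z₀).re / (n * ((n - 1)! : ℝ)) -
      (iteratedDeriv (n - 1) liPhi z₀).re / ((n - 1)! : ℝ) =
      ((iteratedDeriv n liPhi z₀).re - n * (iteratedDeriv (n - 1) liPhi z₀).re) /
        (n * ((n - 1)! : ℝ)) := by
    field_simp
  rw [key]
  exact div_pos (by linarith) (by positivity)

/-- **Freitas 2006, Theorem 2.8 (first clause = the corrected statement)** — DISCHARGED.
[cite: Freitas2006LiHalfPlanes, Theorem 2.8 (first clause)] -/
theorem Freitas2006_thm_2_8_pos_holds : Freitas2006_thm_2_8_pos :=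
  fun _ hn _ hz0 hz1 ↦ freitasC_sub_pos hn hz0 hz1

/-! ## The Taylor coefficients `ℓ_k` of `ℓ = ξ'/ξ` at `0` (proof of Corollary 5.3) -/

/-- `(ξ'/ξ)⁽ᵏ⁾(1)/k! = (k+1) a_{k+1}`, `a_k` the Taylor coefficients of `log ξ` at `1`
(`Xiao2020.logXiTaylorCoeff`). [folklore] -/
private theorem iteratedDeriv_logDeriv_riemannXi_one_div (k : ℕ) :
    iteratedDeriv k (logDeriv riemannXi) 1 / (k ! : ℂ) =
      ((k : ℂ) + 1) * Xiao2020.logXiTaylorCoeff (k + 1) := by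
  rw [← iteratedDeriv_succ_log_riemannXi_one, Xiao2020.logXiTaylorCoeff, Nat.factorial_succ]
  have hk : (k ! : ℂ) ≠ 0 := by exact_mod_cast Nat.factorial_ne_zero k
  push_cast
  field_simp

/-- **Freitas 2006, the coefficients `ℓ_k` (proof of Corollary 5.3)** — DISCHARGED:
`ℓ₀ = log(2√π) − 1 − γ/2` and `ℓ_k = −1 + (1−2^{−k−1})ζ(k+1) + (−1)ᵏ η_k` (`k ≥ 1`).  Via the
functional equation (`ℓ_k(0) = (−1)^{k+1} ℓ_k(1)`, tree `iteratedDeriv_logDeriv_riemannXi_zero`),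
the tree's `(k+1)a_{k+1} = q_k +
(−1)ᵏ(1 − (1−2^{−k−1})ζ(k+1))` (`Xiao2020.logXiTaylorCoeff_succ`), `η_k = −Re q_k`
(`liEta_eq_neg_re_zetaOneLogDerivCoeff`), and at `k = 0` the arithmetic formula for `λ₁ = Re a₁`
(`Coffey2005_thm1_holds`). [cite: Freitas2006LiHalfPlanes, proof of Corollary 5.3 (arXiv p0010:L175)] -/
theorem Freitas2006_ell_coeff_holds : Freitas2006_ell_coeff := by
  constructor
  · -- `k = 0`
    rw [freitasEllCoeff, Complex.ofReal_zero, iteratedDeriv_logDeriv_riemannXi_zero,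
      pow_zero, neg_one_mul, neg_div, Complex.neg_re, iteratedDeriv_logDeriv_riemannXi_one_div,
      Nat.cast_zero, zero_add, one_mul]
    -- `Re a₁ = λ₁ = liTrend 1 + liOscPart 1`
    have h1 := Xiao2020.keiperLiCoeff_eq_sum_logXiTaylorCoeff (n := 1) le_rfl
    simp only [Finset.range_one, Finset.sum_singleton, zero_add, Nat.choose_self, mul_one,
      Nat.cast_one, one_mul] at h1
    rw [← h1, Coffey2005_thm1_holds.2 1 le_rfl, liTrend_eq, liArchPart_eq,
      liArchSum_of_le_one le_rfl, liOscPart_eq, Finset.Icc_self, Finset.sum_singleton,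
      Nat.choose_self, Nat.sub_self, liEta_zero,
      Real.log_mul two_ne_zero (Real.sqrt_ne_zero'.2 Real.pi_pos), Real.log_sqrt Real.pi_pos.le]
    push_cast
    ring
  · intro k hk
    rw [freitasEllCoeff, Complex.ofReal_zero, iteratedDeriv_logDeriv_riemannXi_zero,
      show -(-1 : ℂ) ^ k = (-1) ^ (k + 1) by ring, mul_div_assoc,
      iteratedDeriv_logDeriv_riemannXi_one_div, Xiao2020.logXiTaylorCoeff_succ hk,
      mul_add, Complex.add_re]
    have hq : ((-1 : ℂ) ^ (k + 1) * Xiao2020.zetaOneLogDerivCoeff k).re = (-1) ^ k * liEta k := by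
      rw [liEta_eq_neg_re_zetaOneLogDerivCoeff, show ((-1 : ℂ) ^ (k + 1)) = (((-1 : ℝ) ^ (k + 1) : ℝ) : ℂ)
        by push_cast; ring, Complex.re_ofReal_mul, pow_succ]
      ring
    have hc : (1 - 1 / (2 : ℂ) ^ (k + 1)) = (((1 - (2 : ℝ)⁻¹ ^ (k + 1) : ℝ)) : ℂ) := by
      push_cast
      rw [one_div, ← inv_pow]
    have hz : ((-1 : ℂ) ^ (k + 1) * ((-1) ^ k * (1 - (1 - 1 / 2 ^ (k + 1)) *
        riemannZeta ((k + 1 : ℕ) : ℂ)))).re =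
        -1 + (1 - (2 : ℝ)⁻¹ ^ (k + 1)) * (riemannZeta (k + 1)).re := by
      rw [← mul_assoc, ← pow_add, show k + 1 + k = 2 * k + 1 by ring, pow_succ, pow_mul,
        neg_one_sq, one_pow, one_mul, neg_one_mul, Complex.neg_re, Complex.sub_re, Complex.one_re,
        hc, Complex.re_ofReal_mul, Nat.cast_succ]
      ring
    rw [hq, hz]
    ring

/-! ## `F(0,τ) = 0`, the monotonicity of `ξ` on `[1/2,∞)` and the sign of `log(2ξ(τ))/τ` -/

/-- `F(0, τ) = 0` identically (p0010:L27–28). [cite: Freitas2006LiHalfPlanes, §5 (arXiv p0010:L27)] -/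
theorem freitasF_zero_left (τ : ℝ) : freitasF 0 τ = 0 := by
  unfold freitasF
  split_ifs
  · simp
  · simp

/-- `ξ` is strictly increasing on `[1/2, ∞)` (real axis), since `ξ' > 0` on `(1/2, ∞)` (Theorem 2.2).
[cite: Freitas2006LiHalfPlanes, Theorem 2.2] -/
theorem strictMonoOn_re_riemannXi :
    StrictMonoOn (fun t : ℝ ↦ (riemannXi t).re) (Set.Ici (1 / 2)) := by
  have hderiv : ∀ t : ℝ, HasDerivAt (fun t : ℝ ↦ (riemannXi t).re) ((deriv riemannXi t).re) t :=
    fun t ↦ ((differentiable_riemannXi (t : ℂ)).hasDerivAt).real_of_complex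
  refine strictMonoOn_of_deriv_pos (convex_Ici _)
    (fun t _ ↦ (hderiv t).continuousAt.continuousWithinAt) fun t ht ↦ ?_
  rw [interior_Ici, Set.mem_Ioi] at ht
  rw [(hderiv t).deriv, ← iteratedDeriv_one]
  exact (Freitas2006_thm_2_2_holds t 0).2.1 ht

/-- `ξ(τ) < 1/2 = ξ(1)` exactly for `0 < τ < 1` (real axis; `ξ` is symmetric about `1/2` and
increasing on `[1/2,∞)`). [cite: Freitas2006LiHalfPlanes, §5 (arXiv p0010:L33)] -/
theorem re_riemannXi_lt_half_iff (τ : ℝ) :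
    (riemannXi τ).re < 1 / 2 ↔ 0 < τ ∧ τ < 1 := by
  have hone : (riemannXi ((1 : ℝ) : ℂ)).re = 1 / 2 := by
    rw [Complex.ofReal_one, riemannXi_one]; norm_num
  have hsymm : ∀ t : ℝ, (riemannXi t).re = (riemannXi ((1 - t : ℝ) : ℂ)).re := by
    intro t; rw [Complex.ofReal_sub, Complex.ofReal_one, riemannXi_one_sub]
  -- reduce to `t ≥ 1/2` by symmetry
  have key : ∀ t : ℝ, 1 / 2 ≤ t → ((riemannXi t).re < 1 / 2 ↔ t < 1) := by
    intro t ht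
    rw [← hone]
    exact strictMonoOn_re_riemannXi.lt_iff_lt ht (by norm_num : (1 / 2 : ℝ) ≤ 1)
  rcases le_or_gt (1 / 2) τ with h | h
  · rw [key τ h]
    constructor
    · intro h1; exact ⟨by linarith, h1⟩
    · exact fun h1 ↦ h1.2
  · rw [hsymm τ, key (1 - τ) (by linarith)]
    constructor
    · intro h1; exact ⟨by linarith, by linarith⟩
    · intro h1; linarith [h1.1]

/-- The sign of `∂F/∂x(0,τ) = log(2ξ(τ))/τ` claimed on p0010:L33–36 ("negative for `τ` smaller than
one and positive for `τ` larger than one"; `2·` = Freitas' normalisation `ξ(0) = 1`), for `τ ≠ 0`.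
[cite: Freitas2006LiHalfPlanes, §5 (arXiv p0010:L33)] -/
theorem log_two_mul_re_riemannXi_div_neg {τ : ℝ} (hτ0 : τ ≠ 0) (hτ1 : τ < 1) :
    Real.log (2 * (riemannXi τ).re) / τ < 0 := by
  have hpos : 0 < (riemannXi τ).re := (Complex.pos_iff.1 (riemannXi_ofReal_pos τ)).1
  rcases lt_or_gt_of_ne hτ0 with hneg | hp
  · -- `τ < 0`: `ξ(τ) > 1/2`
    have h : ¬ (riemannXi τ).re < 1 / 2 := fun h ↦ by
      have := ((re_riemannXi_lt_half_iff τ).1 h).1; linarith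
    refine div_neg_of_pos_of_neg (Real.log_pos ?_) hneg
    have h' : 1 / 2 < (riemannXi τ).re := by
      rcases (not_lt.1 h).eq_or_lt with e | e
      · exfalso
        have h1 : (riemannXi ((1 : ℝ) : ℂ)).re = 1 / 2 := by
          rw [Complex.ofReal_one, riemannXi_one]; norm_num
        have h2 : (riemannXi τ).re = (riemannXi ((1 - τ : ℝ) : ℂ)).re := by
          rw [Complex.ofReal_sub, Complex.ofReal_one, riemannXi_one_sub]
        have h3 := strictMonoOn_re_riemannXi (by norm_num : (1 / 2 : ℝ) ≤ 1)
          (show (1 / 2 : ℝ) ≤ 1 - τ by linarith) (by linarith : (1 : ℝ) < 1 - τ)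
        simp only at h3
        rw [h1, ← h2] at h3
        linarith
      · exact e
    linarith
  · refine div_neg_of_neg_of_pos (Real.log_neg (by linarith) ?_) hp
    have := (re_riemannXi_lt_half_iff τ).2 ⟨hp, hτ1⟩
    linarith

/-- … and positive for `τ > 1`. [cite: Freitas2006LiHalfPlanes, §5 (arXiv p0010:L33)] -/
theorem log_two_mul_re_riemannXi_div_pos {τ : ℝ} (hτ1 : 1 < τ) :
    0 < Real.log (2 * (riemannXi τ).re) / τ := by
  refine div_pos (Real.log_pos ?_) (by linarith)
  have h1 : (riemannXi ((1 : ℝ) : ℂ)).re = 1 / 2 := by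
    rw [Complex.ofReal_one, riemannXi_one]; norm_num
  have h3 := strictMonoOn_re_riemannXi (by norm_num : (1 / 2 : ℝ) ≤ 1)
    (show (1 / 2 : ℝ) ≤ τ by linarith) hτ1
  simp only at h3
  rw [h1] at h3
  linarith

/-! ## `∂F/∂x(0,τ) = log(2ξ(τ))/τ` and the discharge of `Freitas2006_F_at_zero`

Freitas (p0010:L27–36): "differentiating with respect to `x` and letting `x → 0`, `F_x(0,τ) =
−(1/τ) Σ_ρ log(ρ/(ρ−τ)) = (1/τ) log Π_ρ (ρ−τ)/ρ = (1/τ) log ξ(τ)`" (his `ξ = 2·` the tree's).  We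
differentiate the zero sum termwise (`hasDerivAt_tsum_of_isPreconnected`): with
`L_ρ = log(ρ/(ρ−τ)) = a_ρ + i b_ρ`, `|∂ₓ Re(ρ/(ρ−τ))ˣ| = e^{x a_ρ}|a_ρ cos(x b_ρ) − b_ρ sin(x b_ρ)|
≤ e^{|a_ρ|}(|a_ρ| + b_ρ²)` for `|x| < 1`, and `a_ρ = −log|1 − τ/ρ| = O(|ρ|⁻²)`, `b_ρ² = O(|ρ|⁻²)`
(note that `|L_ρ| ≍ |ρ|⁻¹` alone is NOT summable); the value `Σ_ρ m(ρ) log|1 − τ/ρ| = log(2ξ(τ))`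
is the logarithm of the (paired) Hadamard product (`IsHadamardSeq.hasSum_log_norm_factors_sub`),
transferred to the sum over the zeros with multiplicity as in Lemma 3.1 (i). -/

section FAtZero

open ZetaZeros

/-- A non-trivial zero is not a real number `τ` (`ξ(τ) > 0`). [folklore] -/
private theorem zero_ne_ofReal (ρ : ZetaZeros.riemannZetaNontrivialZeros) (τ : ℝ) :
    (ρ : ℂ) ≠ (τ : ℂ) := by
  intro e
  have hξ : riemannXi (ρ : ℂ) = 0 := (riemannXi_eq_zero_iff_holds _).2
    ⟨riemannZetaNontrivialZeros.zeta_eq_zero ρ.2, riemannZetaNontrivialZeros.re_pos ρ.2,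
      riemannZetaNontrivialZeros.re_lt_one ρ.2⟩
  rw [e] at hξ
  exact (riemannXi_ofReal_pos τ).ne' hξ

/-- A non-trivial zero is not `0`. [folklore] -/
private theorem zero_ne_zero' (ρ : ZetaZeros.riemannZetaNontrivialZeros) : (ρ : ℂ) ≠ 0 := by
  intro e
  have := riemannZetaNontrivialZeros.re_pos ρ.2
  rw [e] at this; simp at this

/-- `ρ/(ρ−τ) ≠ 0`. [folklore] -/
private theorem freitasU_ne_zero (ρ : ZetaZeros.riemannZetaNontrivialZeros) (τ : ℝ) :
    (ρ : ℂ) / ((ρ : ℂ) - τ) ≠ 0 :=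
  div_ne_zero (zero_ne_zero' ρ) (sub_ne_zero.2 (zero_ne_ofReal ρ τ))

/-- `Re log(ρ/(ρ−τ)) = −log|1 − τ/ρ|`. [folklore] -/
private theorem re_log_freitasU (ρ : ZetaZeros.riemannZetaNontrivialZeros) (τ : ℝ) :
    (Complex.log ((ρ : ℂ) / ((ρ : ℂ) - τ))).re = -Real.log ‖1 - (τ : ℂ) / (ρ : ℂ)‖ := by
  have hρ := zero_ne_zero' ρ
  have hρτ : (ρ : ℂ) - τ ≠ 0 := sub_ne_zero.2 (zero_ne_ofReal ρ τ)
  rw [Complex.log_re, show (ρ : ℂ) / ((ρ : ℂ) - τ) = (1 - (τ : ℂ) / (ρ : ℂ))⁻¹ by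
    field_simp, norm_inv, Real.log_inv]

/-- **Bounds for the far zeros**: if `8(|τ|+1) ≤ |ρ|` then, with `L = log(ρ/(ρ−τ))`,
`‖L‖ ≤ 1`, `|Re L| ≤ (|τ| + τ²)/|ρ|²` and `‖L‖² ≤ 3τ²/|ρ|²`. [folklore] -/
private theorem log_freitasU_bounds (ρ : ZetaZeros.riemannZetaNontrivialZeros) (τ : ℝ)
    (hfar : 8 * (|τ| + 1) ≤ ‖(ρ : ℂ)‖) :
    ‖Complex.log ((ρ : ℂ) / ((ρ : ℂ) - τ))‖ ≤ 1 ∧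
      |(Complex.log ((ρ : ℂ) / ((ρ : ℂ) - τ))).re| ≤ (|τ| + τ ^ 2) / ‖(ρ : ℂ)‖ ^ 2 ∧
      ‖Complex.log ((ρ : ℂ) / ((ρ : ℂ) - τ))‖ ^ 2 ≤ 3 * τ ^ 2 / ‖(ρ : ℂ)‖ ^ 2 := by
  have hρ := zero_ne_zero' ρ
  have hρn : 0 < ‖(ρ : ℂ)‖ := norm_pos_iff.2 hρ
  have hρ8 : 8 ≤ ‖(ρ : ℂ)‖ := le_trans (by nlinarith [abs_nonneg τ]) hfar
  set w : ℂ := (τ : ℂ) / (ρ : ℂ) with hw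
  have hwn : ‖w‖ = |τ| / ‖(ρ : ℂ)‖ := by rw [hw, norm_div, Complex.norm_real, Real.norm_eq_abs]
  have hw8 : ‖w‖ ≤ 1 / 8 := by
    rw [hwn, div_le_iff₀ hρn]
    nlinarith [abs_nonneg τ]
  have hw2 : ‖w‖ ≤ 1 / 2 := by linarith
  have hu : (ρ : ℂ) / ((ρ : ℂ) - τ) = (1 - w)⁻¹ := by
    have hρτ : (ρ : ℂ) - τ ≠ 0 := sub_ne_zero.2 (zero_ne_ofReal ρ τ)
    rw [hw]; field_simp
  have harg : (1 - w).arg ≠ Real.pi := by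
    intro e
    have h1 := (Complex.arg_eq_pi_iff.1 e).1
    have h2 : |w.re| ≤ ‖w‖ := Complex.abs_re_le_norm w
    simp only [sub_re, one_re] at h1
    have := (abs_le.1 (h2.trans hw2)).2
    linarith
  have hL : Complex.log ((ρ : ℂ) / ((ρ : ℂ) - τ)) = -Complex.log (1 + (-w)) := by
    rw [hu, Complex.log_inv _ harg, ← sub_eq_add_neg]
  have hnw : ‖-w‖ = ‖w‖ := norm_neg _
  -- `‖L‖ ≤ (3/2)‖w‖`
  have hn1 : ‖Complex.log ((ρ : ℂ) / ((ρ : ℂ) - τ))‖ ≤ 3 / 2 * ‖w‖ := by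
    rw [hL, norm_neg]
    exact (Complex.norm_log_one_add_half_le_self (by rwa [hnw])).trans (by rw [hnw])
  -- `|Re L| ≤ |Re w| + ‖w‖²`
  have hre : |(Complex.log ((ρ : ℂ) / ((ρ : ℂ) - τ))).re| ≤ |w.re| + ‖w‖ ^ 2 := by
    have h1 : ‖Complex.log (1 + (-w)) - (-w)‖ ≤ ‖w‖ ^ 2 := by
      have h := Complex.norm_log_one_add_sub_self_le (z := -w) (by rw [hnw]; linarith)
      rw [hnw] at h
      refine h.trans ?_
      have : (1 - ‖w‖)⁻¹ ≤ 2 := by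
        rw [inv_le_comm₀ (by linarith) two_pos]; linarith
      nlinarith [norm_nonneg w, sq_nonneg ‖w‖]
    have h2 : |(Complex.log (1 + (-w)) - (-w)).re| ≤ ‖w‖ ^ 2 :=
      (Complex.abs_re_le_norm _).trans h1
    rw [hL, Complex.neg_re, abs_neg]
    rw [Complex.sub_re, Complex.neg_re] at h2
    have := abs_sub_abs_le_abs_sub (Complex.log (1 + -w)).re (-w.re)
    rw [abs_neg] at this
    linarith
  -- `|Re w| ≤ |τ|/|ρ|²`, `‖w‖² = τ²/|ρ|²`
  have hwre : |w.re| ≤ |τ| / ‖(ρ : ℂ)‖ ^ 2 := by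
    have h0 := riemannZetaNontrivialZeros.re_pos ρ.2
    have h1 := riemannZetaNontrivialZeros.re_lt_one ρ.2
    have e : w.re = τ * (((ρ : ℂ)).re / ‖(ρ : ℂ)‖ ^ 2) := by
      rw [hw, div_eq_mul_inv, Complex.re_ofReal_mul, Complex.inv_re, Complex.normSq_eq_norm_sq]
    have hρ2 : (0 : ℝ) < ‖(ρ : ℂ)‖ ^ 2 := by positivity
    rw [e, abs_mul, abs_div, abs_of_pos h0, abs_of_pos hρ2, ← mul_div_assoc]
    exact div_le_div_of_nonneg_right (mul_le_of_le_one_right (abs_nonneg τ) h1.le) hρ2.le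
  have hwsq : ‖w‖ ^ 2 = τ ^ 2 / ‖(ρ : ℂ)‖ ^ 2 := by rw [hwn, div_pow, sq_abs]
  refine ⟨hn1.trans (by linarith), hre.trans ?_, ?_⟩
  · rw [hwsq, add_div]
    exact add_le_add hwre le_rfl
  · calc ‖Complex.log ((ρ : ℂ) / ((ρ : ℂ) - τ))‖ ^ 2 ≤ (3 / 2 * ‖w‖) ^ 2 :=
          pow_le_pow_left₀ (norm_nonneg _) hn1 2
      _ = 9 / 4 * (τ ^ 2 / ‖(ρ : ℂ)‖ ^ 2) := by rw [mul_pow, hwsq]; norm_num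
      _ ≤ 3 * τ ^ 2 / ‖(ρ : ℂ)‖ ^ 2 := by
          rw [mul_div_assoc']; exact div_le_div_of_nonneg_right (by nlinarith [sq_nonneg τ]) (by positivity)

/-- Summability over the zeros from a bound `≤ C · m(ρ)/|ρ|²` off a finite set (here: off the zeros
with `|Im ρ| ≤ R`, `R ≥ 1`), via `Σ m(ρ)/(1+γ²) < ∞`. [folklore] -/
private theorem summable_zeros_of_le {fz : ZetaZeros.riemannZetaNontrivialZeros → ℝ} {C R : ℝ}
    (hR : 1 ≤ R) (h0 : ∀ ρ, 0 ≤ fz ρ)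
    (hle : ∀ ρ : ZetaZeros.riemannZetaNontrivialZeros, R ≤ ‖(ρ : ℂ)‖ →
      fz ρ ≤ C * ((riemannZetaZeroOrder (ρ : ℂ) : ℝ) / ‖(ρ : ℂ)‖ ^ 2)) :
    Summable fz := by
  classical
  set S : Finset ZetaZeros.riemannZetaNontrivialZeros := weilZeroFinset R with hS
  set ψ : ZetaZeros.riemannZetaNontrivialZeros → ℝ := fun ρ ↦ if ρ ∈ S then fz ρ else 0 with hψ
  have hψs : Summable ψ := by
    refine summable_of_hasFiniteSupport (S.finite_toSet.subset fun ρ hρ ↦ ?_)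
    by_contra h
    rw [Finset.mem_coe] at h
    exact hρ (by simp [hψ, h])
  have hW := ZetaZeroSum.summable_zeroOrder_div_one_add_sq.mul_left (2 * |C|)
  refine Summable.of_nonneg_of_le h0 (fun ρ ↦ ?_) (hψs.add hW)
  by_cases hρ : ρ ∈ S
  · simp only [hψ, hρ, if_true]
    have : 0 ≤ 2 * |C| * ((riemannZetaZeroOrder (ρ : ℂ) : ℝ) / (1 + ((ρ : ℂ)).im ^ 2)) :=
      mul_nonneg (by positivity) (div_nonneg (ZetaZeroSum.zeroOrder_nonneg ρ) (by positivity))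
    linarith
  · simp only [hψ, hρ, if_false, zero_add]
    have hfar : R ≤ ‖(ρ : ℂ)‖ := by
      rw [hS, mem_weilZeroFinset, not_le] at hρ
      exact hρ.le.trans (Complex.abs_im_le_norm _)
    have hm : (0 : ℝ) ≤ riemannZetaZeroOrder (ρ : ℂ) := ZetaZeroSum.zeroOrder_nonneg ρ
    have hρ1 : 1 ≤ ‖(ρ : ℂ)‖ := hR.trans hfar
    have hcmp : (riemannZetaZeroOrder (ρ : ℂ) : ℝ) / ‖(ρ : ℂ)‖ ^ 2 ≤
        2 * ((riemannZetaZeroOrder (ρ : ℂ) : ℝ) / (1 + ((ρ : ℂ)).im ^ 2)) := by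
      rw [div_le_iff₀ (by positivity)]
      have him : ((ρ : ℂ)).im ^ 2 ≤ ‖(ρ : ℂ)‖ ^ 2 := by
        rw [← sq_abs]; exact pow_le_pow_left₀ (abs_nonneg _) (Complex.abs_im_le_norm _) 2
      have : 1 + ((ρ : ℂ)).im ^ 2 ≤ 2 * ‖(ρ : ℂ)‖ ^ 2 := by nlinarith
      calc (riemannZetaZeroOrder (ρ : ℂ) : ℝ)
          = (riemannZetaZeroOrder (ρ : ℂ) : ℝ) / (1 + ((ρ : ℂ)).im ^ 2) * (1 + ((ρ : ℂ)).im ^ 2) := by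
            field_simp
        _ ≤ (riemannZetaZeroOrder (ρ : ℂ) : ℝ) / (1 + ((ρ : ℂ)).im ^ 2) * (2 * ‖(ρ : ℂ)‖ ^ 2) :=
            mul_le_mul_of_nonneg_left this (div_nonneg hm (by positivity))
        _ = 2 * ((riemannZetaZeroOrder (ρ : ℂ) : ℝ) / (1 + ((ρ : ℂ)).im ^ 2)) * ‖(ρ : ℂ)‖ ^ 2 := by
            ring
    calc fz ρ ≤ C * ((riemannZetaZeroOrder (ρ : ℂ) : ℝ) / ‖(ρ : ℂ)‖ ^ 2) := hle ρ hfar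
      _ ≤ |C| * ((riemannZetaZeroOrder (ρ : ℂ) : ℝ) / ‖(ρ : ℂ)‖ ^ 2) :=
          mul_le_mul_of_nonneg_right (le_abs_self C) (div_nonneg hm (by positivity))
      _ ≤ |C| * (2 * ((riemannZetaZeroOrder (ρ : ℂ) : ℝ) / (1 + ((ρ : ℂ)).im ^ 2))) :=
          mul_le_mul_of_nonneg_left hcmp (abs_nonneg C)
      _ = 2 * |C| * ((riemannZetaZeroOrder (ρ : ℂ) : ℝ) / (1 + ((ρ : ℂ)).im ^ 2)) := by ring

/-- **`Σ_ρ m(ρ) |log|1 − τ/ρ|| < ∞`** (the logarithm of the Hadamard product converges absolutely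
once real parts are taken: `log|1 − τ/ρ| = −τ Re(1/ρ) + O(τ²/|ρ|²)` and `Re(1/ρ) = Re ρ/|ρ|²`).
[cite: Freitas2006LiHalfPlanes, §5 (arXiv p0010:L31)] -/
theorem summable_zeroOrder_mul_log_norm (τ : ℝ) :
    Summable (fun ρ : ZetaZeros.riemannZetaNontrivialZeros ↦
      (riemannZetaZeroOrder (ρ : ℂ) : ℝ) * |Real.log ‖1 - (τ : ℂ) / (ρ : ℂ)‖|) := by
  refine summable_zeros_of_le (C := |τ| + τ ^ 2) (R := 8 * (|τ| + 1)) (by nlinarith [abs_nonneg τ])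
    (fun ρ ↦ mul_nonneg (ZetaZeroSum.zeroOrder_nonneg ρ) (abs_nonneg _)) fun ρ hfar ↦ ?_
  obtain ⟨-, hre, -⟩ := log_freitasU_bounds ρ τ hfar
  rw [re_log_freitasU, abs_neg] at hre
  calc (riemannZetaZeroOrder (ρ : ℂ) : ℝ) * |Real.log ‖1 - (τ : ℂ) / (ρ : ℂ)‖|
      ≤ (riemannZetaZeroOrder (ρ : ℂ) : ℝ) * ((|τ| + τ ^ 2) / ‖(ρ : ℂ)‖ ^ 2) :=
        mul_le_mul_of_nonneg_left hre (ZetaZeroSum.zeroOrder_nonneg ρ)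
    _ = (|τ| + τ ^ 2) * ((riemannZetaZeroOrder (ρ : ℂ) : ℝ) / ‖(ρ : ℂ)‖ ^ 2) := by ring

/-- **The logarithm of the Hadamard product over the zeros with multiplicity**: for real `τ`,
`Σ_ρ m(ρ) log|1 − τ/ρ| = log(2ξ(τ))` (tree: `IsHadamardSeq.hasSum_log_norm_factors_sub` for the
pairs `{ρ, 1−ρ}`, `IsHadamardSeq.finsum_liZeroBox_eq_sum` for the multiplicities; the tree's `ξ` is
half of Freitas', whence `2ξ`). [cite: Freitas2006LiHalfPlanes, §5 (arXiv p0010:L31)] -/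
theorem tsum_zeroOrder_mul_log_norm (τ : ℝ) :
    ∑' ρ : ZetaZeros.riemannZetaNontrivialZeros,
      (riemannZetaZeroOrder (ρ : ℂ) : ℝ) * Real.log ‖1 - (τ : ℂ) / (ρ : ℂ)‖ =
      Real.log (2 * (riemannXi τ).re) := by
  classical
  obtain ⟨b, hb⟩ := exists_isHadamardSeq 0
  have hξτ : riemannXi τ ≠ 0 := (riemannXi_ofReal_pos τ).ne'
  have hξ0 : riemannXi 0 ≠ 0 := by rw [riemannXi_zero]; norm_num
  -- the pair sum
  obtain ⟨g, hg⟩ : ∃ g : ℂ → ℝ, g = fun ρ ↦ Real.log ‖1 - (τ : ℂ) / ρ‖ := ⟨_, rfl⟩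
  obtain ⟨G, hG⟩ : ∃ G : ℕ → ℝ, G = fun k ↦ if b k = 0 then 0 else
    g (IsHadamardSeq.xiZero b k) + g (1 - IsHadamardSeq.xiZero b k) := ⟨_, rfl⟩
  have hval : Real.log ‖riemannXi τ‖ - Real.log ‖riemannXi 0‖ = Real.log (2 * (riemannXi τ).re) := by
    have hre : ‖riemannXi τ‖ = (riemannXi τ).re := by
      have hp := riemannXi_ofReal_pos τ
      obtain ⟨h1, h2⟩ := Complex.pos_iff.1 hp
      rw [← Complex.re_add_im (riemannXi τ), ← h2]; simp [abs_of_pos h1]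
    rw [hre, riemannXi_zero, Real.log_mul two_ne_zero (Complex.pos_iff.1 (riemannXi_ofReal_pos τ)).1.ne']
    simp [Real.log_inv]
    ring
  have hpair : HasSum G (Real.log (2 * (riemannXi τ).re)) := by
    have H := hb.hasSum_log_norm_factors_sub hξτ hξ0
    rw [hval] at H
    refine H.congr_fun fun k ↦ ?_
    by_cases hk : b k = 0
    · simp [hG, hk]
    · rw [hG, hg]
      simp only [hk, if_false]
      have hρmem := hb.riemannZeta_xiZero hk
      have hρ0 : IsHadamardSeq.xiZero b k ≠ 0 := fun e ↦ by
        have h := hρmem.2.1; rw [e] at h; simp at h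
      have hρ1 : 1 - IsHadamardSeq.xiZero b k ≠ 0 := fun e ↦ by
        have h := hρmem.2.2; rw [sub_eq_zero] at e; rw [← e] at h; simp at h
      have hA : 1 - b k * (2 * (τ : ℂ) - 1) ^ 2 ≠ 0 := hb.factor_ne_zero' hξτ k
      have hB : 1 - b k * (2 * (0 : ℂ) - 1) ^ 2 ≠ 0 := hb.factor_ne_zero' hξ0 k
      have hP : 1 - (τ : ℂ) / IsHadamardSeq.xiZero b k ≠ 0 := by
        intro e
        have : (τ : ℂ) = IsHadamardSeq.xiZero b k := by
          field_simp at e; linear_combination -e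
        exact hξτ (by rw [this]; exact hb.riemannXi_xiZero hk)
      have hQ : 1 - (τ : ℂ) / (1 - IsHadamardSeq.xiZero b k) ≠ 0 := by
        intro e
        have : (τ : ℂ) = 1 - IsHadamardSeq.xiZero b k := by
          field_simp at e; linear_combination -e
        exact hξτ (by rw [this]; exact hb.riemannXi_one_sub_xiZero hk)
      have hquot : (1 - b k * (2 * (τ : ℂ) - 1) ^ 2) / (1 - b k * (2 * (0 : ℂ) - 1) ^ 2) =
          (1 - (τ : ℂ) / IsHadamardSeq.xiZero b k) * (1 - (τ : ℂ) / (1 - IsHadamardSeq.xiZero b k)) := by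
        have hbk : b k ≠ 0 := hk
        rw [IsHadamardSeq.factor_eq_mul b hk, IsHadamardSeq.factor_eq_mul b hk]
        field_simp
        ring
      rw [← Real.log_div (norm_ne_zero_iff.2 hA) (norm_ne_zero_iff.2 hB), ← norm_div, hquot,
        norm_mul, Real.log_mul (norm_ne_zero_iff.2 hP) (norm_ne_zero_iff.2 hQ)]
  -- pass to the complex-valued version to use the multiplicity bookkeeping
  obtain ⟨F, hF⟩ : ∃ F : ℂ → ℂ, F = fun ρ ↦ (g ρ : ℂ) := ⟨_, rfl⟩
  obtain ⟨GC, hGC⟩ : ∃ GC : ℕ → ℂ, GC = fun k ↦ if b k = 0 then 0 else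
    F (IsHadamardSeq.xiZero b k) + F (1 - IsHadamardSeq.xiZero b k) := ⟨_, rfl⟩
  have hGCsum : HasSum GC ((Real.log (2 * (riemannXi τ).re) : ℝ) : ℂ) := by
    have H2 := (Complex.hasSum_ofReal).2 hpair
    have hfun : (fun k ↦ ((G k : ℝ) : ℂ)) = GC := by
      funext k
      by_cases hk : b k = 0
      · rw [hG, hGC]; simp only [hk, if_true, Complex.ofReal_zero]
      · rw [hG, hGC]; simp only [hk, if_false, Complex.ofReal_add, hF]
    rwa [hfun] at H2
  set K : ℝ → Finset ℕ := fun T ↦ (hb.finite_setOf_abs_im_xiZero_le T).toFinset with hKdef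
  have hK : ∀ T k, k ∈ K T ↔ b k ≠ 0 ∧ |(IsHadamardSeq.xiZero b k).im| ≤ T := fun T k ↦ by
    simp [hKdef, Set.Finite.mem_toFinset]
  have hlim : Tendsto (fun T ↦ ∑ k ∈ K T, GC k) atTop
      (𝓝 ((Real.log (2 * (riemannXi τ).re) : ℝ) : ℂ)) :=
    IsHadamardSeq.tendsto_sum_truncation hGCsum (fun k hk ↦ by simp [hGC, hk]) K hK
  have heq : ∀ T, ∑ᶠ ρ ∈ liZeroBox T, (riemannZetaZeroOrder ρ : ℂ) * F ρ = ∑ k ∈ K T, GC k := by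
    intro T
    rw [hb.finsum_liZeroBox_eq_sum F T (K T) (hK T)]
    refine Finset.sum_congr rfl fun k hk ↦ ?_
    simp [hGC, ((hK T k).1 hk).1]
  have hbox : Tendsto (fun T ↦ (∑ᶠ ρ ∈ liZeroBox T, (riemannZetaZeroOrder ρ : ℂ) * F ρ).re)
      atTop (𝓝 (Real.log (2 * (riemannXi τ).re))) := by
    have h1 : Tendsto (fun T ↦ ∑ᶠ ρ ∈ liZeroBox T, (riemannZetaZeroOrder ρ : ℂ) * F ρ)
        atTop (𝓝 ((Real.log (2 * (riemannXi τ).re) : ℝ) : ℂ)) := by simpa only [heq] using hlim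
    have h2 := (Complex.continuous_re.tendsto _).comp h1
    rw [Complex.ofReal_re] at h2
    exact h2
  -- the same box sums converge to the `tsum` by absolute convergence
  set Φ : ZetaZeros.riemannZetaNontrivialZeros → ℝ := fun ρ ↦
    (riemannZetaZeroOrder (ρ : ℂ) : ℝ) * Real.log ‖1 - (τ : ℂ) / (ρ : ℂ)‖ with hΦ
  have hΦs : Summable Φ := by
    refine (summable_zeroOrder_mul_log_norm τ).of_norm_bounded (fun ρ ↦ ?_)
    rw [hΦ, Real.norm_eq_abs, abs_mul, abs_of_nonneg (ZetaZeroSum.zeroOrder_nonneg ρ)]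
  have hlim2 := hΦs.hasSum.comp tendsto_weilZeroFinset
  have hident : ∀ T, (∑ᶠ ρ ∈ liZeroBox T, (riemannZetaZeroOrder ρ : ℂ) * F ρ).re =
      ∑ ρ ∈ weilZeroFinset T, Φ ρ := by
    intro T
    rw [liZeroBox_eq_weilZeroIndex', ZetaZeroSum.finsum_mem_weilZeroIndex_eq_sum, Complex.re_sum]
    refine Finset.sum_congr rfl fun ρ _ ↦ ?_
    simp only [hΦ, hF, hg, Complex.mul_re, Complex.intCast_re, Complex.intCast_im,
      sub_zero, Complex.ofReal_re, Complex.ofReal_im, mul_zero]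
  have hbox' : Tendsto (fun T ↦ ∑ ρ ∈ weilZeroFinset T, Φ ρ) atTop
      (𝓝 (Real.log (2 * (riemannXi τ).re))) := hbox.congr fun T ↦ hident T
  exact tendsto_nhds_unique hlim2 hbox'

/-- The `x`-derivative of one term `Re[1 − uˣ]`, `u ≠ 0`: `−Re[uˣ log u]`. [folklore] -/
private theorem hasDerivAt_re_one_sub_cpow {u : ℂ} (hu : u ≠ 0) (x : ℝ) :
    HasDerivAt (fun y : ℝ ↦ (1 - u ^ (y : ℂ)).re) (-(u ^ (x : ℂ) * Complex.log u).re) x := by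
  have h1 : HasDerivAt (fun y : ℂ ↦ u ^ y) (u ^ (x : ℂ) * Complex.log u) (x : ℂ) :=
    (Complex.hasStrictDerivAt_const_cpow (Or.inl hu)).hasDerivAt
  have h2 : HasDerivAt (fun y : ℂ ↦ 1 - u ^ y) (-(u ^ (x : ℂ) * Complex.log u)) (x : ℂ) :=
    h1.const_sub 1
  exact h2.real_of_complex

/-- The bound `|Re[uˣ log u]| ≤ e^{|Re log u|}(|Re log u| + |log u|²)` for real `|x| ≤ 1`. [folklore] -/
private theorem abs_re_cpow_mul_log_le {u : ℂ} (hu : u ≠ 0) {x : ℝ} (hx : |x| ≤ 1) :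
    |(u ^ (x : ℂ) * Complex.log u).re| ≤
      Real.exp |(Complex.log u).re| * (|(Complex.log u).re| + ‖Complex.log u‖ ^ 2) := by
  set L := Complex.log u with hL
  set a := L.re
  set c := L.im
  have hcpow : u ^ (x : ℂ) = Complex.exp ((x : ℂ) * L) := by
    rw [Complex.cpow_def_of_ne_zero hu, mul_comm]
  have hre : ((x : ℂ) * L).re = x * a := by simp [a]
  have him : ((x : ℂ) * L).im = x * c := by simp [c]
  have hexp_re : (Complex.exp ((x : ℂ) * L)).re = Real.exp (x * a) * Real.cos (x * c) := by
    rw [Complex.exp_re, hre, him]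
  have hexp_im : (Complex.exp ((x : ℂ) * L)).im = Real.exp (x * a) * Real.sin (x * c) := by
    rw [Complex.exp_im, hre, him]
  have hprod : (u ^ (x : ℂ) * L).re =
      Real.exp (x * a) * (a * Real.cos (x * c) - c * Real.sin (x * c)) := by
    rw [hcpow, Complex.mul_re, hexp_re, hexp_im]; ring
  rw [hprod, abs_mul, abs_of_pos (Real.exp_pos _)]
  have hxa : Real.exp (x * a) ≤ Real.exp |a| := by
    refine Real.exp_le_exp.2 ?_
    calc x * a ≤ |x * a| := le_abs_self _
      _ = |x| * |a| := abs_mul _ _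
      _ ≤ 1 * |a| := mul_le_mul_of_nonneg_right hx (abs_nonneg _)
      _ = |a| := one_mul _
  have hcos : |a * Real.cos (x * c)| ≤ |a| := by
    rw [abs_mul]; exact mul_le_of_le_one_right (abs_nonneg _) (Real.abs_cos_le_one _)
  have hsin : |c * Real.sin (x * c)| ≤ c ^ 2 := by
    rw [abs_mul]
    calc |c| * |Real.sin (x * c)| ≤ |c| * |x * c| :=
          mul_le_mul_of_nonneg_left (Real.abs_sin_le_abs) (abs_nonneg _)
      _ = |x| * (|c| * |c|) := by rw [abs_mul]; ring
      _ ≤ 1 * (|c| * |c|) := mul_le_mul_of_nonneg_right hx (by positivity)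
      _ = c ^ 2 := by rw [one_mul, ← sq, sq_abs]
  have hc2 : c ^ 2 ≤ ‖L‖ ^ 2 := by
    rw [Complex.sq_norm, Complex.normSq_apply]; nlinarith [sq_nonneg a]
  have htri : |a * Real.cos (x * c) - c * Real.sin (x * c)| ≤ |a| + ‖L‖ ^ 2 :=
    (abs_sub _ _).trans (by linarith)
  exact mul_le_mul hxa htri (abs_nonneg _) (Real.exp_pos _).le

/-- **`∂F/∂x(0,τ) = log(2ξ(τ))/τ`** for real `τ ≠ 0` (p0010:L29–33; `2·` = Freitas' normalisation):
termwise differentiation of the absolutely dominated zero sum. [cite: Freitas2006LiHalfPlanes, §5 (arXiv p0010:L29)] -/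
theorem hasDerivAt_freitasF_zero {τ : ℝ} (hτ : τ ≠ 0) :
    HasDerivAt (fun x : ℝ ↦ freitasF x τ) (Real.log (2 * (riemannXi τ).re) / τ) 0 := by
  -- the terms and their derivatives
  set m : ZetaZeros.riemannZetaNontrivialZeros → ℝ := fun ρ ↦ (riemannZetaZeroOrder (ρ : ℂ) : ℝ)
    with hm
  set u : ZetaZeros.riemannZetaNontrivialZeros → ℂ := fun ρ ↦ (ρ : ℂ) / ((ρ : ℂ) - τ) with hu
  have hu0 : ∀ ρ, u ρ ≠ 0 := fun ρ ↦ freitasU_ne_zero ρ τ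
  set g : ZetaZeros.riemannZetaNontrivialZeros → ℝ → ℝ := fun ρ x ↦ m ρ * (1 - u ρ ^ (x : ℂ)).re
    with hg
  set g' : ZetaZeros.riemannZetaNontrivialZeros → ℝ → ℝ := fun ρ x ↦
    m ρ * (-(u ρ ^ (x : ℂ) * Complex.log (u ρ)).re) with hg'
  set U : ZetaZeros.riemannZetaNontrivialZeros → ℝ := fun ρ ↦ m ρ *
    (Real.exp |(Complex.log (u ρ)).re| * (|(Complex.log (u ρ)).re| + ‖Complex.log (u ρ)‖ ^ 2))
    with hU
  have hm0 : ∀ ρ, 0 ≤ m ρ := fun ρ ↦ ZetaZeroSum.zeroOrder_nonneg ρ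
  -- summability of the dominating sequence
  have hUs : Summable U := by
    refine summable_zeros_of_le (C := Real.exp 1 * ((|τ| + τ ^ 2) + 3 * τ ^ 2))
      (R := 8 * (|τ| + 1)) (by nlinarith [abs_nonneg τ])
      (fun ρ ↦ mul_nonneg (hm0 ρ) (by positivity)) fun ρ hfar ↦ ?_
    obtain ⟨hn1, hre, hsq⟩ := log_freitasU_bounds ρ τ hfar
    have ha1 : |(Complex.log (u ρ)).re| ≤ 1 := (Complex.abs_re_le_norm _).trans hn1
    have hρn : 0 < ‖(ρ : ℂ)‖ := norm_pos_iff.2 (zero_ne_zero' ρ)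
    rw [hU]
    simp only
    rw [show Real.exp 1 * ((|τ| + τ ^ 2) + 3 * τ ^ 2) * (m ρ / ‖(ρ : ℂ)‖ ^ 2) =
      m ρ * (Real.exp 1 * (((|τ| + τ ^ 2) / ‖(ρ : ℂ)‖ ^ 2 + 3 * τ ^ 2 / ‖(ρ : ℂ)‖ ^ 2))) by
      field_simp]
    refine mul_le_mul_of_nonneg_left ?_ (hm0 ρ)
    exact mul_le_mul (Real.exp_le_exp.2 ha1) (add_le_add hre hsq) (by positivity) (by positivity)
  -- termwise differentiation on `(-1, 1)`
  have hderiv : ∀ ρ x, x ∈ Set.Ioo (-1 : ℝ) 1 → HasDerivAt (g ρ) (g' ρ x) x := by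
    intro ρ x _
    simp only [hg, hg']
    exact (hasDerivAt_re_one_sub_cpow (hu0 ρ) x).const_mul (m ρ)
  have hbound : ∀ ρ x, x ∈ Set.Ioo (-1 : ℝ) 1 → ‖g' ρ x‖ ≤ U ρ := by
    intro ρ x hx
    have hx1 : |x| ≤ 1 := abs_le.2 ⟨hx.1.le, hx.2.le⟩
    rw [hg', hU, Real.norm_eq_abs]
    simp only
    rw [abs_mul, abs_of_nonneg (hm0 ρ), abs_neg]
    exact mul_le_mul_of_nonneg_left (abs_re_cpow_mul_log_le (hu0 ρ) hx1) (hm0 ρ)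
  have hg0 : Summable fun ρ ↦ g ρ 0 := by
    refine (summable_zero).congr fun ρ ↦ ?_
    simp [hg]
  have HD := hasDerivAt_tsum_of_isPreconnected hUs isOpen_Ioo isPreconnected_Ioo hderiv hbound
    (show (0 : ℝ) ∈ Set.Ioo (-1 : ℝ) 1 by norm_num) hg0 (show (0 : ℝ) ∈ Set.Ioo (-1 : ℝ) 1 by norm_num)
  -- the value of the derivative series at `0`
  have hval : ∑' ρ, g' ρ 0 = Real.log (2 * (riemannXi τ).re) := by
    rw [← tsum_zeroOrder_mul_log_norm τ]
    refine tsum_congr fun ρ ↦ ?_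
    simp only [hg', hm, hu, Complex.ofReal_zero, Complex.cpow_zero, one_mul,
      re_log_freitasU, neg_neg]
  rw [hval] at HD
  -- `F(x,τ) = τ⁻¹ · Σ' g ρ x`
  have hfun : (fun x : ℝ ↦ freitasF x τ) = fun x ↦ τ⁻¹ * ∑' ρ, g ρ x := by
    funext x
    simp only [freitasF, hτ, if_false, hg, hm, hu]
  rw [hfun, div_eq_inv_mul]
  exact HD.const_mul τ⁻¹

/-- **Freitas 2006, `F(0,τ) = 0` and `∂F/∂x(0,τ) = (1/τ) log ξ_F(τ)`** (p0010:L27–36) — DISCHARGED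
for `τ ≠ 0` as typed. [cite: Freitas2006LiHalfPlanes, §5 (arXiv p0010:L27)] -/
theorem Freitas2006_F_at_zero_holds : Freitas2006_F_at_zero := by
  intro τ hτ
  exact ⟨freitasF_zero_left τ, hasDerivAt_freitasF_zero hτ,
    fun h ↦ log_two_mul_re_riemannXi_div_neg hτ h, fun h ↦ log_two_mul_re_riemannXi_div_pos h⟩

end FAtZero

/-! ## Corollary 5.2: `F(−p, τ)` is a polynomial in `τ`

At a negative integer `x = −p` each term of the zero sum is a polynomial:
`1 − (ρ/(ρ−τ))^{−p} = 1 − (1 − τ/ρ)^p = Σ_{k<p} C(p,k+1)(−1)ᵏ (τ/ρ)^{k+1}`, and the power sums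
`Σ_ρ m(ρ) Re ρ^{−(k+1)} = Re σ_{k+1} = −ℓ_k` (tree: `zetaZeroPowerSum`, `Coffey2008_eq34_holds` /
`zetaZeroPowerSum_succ_eq`, and `ξ'/ξ(1−s) = −ξ'/ξ(s)`), which is the computation of the proof of
Theorem 5.1 (p0010:L68–80) at `x = −p`. -/

section CorFiveTwo

open ZetaZeros

/-- The real power sums `Σ_ρ m(ρ) Re ρ^{−k}` (`k ≥ 1`) converge absolutely (`k = 1`:
`Re(1/ρ) = Re ρ/|ρ|²`). [cite: Freitas2006LiHalfPlanes, proof of Theorem 5.1 (arXiv p0010:L75)] -/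
theorem summable_zeroOrder_mul_re_inv_pow {k : ℕ} (hk : 1 ≤ k) :
    Summable (fun ρ : ZetaZeros.riemannZetaNontrivialZeros ↦
      (riemannZetaZeroOrder (ρ : ℂ) : ℝ) * (((ρ : ℂ)⁻¹) ^ k).re) := by
  refine Summable.of_norm ?_
  refine summable_zeros_of_le (C := 1) (R := 1) le_rfl (fun ρ ↦ norm_nonneg _) fun ρ _ ↦ ?_
  have h1 : (1 : ℝ) ≤ ‖(ρ : ℂ)‖ := by linarith [FordL33.fourteen_lt_norm ρ]
  have hm : (0 : ℝ) ≤ riemannZetaZeroOrder (ρ : ℂ) := ZetaZeroSum.zeroOrder_nonneg ρ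
  have hρ2 : (0 : ℝ) < ‖(ρ : ℂ)‖ ^ 2 := by positivity
  rw [Real.norm_eq_abs, abs_mul, abs_of_nonneg hm, one_mul, div_eq_mul_inv]
  refine mul_le_mul_of_nonneg_left ?_ hm
  rcases Nat.lt_or_ge k 2 with hk1 | hk2
  · obtain rfl : k = 1 := by omega
    have h0 := riemannZetaNontrivialZeros.re_pos ρ.2
    have h1' := riemannZetaNontrivialZeros.re_lt_one ρ.2
    rw [pow_one, Complex.inv_re, Complex.normSq_eq_norm_sq, abs_div, abs_of_pos hρ2,
      abs_of_pos h0, div_le_iff₀ hρ2, inv_mul_cancel₀ hρ2.ne']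
    exact h1'.le
  · calc |(((ρ : ℂ)⁻¹) ^ k).re| ≤ ‖((ρ : ℂ)⁻¹) ^ k‖ := Complex.abs_re_le_norm _
      _ = (‖(ρ : ℂ)‖ ^ k)⁻¹ := by rw [norm_pow, norm_inv, inv_pow]
      _ ≤ (‖(ρ : ℂ)‖ ^ 2)⁻¹ := inv_anti₀ hρ2 (pow_le_pow_right₀ h1 hk2)

/-- `Re σ_k = Σ_ρ m(ρ) Re ρ^{−k}` (`k ≥ 1`): the symmetric power sum's real part is the plain sum of
real parts (the zero set and the multiplicities are invariant under `ρ ↦ 1 − ρ̄`, tree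
`FordL33.reflEquiv`). [cite: Freitas2006LiHalfPlanes, proof of Theorem 5.1 (arXiv p0010:L75)] -/
theorem re_zetaZeroPowerSum_eq_tsum {k : ℕ} (hk : 1 ≤ k) :
    (zetaZeroPowerSum k).re = ∑' ρ : ZetaZeros.riemannZetaNontrivialZeros,
      (riemannZetaZeroOrder (ρ : ℂ) : ℝ) * (((ρ : ℂ)⁻¹) ^ k).re := by
  have hS := summable_zeroOrder_mul_re_inv_pow hk
  set f : ZetaZeros.riemannZetaNontrivialZeros → ℝ := fun ρ ↦
    (riemannZetaZeroOrder (ρ : ℂ) : ℝ) * (((ρ : ℂ)⁻¹) ^ k).re with hf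
  -- the reflected sum equals the plain one
  have hS' : Summable (fun ρ : ZetaZeros.riemannZetaNontrivialZeros ↦
      (riemannZetaZeroOrder (ρ : ℂ) : ℝ) * (((1 - (ρ : ℂ))⁻¹) ^ k).re) ∧
      ∑' ρ : ZetaZeros.riemannZetaNontrivialZeros,
        (riemannZetaZeroOrder (ρ : ℂ) : ℝ) * (((1 - (ρ : ℂ))⁻¹) ^ k).re = ∑' ρ, f ρ := by
    have hrefl : ∀ ρ : ZetaZeros.riemannZetaNontrivialZeros, f (FordL33.reflEquiv ρ) =
        (riemannZetaZeroOrder (ρ : ℂ) : ℝ) * (((1 - (ρ : ℂ))⁻¹) ^ k).re := by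
      intro ρ
      have hco : (FordL33.reflEquiv ρ : RHWave0.riemannZetaNontrivialZeros) = FordL33.refl ρ := rfl
      have hval : ((FordL33.refl ρ : RHWave0.riemannZetaNontrivialZeros) : ℂ) = 1 - conj (ρ : ℂ) := rfl
      rw [hf]
      simp only
      rw [hco, FordL33.order_refl, hval, show (1 : ℂ) - conj (ρ : ℂ) = conj (1 - (ρ : ℂ)) by simp,
        ← map_inv₀, ← map_pow, Complex.conj_re]
    have hfun : (fun ρ : ZetaZeros.riemannZetaNontrivialZeros ↦
        (riemannZetaZeroOrder (ρ : ℂ) : ℝ) * (((1 - (ρ : ℂ))⁻¹) ^ k).re) = f ∘ FordL33.reflEquiv := by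
      funext ρ; exact (hrefl ρ).symm
    rw [hfun]
    exact ⟨(FordL33.reflEquiv.summable_iff).2 hS, FordL33.reflEquiv.tsum_eq f⟩
  unfold zetaZeroPowerSum
  have hsum : Summable (fun ρ : ZetaZeros.riemannZetaNontrivialZeros ↦
      (riemannZetaZeroOrder (ρ : ℂ) : ℂ) * ((((ρ : ℂ))⁻¹) ^ k + ((1 - (ρ : ℂ))⁻¹) ^ k)) :=
    summable_zetaZeroPowerSum_term hk
  have h12re : ((1 : ℂ) / 2).re = 1 / 2 := by norm_num
  have h12im : ((1 : ℂ) / 2).im = 0 := by norm_num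
  rw [Complex.mul_re, Complex.re_tsum hsum, h12re, h12im, zero_mul, sub_zero]
  have hsplit : ∀ ρ : ZetaZeros.riemannZetaNontrivialZeros,
      ((riemannZetaZeroOrder (ρ : ℂ) : ℂ) * ((((ρ : ℂ))⁻¹) ^ k + ((1 - (ρ : ℂ))⁻¹) ^ k)).re =
        f ρ + (riemannZetaZeroOrder (ρ : ℂ) : ℝ) * (((1 - (ρ : ℂ))⁻¹) ^ k).re := by
    intro ρ
    rw [hf]
    simp only [Complex.mul_re, Complex.add_re, Complex.add_im, Complex.intCast_re, Complex.intCast_im,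
      zero_mul, sub_zero]
    ring
  rw [tsum_congr hsplit, hS.tsum_add hS'.1, hS'.2]
  ring

/-- `ℓ_k = −Re σ_{k+1}`: Freitas' Taylor coefficients of `ξ'/ξ` at `0` are minus the power sums over
the zeros (`ξ'/ξ(s) = −Σ_ρ Σ_k s^k/ρ^{k+1}`, p0010:L72–80; tree `zetaZeroPowerSum_succ_eq` at `s = 1`
and the functional equation). [cite: Freitas2006LiHalfPlanes, proof of Theorem 5.1 (arXiv p0010:L78)] -/
theorem freitasEllCoeff_zero_eq_neg_re_zetaZeroPowerSum (k : ℕ) :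
    freitasEllCoeff 0 k = -(zetaZeroPowerSum (k + 1)).re := by
  rw [freitasEllCoeff, Complex.ofReal_zero, iteratedDeriv_logDeriv_riemannXi_zero,
    zetaZeroPowerSum_succ_eq, ← Complex.neg_re]
  congr 1
  ring

/-- `1 − (1 − w)^p = Σ_{k<p} C(p,k+1) (−1)ᵏ w^{k+1}`. [folklore] -/
private theorem one_sub_one_sub_pow (w : ℂ) (p : ℕ) :
    1 - (1 - w) ^ p = ∑ k ∈ Finset.range p, (p.choose (k + 1) : ℂ) * (-1) ^ k * w ^ (k + 1) := by
  have h := add_pow (-w) 1 p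
  rw [show -w + 1 = 1 - w by ring, Finset.sum_range_succ'] at h
  simp only [one_pow, mul_one, pow_zero, Nat.choose_zero_right, Nat.cast_one] at h
  rw [h]
  have e : ∀ k ∈ Finset.range p, (-w) ^ (k + 1) * (p.choose (k + 1) : ℂ) =
      -((p.choose (k + 1) : ℂ) * (-1) ^ k * w ^ (k + 1)) := by
    intro k _; rw [neg_pow]; ring
  rw [Finset.sum_congr rfl e, Finset.sum_neg_distrib]
  ring

/-- `Π_{j=0}^{k} (j − p) / (k+1)! = (−1)^{k+1} C(p, k+1)` for `k < p`. [folklore] -/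
private theorem prod_sub_div_factorial {p k : ℕ} (hk : k < p) :
    (∏ j ∈ Finset.range (k + 1), ((j : ℝ) - p)) / ((k + 1)! : ℝ) =
      (-1) ^ (k + 1) * (p.choose (k + 1) : ℝ) := by
  have hprod : (∏ j ∈ Finset.range (k + 1), ((j : ℝ) - p)) =
      (-1) ^ (k + 1) * (p.descFactorial (k + 1) : ℝ) := by
    rw [Nat.descFactorial_eq_prod_range, Nat.cast_prod]
    rw [show ((-1 : ℝ)) ^ (k + 1) = ∏ _j ∈ Finset.range (k + 1), (-1 : ℝ) by simp,
      ← Finset.prod_mul_distrib]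
    refine Finset.prod_congr rfl fun j hj ↦ ?_
    have hj' : j ≤ p := by have := Finset.mem_range.1 hj; omega
    rw [Nat.cast_sub hj']
    ring
  rw [hprod, Nat.descFactorial_eq_factorial_mul_choose]
  have hf : ((k + 1)! : ℝ) ≠ 0 := by positivity
  push_cast
  field_simp

/-- `F(−p, 0)`: both sides equal `−p ℓ₀`. [folklore] -/
private theorem cor_5_2_at_zero {p : ℕ} (hp : 1 ≤ p) :
    freitasF (-(p : ℝ)) 0 = ∑ k ∈ Finset.range p,
      freitasEllCoeff 0 k / ((k + 1)! : ℝ) * (∏ j ∈ Finset.range (k + 1), ((j : ℝ) - p)) * (0 : ℝ) ^ k := by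
  rw [Finset.sum_eq_single 0]
  · simp [freitasF, freitasEllCoeff]
    ring
  · intro k _ hk
    simp [zero_pow hk]
  · intro h; exact absurd (Finset.mem_range.2 (by omega)) h

/-- **Freitas 2006, Corollary 5.2** — DISCHARGED: for a positive integer `p` and every real `τ`,
`F(−p,τ) = Σ_{k=0}^{p−1} (ℓ_k/(k+1)!) Π_{j=0}^{k}(j−p) τᵏ`. [cite: Freitas2006LiHalfPlanes, Corollary 5.2] -/
theorem Freitas2006_cor_5_2_holds : Freitas2006_cor_5_2 := by
  intro p hp τ
  by_cases hτ : τ = 0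
  · subst hτ; exact cor_5_2_at_zero hp
  -- `τ ≠ 0`
  set m : ZetaZeros.riemannZetaNontrivialZeros → ℝ := fun ρ ↦ (riemannZetaZeroOrder (ρ : ℂ) : ℝ)
    with hm
  -- each term is a polynomial in `τ`
  have hterm : ∀ ρ : ZetaZeros.riemannZetaNontrivialZeros,
      m ρ * (1 - ((ρ : ℂ) / ((ρ : ℂ) - τ)) ^ (((-(p : ℝ) : ℝ)) : ℂ)).re =
        ∑ k ∈ Finset.range p, ((p.choose (k + 1) : ℝ) * (-1) ^ k * τ ^ (k + 1)) *
          (m ρ * (((ρ : ℂ)⁻¹) ^ (k + 1)).re) := by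
    intro ρ
    have hρ := zero_ne_zero' ρ
    have hρτ : (ρ : ℂ) - τ ≠ 0 := sub_ne_zero.2 (zero_ne_ofReal ρ τ)
    have hcpow : ((ρ : ℂ) / ((ρ : ℂ) - τ)) ^ (((-(p : ℝ) : ℝ)) : ℂ) = (1 - (τ : ℂ) * (ρ : ℂ)⁻¹) ^ p := by
      rw [Complex.ofReal_neg, Complex.ofReal_natCast, Complex.cpow_neg, Complex.cpow_natCast,
        ← inv_pow, inv_div]
      congr 1
      field_simp
    rw [hcpow, one_sub_one_sub_pow, Complex.re_sum, Finset.mul_sum]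
    refine Finset.sum_congr rfl fun k _ ↦ ?_
    rw [mul_pow, show ((p.choose (k + 1) : ℂ)) * (-1) ^ k * ((τ : ℂ) ^ (k + 1) * ((ρ : ℂ)⁻¹) ^ (k + 1)) =
      ((((p.choose (k + 1) : ℝ) * (-1) ^ k * τ ^ (k + 1) : ℝ)) : ℂ) * ((ρ : ℂ)⁻¹) ^ (k + 1) by
        push_cast; ring, Complex.re_ofReal_mul]
    ring
  have hS : ∀ k ∈ Finset.range p, Summable (fun ρ : ZetaZeros.riemannZetaNontrivialZeros ↦
      ((p.choose (k + 1) : ℝ) * (-1) ^ k * τ ^ (k + 1)) * (m ρ * (((ρ : ℂ)⁻¹) ^ (k + 1)).re)) :=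
    fun k _ ↦ (summable_zeroOrder_mul_re_inv_pow (k := k + 1) (by omega)).mul_left _
  have hF : freitasF (-(p : ℝ)) τ = τ⁻¹ * ∑ k ∈ Finset.range p,
      ((p.choose (k + 1) : ℝ) * (-1) ^ k * τ ^ (k + 1)) * (zetaZeroPowerSum (k + 1)).re := by
    rw [freitasF, if_neg hτ]
    congr 1
    rw [show (∑' ρ : ZetaZeros.riemannZetaNontrivialZeros, (riemannZetaZeroOrder (ρ : ℂ) : ℝ) *
        (1 - ((ρ : ℂ) / ((ρ : ℂ) - τ)) ^ (((-(p : ℝ) : ℝ)) : ℂ)).re) =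
        ∑' ρ : ZetaZeros.riemannZetaNontrivialZeros, ∑ k ∈ Finset.range p,
          ((p.choose (k + 1) : ℝ) * (-1) ^ k * τ ^ (k + 1)) * (m ρ * (((ρ : ℂ)⁻¹) ^ (k + 1)).re)
        from tsum_congr hterm, Summable.tsum_finsetSum hS]
    refine Finset.sum_congr rfl fun k _ ↦ ?_
    rw [tsum_mul_left, re_zetaZeroPowerSum_eq_tsum (by omega : 1 ≤ k + 1)]
  rw [hF, Finset.mul_sum]
  refine Finset.sum_congr rfl fun k hk ↦ ?_
  have hk' : k < p := Finset.mem_range.1 hk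
  rw [freitasEllCoeff_zero_eq_neg_re_zetaZeroPowerSum]
  have hc := prod_sub_div_factorial hk'
  have hf0 : ((k + 1)! : ℝ) ≠ 0 := by positivity
  rw [div_eq_iff hf0] at hc
  rw [hc, pow_succ]
  field_simp
  ring

end CorFiveTwo

/-! ## Theorem 5.1: the expansion of `F(x,τ)` in powers of `τ`

Proof as printed (p0010:L64–86): expand each term, `(ρ/(ρ−τ))ˣ = (1 − τ/ρ)^{−x} =
Σ_k [x(x+1)⋯(x+k−1)/k!] (τ/ρ)ᵏ` (the binomial series, Mathlib
`Complex.one_div_one_sub_cpow_hasFPowerSeriesOnBall_zero`), and sum over the zeros using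
`Σ_ρ m(ρ) Re ρ^{−k} = −ℓ_{k−1}`; the double series converges absolutely for `|τ| < |ρ₁|` (the
`k = 1` row through `Re(1/ρ) = Re ρ/|ρ|²`), which justifies the interchange. -/

section ThmFiveOne

open ZetaZeros

/-- `n! · C(a+n−1, n) = a(a+1)⋯(a+n−1)` (the rising factorial). [folklore] -/
private theorem factorial_mul_choose_eq_prod {R : Type*} [Field R] [CharZero R] (a : R) (n : ℕ) :
    (n ! : R) * Ring.choose (a + n - 1) n = ∏ j ∈ Finset.range n, (a + j) := by
  rw [Ring.choose_eq_smul, smul_eq_mul, ← mul_assoc,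
    mul_inv_cancel₀ (by exact_mod_cast Nat.factorial_ne_zero n), one_mul,
    Polynomial.descPochhammer_smeval_eq_ascPochhammer, show a + n - 1 - (n : R) + 1 = a by ring,
    Polynomial.ascPochhammer_smeval_eq_eval]
  induction n with
  | zero => simp
  | succ n ih => rw [ascPochhammer_succ_eval, ih, Finset.prod_range_succ]

/-- The binomial series for one zero: for `‖w‖ < 1` and real `x`,
`((1−w)⁻¹)ˣ = Σ_n [Π_{j<n}(x+j)/n!] wⁿ`. [cite: Freitas2006LiHalfPlanes, proof of Theorem 5.1 (arXiv p0010:L68)] -/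
theorem hasSum_inv_one_sub_cpow {w : ℂ} (hw : ‖w‖ < 1) (x : ℝ) :
    HasSum (fun n : ℕ ↦ (((∏ j ∈ Finset.range n, (x + (j : ℝ))) / (n ! : ℝ) : ℝ) : ℂ) * w ^ n)
      (((1 - w)⁻¹) ^ (x : ℂ)) := by
  have P := Complex.one_div_one_sub_cpow_hasFPowerSeriesOnBall_zero (x : ℂ)
  have hmem : w ∈ Metric.eball (0 : ℂ) 1 := by
    rw [show (1 : ENNReal) = ENNReal.ofReal 1 by simp, Metric.eball_ofReal]
    simpa using hw
  have H := P.hasSum hmem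
  simp only [zero_add, FormalMultilinearSeries.ofScalars_apply_eq, smul_eq_mul] at H
  have harg : (1 - w).arg ≠ Real.pi := by
    intro e
    have h1 := (Complex.arg_eq_pi_iff.1 e).1
    have h2 : |w.re| ≤ ‖w‖ := Complex.abs_re_le_norm w
    simp only [Complex.sub_re, Complex.one_re] at h1
    have := (abs_le.1 (h2.trans hw.le)).2
    linarith
  rw [Complex.inv_cpow _ _ harg, ← one_div]
  refine H.congr_fun fun n ↦ ?_
  have hn : (n ! : ℂ) ≠ 0 := by exact_mod_cast Nat.factorial_ne_zero n
  have key := factorial_mul_choose_eq_prod ((x : ℂ)) n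
  rw [show Ring.choose ((x : ℂ) + n - 1) n = (∏ j ∈ Finset.range n, ((x : ℂ) + j)) / (n ! : ℂ) by
    rw [← key]; field_simp]
  push_cast
  ring

/-- A uniform gap below the zeros: if `|τ| < |ρ|` for every zero then `|τ| ≤ s|ρ|` for every zero,
for some `s < 1` (finitely many zeros have `|Im ρ| ≤ 2|τ|`). [folklore] -/
private theorem exists_ratio_lt_one {τ : ℝ}
    (hτρ : ∀ ρ ∈ ZetaZeros.riemannZetaNontrivialZeros, |τ| < ‖ρ‖) :
    ∃ s : ℝ, 1 / 2 ≤ s ∧ s < 1 ∧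
      ∀ ρ : ZetaZeros.riemannZetaNontrivialZeros, |τ| ≤ s * ‖(ρ : ℂ)‖ := by
  classical
  set S : Finset ZetaZeros.riemannZetaNontrivialZeros := weilZeroFinset (2 * |τ|) with hS
  -- off `S` the ratio is `< 1/2`
  have hoff : ∀ ρ : ZetaZeros.riemannZetaNontrivialZeros, ρ ∉ S → |τ| ≤ 1 / 2 * ‖(ρ : ℂ)‖ := by
    intro ρ hρ
    rw [hS, mem_weilZeroFinset, not_le] at hρ
    have : 2 * |τ| ≤ ‖(ρ : ℂ)‖ := hρ.le.trans (Complex.abs_im_le_norm _)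
    linarith
  by_cases hne : S.Nonempty
  · obtain ⟨ρ₀, hρ₀, hmax⟩ := S.exists_max_image (fun ρ ↦ |τ| / ‖(ρ : ℂ)‖) hne
    have hρ₀n := norm_pos_iff.2 (zero_ne_zero' ρ₀)
    set s : ℝ := max (1 / 2) (|τ| / ‖(ρ₀ : ℂ)‖) with hs
    refine ⟨s, le_max_left _ _, max_lt (by norm_num) ((div_lt_one hρ₀n).2 (hτρ _ ρ₀.2)),
      fun ρ ↦ ?_⟩
    have hρn := norm_pos_iff.2 (zero_ne_zero' ρ)
    by_cases hmem : ρ ∈ S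
    · have h1 : |τ| / ‖(ρ : ℂ)‖ ≤ s := (hmax ρ hmem).trans (le_max_right _ _)
      rwa [div_le_iff₀ hρn] at h1
    · exact (hoff ρ hmem).trans (mul_le_mul_of_nonneg_right (le_max_left _ _) (norm_nonneg _))
  · refine ⟨1 / 2, le_rfl, by norm_num, fun ρ ↦ hoff ρ fun h ↦ hne ⟨ρ, h⟩⟩

/-- `Σ_ρ m(ρ)/|ρ|² < ∞` over the zero subtype. [folklore] -/
private theorem summable_zeroOrder_div_norm_sq' :
    Summable (fun ρ : ZetaZeros.riemannZetaNontrivialZeros ↦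
      (riemannZetaZeroOrder (ρ : ℂ) : ℝ) / ‖(ρ : ℂ)‖ ^ 2) :=
  summable_zeros_of_le (C := 1) (R := 1) le_rfl
    (fun ρ ↦ div_nonneg (ZetaZeroSum.zeroOrder_nonneg ρ) (by positivity)) fun ρ _ ↦ by rw [one_mul]

/-- **Freitas 2006, Theorem 5.1** — DISCHARGED (real `x`, `|τ| < |ρ|` for every zero):
`F(x,τ) = Σ_{k≥0} (ℓ_k/(k+1)!) x(x+1)⋯(x+k) τᵏ`. [cite: Freitas2006LiHalfPlanes, Theorem 5.1] -/
theorem Freitas2006_thm_5_1_holds : Freitas2006_thm_5_1 := by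
  intro x τ hτρ
  -- the coefficients `c_n = x(x+1)⋯(x+n−1)/n!`
  obtain ⟨c, hc⟩ : ∃ c : ℕ → ℝ, c = fun n ↦ (∏ j ∈ Finset.range n, (x + (j : ℝ))) / (n ! : ℝ) :=
    ⟨_, rfl⟩
  have hcn : ∀ n, (∏ j ∈ Finset.range n, (x + (j : ℝ))) / (n ! : ℝ) = c n := fun n ↦ by rw [hc]
  have hc0 : c 0 = 1 := by rw [hc]; simp
  by_cases hτ : τ = 0
  · -- `τ = 0`: both sides reduce to `x ℓ₀`
    subst hτ
    have hval : freitasF x 0 = freitasEllCoeff 0 0 / ((0 + 1)! : ℝ) *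
        (∏ j ∈ Finset.range (0 + 1), (x + j)) * (0 : ℝ) ^ 0 := by
      simp [freitasF, freitasEllCoeff]; ring
    rw [hval]
    refine hasSum_single 0 fun k hk ↦ ?_
    simp [zero_pow hk]
  -- `τ ≠ 0`
  obtain ⟨s, hs12, hs1, hsρ⟩ := exists_ratio_lt_one hτρ
  have hs0 : 0 < s := by linarith
  set m : ZetaZeros.riemannZetaNontrivialZeros → ℝ := fun ρ ↦ (riemannZetaZeroOrder (ρ : ℂ) : ℝ)
    with hm
  have hm0 : ∀ ρ, 0 ≤ m ρ := fun ρ ↦ ZetaZeroSum.zeroOrder_nonneg ρ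
  -- summability of `|c n| sⁿ` (the real binomial series has radius `1`)
  have hcs : Summable (fun n : ℕ ↦ |c n| * s ^ n) := by
    have P := Real.one_div_one_sub_rpow_hasFPowerSeriesOnBall_zero x
    have hr : ((s.toNNReal : NNReal) : ENNReal) <
        (FormalMultilinearSeries.ofScalars ℝ fun n ↦ Ring.choose (x + n - 1) n).radius := by
      refine lt_of_lt_of_le ?_ P.r_le
      exact ENNReal.coe_lt_one_iff.2 (Real.toNNReal_lt_one.2 hs1)
    have H := FormalMultilinearSeries.summable_norm_mul_pow _ hr
    refine H.congr fun n ↦ ?_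
    rw [FormalMultilinearSeries.ofScalars_norm, Real.norm_eq_abs, Real.coe_toNNReal _ hs0.le]
    congr 2
    have key := factorial_mul_choose_eq_prod x n
    have hn : (n ! : ℝ) ≠ 0 := by positivity
    rw [hc]
    simp only
    rw [← key]
    field_simp
  -- the double family `G (ρ, n) = −m(ρ) c_{n+1} τ^{n+1} Re ρ^{−(n+1)}`
  set G : ZetaZeros.riemannZetaNontrivialZeros × ℕ → ℝ := fun q ↦
    -(m q.1 * (c (q.2 + 1) * τ ^ (q.2 + 1) * ((((q.1 : ℂ))⁻¹) ^ (q.2 + 1)).re)) with hG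
  -- domination `|G(ρ,n)| ≤ (m/|ρ|²) · A n`
  set A : ℕ → ℝ := fun n ↦ |c (n + 1)| * s ^ (n + 1) * (τ ^ 2 / s ^ 2) +
    (if n = 0 then |c 1| * |τ| else 0) with hA
  have hA0 : ∀ n, 0 ≤ A n := fun n ↦ by
    rw [hA]; simp only
    refine add_nonneg (by positivity) ?_
    split_ifs <;> positivity
  have hAs : Summable A := by
    have h1 : Summable (fun n : ℕ ↦ |c (n + 1)| * s ^ (n + 1) * (τ ^ 2 / s ^ 2)) :=
      ((summable_nat_add_iff 1).2 hcs).mul_right (τ ^ 2 / s ^ 2)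
    have h2 : Summable (fun n : ℕ ↦ if n = 0 then |c 1| * |τ| else 0) :=
      summable_of_hasFiniteSupport ((Set.finite_singleton 0).subset fun n hn ↦ by
        by_contra h
        have hn0 : n ≠ 0 := fun e ↦ h (by simp [e])
        exact hn (by simp [hn0]))
    exact h1.add h2
  have hdom : ∀ q : ZetaZeros.riemannZetaNontrivialZeros × ℕ,
      ‖G q‖ ≤ (m q.1 / ‖(q.1 : ℂ)‖ ^ 2) * A q.2 := by
    rintro ⟨ρ, n⟩
    have hρ := norm_pos_iff.2 (zero_ne_zero' ρ)
    rw [Real.norm_eq_abs]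
    show |-(m ρ * (c (n + 1) * τ ^ (n + 1) * ((((ρ : ℂ))⁻¹) ^ (n + 1)).re))| ≤
      (m ρ / ‖(ρ : ℂ)‖ ^ 2) * A n
    rw [abs_neg, abs_mul, abs_of_nonneg (hm0 ρ), div_mul_eq_mul_div, mul_div_assoc]
    refine mul_le_mul_of_nonneg_left ?_ (hm0 ρ)
    rw [abs_mul, abs_mul, abs_pow]
    rcases Nat.eq_zero_or_pos n with rfl | hn
    · -- `n = 0`: `Re(1/ρ) = Re ρ/|ρ|² ≤ 1/|ρ|²`
      have h0 := riemannZetaNontrivialZeros.re_pos ρ.2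
      have h1 := riemannZetaNontrivialZeros.re_lt_one ρ.2
      simp only [zero_add, pow_one, hA, if_true]
      have hρ2 : (0 : ℝ) < ‖(ρ : ℂ)‖ ^ 2 := by positivity
      rw [Complex.inv_re, Complex.normSq_eq_norm_sq, abs_div, abs_of_pos h0, abs_of_pos hρ2]
      have hfirst : 0 ≤ |c 1| * s * (τ ^ 2 / s ^ 2) := by positivity
      calc |c 1| * |τ| * ((ρ : ℂ).re / ‖(ρ : ℂ)‖ ^ 2)
          ≤ |c 1| * |τ| * (1 / ‖(ρ : ℂ)‖ ^ 2) := by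
            refine mul_le_mul_of_nonneg_left ?_ (by positivity)
            exact div_le_div_of_nonneg_right h1.le hρ2.le
        _ = (|c 1| * |τ|) / ‖(ρ : ℂ)‖ ^ 2 := by ring
        _ ≤ (|c 1| * s * (τ ^ 2 / s ^ 2) + |c 1| * |τ|) / ‖(ρ : ℂ)‖ ^ 2 :=
            div_le_div_of_nonneg_right (by linarith) hρ2.le
    · -- `n ≥ 1`
      simp only [hA, show n ≠ 0 by omega, if_false, add_zero]
      have hre : |((((ρ : ℂ))⁻¹) ^ (n + 1)).re| ≤ (‖(ρ : ℂ)‖ ^ (n + 1))⁻¹ := by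
        refine (Complex.abs_re_le_norm _).trans ?_
        rw [norm_pow, norm_inv, inv_pow]
      obtain ⟨k, rfl⟩ : ∃ k, n = k + 1 := ⟨n - 1, by omega⟩
      have hτk : |τ| ^ k ≤ (s * ‖(ρ : ℂ)‖) ^ k := pow_le_pow_left₀ (abs_nonneg τ) (hsρ ρ) _
      calc |c (k + 1 + 1)| * |τ| ^ (k + 1 + 1) * |((((ρ : ℂ))⁻¹) ^ (k + 1 + 1)).re|
          ≤ |c (k + 1 + 1)| * (τ ^ 2 * (s * ‖(ρ : ℂ)‖) ^ k) * (‖(ρ : ℂ)‖ ^ (k + 1 + 1))⁻¹ := by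
            refine mul_le_mul (mul_le_mul_of_nonneg_left ?_ (abs_nonneg _)) hre (abs_nonneg _)
              (by positivity)
            rw [show |τ| ^ (k + 1 + 1) = τ ^ 2 * |τ| ^ k by rw [← sq_abs]; ring]
            exact mul_le_mul_of_nonneg_left hτk (by positivity)
        _ = |c (k + 1 + 1)| * s ^ (k + 1 + 1) * (τ ^ 2 / s ^ 2) / ‖(ρ : ℂ)‖ ^ 2 := by
            field_simp
            ring
  have hprod : Summable (fun q : ZetaZeros.riemannZetaNontrivialZeros × ℕ ↦
      (m q.1 / ‖(q.1 : ℂ)‖ ^ 2) * A q.2) :=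
    summable_zeroOrder_div_norm_sq'.mul_of_nonneg hAs
      (fun ρ ↦ div_nonneg (hm0 ρ) (by positivity)) hA0
  have hGsum : Summable G := Summable.of_norm_bounded hprod hdom
  -- fibres over `ρ`: the binomial series of one zero
  have hfib : ∀ ρ : ZetaZeros.riemannZetaNontrivialZeros, HasSum (fun n ↦ G (ρ, n))
      (m ρ * (1 - ((ρ : ℂ) / ((ρ : ℂ) - τ)) ^ (x : ℂ)).re) := by
    intro ρ
    have hρ0 := zero_ne_zero' ρ
    have hρ := norm_pos_iff.2 hρ0
    have hρτ : (ρ : ℂ) - τ ≠ 0 := sub_ne_zero.2 (zero_ne_ofReal ρ τ)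
    set w : ℂ := (τ : ℂ) / (ρ : ℂ) with hw
    have hw1 : ‖w‖ < 1 := by
      rw [hw, norm_div, Complex.norm_real, Real.norm_eq_abs, div_lt_one hρ]
      exact hτρ _ ρ.2
    have H := hasSum_inv_one_sub_cpow hw1 x
    have hu : (1 - w)⁻¹ = (ρ : ℂ) / ((ρ : ℂ) - τ) := by rw [hw]; field_simp
    rw [hu] at H
    simp only [hcn] at H
    -- drop the `n = 0` term and take `−m · Re`
    have H1 := (hasSum_nat_add_iff' 1).2 H
    rw [Finset.sum_range_one, pow_zero, mul_one, hc0, Complex.ofReal_one] at H1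
    have H2 := (H1.mapL Complex.reCLM).mul_left (-m ρ)
    simp only [Complex.reCLM_apply] at H2
    have hfun : (fun n ↦ G (ρ, n)) =
        fun n ↦ -m ρ * ((((c (n + 1)) : ℝ) : ℂ) * w ^ (n + 1)).re := by
      funext n
      show -(m ρ * (c (n + 1) * τ ^ (n + 1) * ((((ρ : ℂ))⁻¹) ^ (n + 1)).re)) =
        -m ρ * ((((c (n + 1)) : ℝ) : ℂ) * w ^ (n + 1)).re
      rw [show ((c (n + 1) : ℝ) : ℂ) * w ^ (n + 1) =
        (((c (n + 1) * τ ^ (n + 1) : ℝ)) : ℂ) * (((ρ : ℂ))⁻¹) ^ (n + 1) by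
          rw [hw, div_eq_mul_inv, mul_pow]; push_cast; ring, Complex.re_ofReal_mul]
      ring
    have hval : m ρ * (1 - ((ρ : ℂ) / ((ρ : ℂ) - τ)) ^ (x : ℂ)).re =
        -m ρ * (((ρ : ℂ) / ((ρ : ℂ) - τ)) ^ (x : ℂ) - 1).re := by
      rw [Complex.sub_re, Complex.sub_re, Complex.one_re]; ring
    rw [hfun, hval]
    exact H2
  -- the sum over the zeros is the sum of the double family
  have h1 : HasSum (fun ρ : ZetaZeros.riemannZetaNontrivialZeros ↦
      m ρ * (1 - ((ρ : ℂ) / ((ρ : ℂ) - τ)) ^ (x : ℂ)).re) (∑' q, G q) :=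
    hGsum.hasSum.prod_fiberwise hfib
  -- fibres over `n`: the power sums
  have hswap : HasSum (G ∘ (Equiv.prodComm ℕ ZetaZeros.riemannZetaNontrivialZeros))
      (∑' q, G q) := (Equiv.hasSum_iff _).2 hGsum.hasSum
  have hfib2 : ∀ n : ℕ, HasSum (fun ρ : ZetaZeros.riemannZetaNontrivialZeros ↦
      (G ∘ (Equiv.prodComm ℕ ZetaZeros.riemannZetaNontrivialZeros)) (n, ρ))
      (-(c (n + 1) * τ ^ (n + 1)) * (zetaZeroPowerSum (n + 1)).re) := by
    intro n
    rw [re_zetaZeroPowerSum_eq_tsum (by omega : 1 ≤ n + 1)]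
    have H := (summable_zeroOrder_mul_re_inv_pow (k := n + 1) (by omega)).hasSum.mul_left
      (-(c (n + 1) * τ ^ (n + 1)))
    refine H.congr_fun fun ρ ↦ ?_
    simp only [Function.comp_apply, Equiv.prodComm_apply, Prod.swap_prod_mk, hG, hm]
    ring
  have h2 : HasSum (fun n : ℕ ↦ -(c (n + 1) * τ ^ (n + 1)) * (zetaZeroPowerSum (n + 1)).re)
      (∑' q, G q) := hswap.prod_fiberwise hfib2
  -- assemble: `F(x,τ) = τ⁻¹ Σ_ρ … = τ⁻¹ Σ_n c_{n+1} τ^{n+1} ℓ_n`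
  have hF : freitasF x τ = τ⁻¹ * ∑' q, G q := by
    rw [freitasF, if_neg hτ, h1.tsum_eq]
  rw [hF]
  have h3 := h2.mul_left τ⁻¹
  refine h3.congr_fun fun n ↦ ?_
  have e1 : τ⁻¹ * (-(c (n + 1) * τ ^ (n + 1)) * (zetaZeroPowerSum (n + 1)).re) =
      -(c (n + 1) * τ ^ n) * (zetaZeroPowerSum (n + 1)).re := by
    rw [pow_succ]
    field_simp
  rw [e1, freitasEllCoeff_zero_eq_neg_re_zetaZeroPowerSum, ← hcn (n + 1)]
  ring

end ThmFiveOne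

end Literature.NumberTheory.LFunctions
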